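import Literature.MathematicalPhysics.QuantumLattice.FermiRG.BGM2003SectorCountingProof
import HarnessLib

/-!
# Benfatto–Giuliani–Mastropietro 2003, Lemma 3.1 WITH A TARGET VECTOR («umklapp strings») and a transversality parameter — PROOF

Topic `Literature/MathematicalPhysics/QuantumLattice/FermiRG`; companion of `BGM2003SectorCountingProof.lean` (the printed Lemma 3.1,
momentum conservation `Σ k = 0` in `ℝ²`).  Cell gate-hubbard-kl, seat p4 g13, memo HOME/prover-p4/ON-CLASS-KB.md «CLAIM U»: on the square
lattice at the programme's fillings, momentum is conserved modulo `2πℤ²`, and the relative sector count is needed ALSO for strings whose momenta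
sum to a NON-ZERO reciprocal vector `R = 2πG` (the «umklapp-active» coarse tuples of the cell's split re-measurement rows).  The printed proof
(§7.4) uses `Σ = 0` at exactly one line — (s1.34), `wedge_bound`: the anchored leg is parallel (mod `π`) to the bundle of the other legs.  With a
target `R ≠ 0` that conclusion can fail (the anchored leg may be TRANSVERSAL to a collinear bundle: the «umklapp corners» of the cell's
COUNTING-NOTE-2), so here it is a HYPOTHESIS with a free angle `Ψ` (anchored leg within `Ψ` of every other leg), and the price of transversality
is carried explicitly: Lemma 7.5 is applied with `η = K₂·L_Ψ·δ₂`, `L_Ψ := L + c₂Ψ/(K₁Φ)`, in the regime `K₂ L_Ψ c₃ 2^{−n′} ≤ c₂′ Φ`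
(`Φ ≳ max(L·2^{−n′}, √(Ψ·2^{−n′}))`), so the solved pair is pinned to `O(L_Ψ²)` grid pairs instead of `O(L²)`:

* `string_box_target` ((s1.38)–(s1.40) with target and wedge hypothesis), `string_data_target`;
* `fibre_large_target`, `fibre_small_target`, `fibre_bound_target` (the two regimes of the solved pair), `class_bound_target`;
* **`count_target`**: `#{target strings anchored at ω₁, refining ωt, anchored leg within Ψ of the others} ≤ L² · B_fib · (3·2^{n′−n})^{L−3}` for every
  admissible regime parameter `Φ` and `B_fib ≥ (2(2Φ/w′+1))² + max((2(2c₀K₂c₃/π+1)L_Ψ)², 4c₃²K₂²L_Ψ²/η₀²)`.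
For the bulk of the umklapp-active tuples (anchored leg inside the bundle's angular spread, `Ψ ≲ L·spread`) this is the printed `(L−3)` count with
constants `O(L²)`; near the corners it quantifies the loss (`L_Ψ/L ≍ 1 + Ψ/(LΦ)`).

The file-private geometric bricks of `BGM2003SectorCountingProof.lean` that the adapted proofs use (frame dot products, torus distance, grid
counts, `pair_pinned`, …) are repeated here VERBATIM as private lemmas (they are not importable); the public `fermiPoint_support` /
`fermiSum_eq_cases` are imported.  Theorem-only; no definitions, no named facts; nothing here asserts anything about the Hubbard model.
-/

noncomputable section

open Real Set

namespace Literature.MathematicalPhysics.QuantumLattice.FermiRG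

namespace BGM2003

section Bricks

variable {ε : (Fin 2 → ℝ) → ℝ} {μ e₀ : ℝ} {u : ℝ → ℝ → ℝ}

/-! ### File-private bricks of `BGM2003SectorCountingProof.lean`, repeated verbatim (not importable) -/

/-- `|0| ≤ e₀`. [folklore] -/
private theorem abs_zero_le_e₀ (hD : DispersionHyp ε μ e₀ u) : |(0 : ℝ)| ≤ e₀ := by
  rw [abs_zero]; exact hD.e₀_pos.le

/-- Components of `n⃗`. [folklore] -/
private theorem unitNormal_eq' (u : ℝ → ℝ → ℝ) (θ e : ℝ) :
    unitNormal u θ e = ![(speed u θ e)⁻¹ * u θ e * Real.cos θ + (speed u θ e)⁻¹ * radiusDeriv u θ e * Real.sin θ,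
      (speed u θ e)⁻¹ * u θ e * Real.sin θ - (speed u θ e)⁻¹ * radiusDeriv u θ e * Real.cos θ] := by
  ext i; fin_cases i <;> simp [unitNormal, dir, tdir] <;> ring

/-- Components of `τ⃗`. [folklore] -/
private theorem unitTangent_eq' (u : ℝ → ℝ → ℝ) (θ e : ℝ) :
    unitTangent u θ e = ![(speed u θ e)⁻¹ * radiusDeriv u θ e * Real.cos θ - (speed u θ e)⁻¹ * u θ e * Real.sin θ,
      (speed u θ e)⁻¹ * radiusDeriv u θ e * Real.sin θ + (speed u θ e)⁻¹ * u θ e * Real.cos θ] := by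
  ext i; fin_cases i <;> simp [unitTangent, dir, tdir] <;> ring

/-- `cos(arctan(b/a)) = a/√(b² + a²)` and `sin(arctan(b/a)) = b/√(b² + a²)` for `a > 0`. [folklore] -/
private theorem cos_sin_arctan_ratio' {a b : ℝ} (ha : 0 < a) :
    Real.cos (Real.arctan (b / a)) = a / Real.sqrt (b ^ 2 + a ^ 2) ∧
      Real.sin (Real.arctan (b / a)) = b / Real.sqrt (b ^ 2 + a ^ 2) := by
  have hsq : Real.sqrt (1 + (b / a) ^ 2) = Real.sqrt (b ^ 2 + a ^ 2) / a := by
    rw [show 1 + (b / a) ^ 2 = (b ^ 2 + a ^ 2) / a ^ 2 by field_simp; ring,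
      Real.sqrt_div (by positivity), Real.sqrt_sq ha.le]
  have hpos : 0 < Real.sqrt (b ^ 2 + a ^ 2) := Real.sqrt_pos.2 (by positivity)
  rw [Real.cos_arctan, Real.sin_arctan, hsq]
  constructor
  · field_simp
  · field_simp

/-- `n⃗(θ,e) = (cos α(θ,e), sin α(θ,e))` (`u > 0`). [cite: BenfattoGiulianiMastropietro2003, §7.1 Lemma 7.1 p.26 (L54–58)] -/
private theorem unitNormal_angle' {θ e : ℝ} (hu : 0 < u θ e) :
    unitNormal u θ e = ![Real.cos (normalAngle u θ e), Real.sin (normalAngle u θ e)] := by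
  obtain ⟨hc, hs⟩ := cos_sin_arctan_ratio' (b := radiusDeriv u θ e) hu
  rw [unitNormal_eq', normalAngle, Real.cos_sub, Real.sin_sub, hc, hs, speed]
  ext i; fin_cases i <;> simp <;> ring

/-- `τ⃗(θ,e) = (-sin α(θ,e), cos α(θ,e))` (`u > 0`). [cite: BenfattoGiulianiMastropietro2003, §7.1 (A1.6)–(A1.7) p.26 (L35–52)] -/
private theorem unitTangent_angle' {θ e : ℝ} (hu : 0 < u θ e) :
    unitTangent u θ e = ![-Real.sin (normalAngle u θ e), Real.cos (normalAngle u θ e)] := by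
  obtain ⟨hc, hs⟩ := cos_sin_arctan_ratio' (b := radiusDeriv u θ e) hu
  rw [unitTangent_eq', normalAngle, Real.cos_sub, Real.sin_sub, hc, hs, speed]
  ext i; fin_cases i <;> simp <;> ring

/-- `n⃗(t) · n⃗(θ') = cos(α(t) - α(θ'))`. [folklore] -/
private theorem normal_dot_normal' {t θ' : ℝ} (ht : 0 < u t 0) (hθ' : 0 < u θ' 0) :
    unitNormal u t 0 ⬝ᵥ unitNormal u θ' 0 = Real.cos (normalAngle u t 0 - normalAngle u θ' 0) := by
  rw [unitNormal_angle' ht, unitNormal_angle' hθ', Real.cos_sub]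
  simp [dotProduct, Fin.sum_univ_two]

/-- `τ⃗(t) · n⃗(θ') = -sin(α(t) - α(θ'))`. [cite: BenfattoGiulianiMastropietro2003, §7.1 (A1.10) p.26 (L64–66)] -/
private theorem tangent_dot_normal' {t θ' : ℝ} (ht : 0 < u t 0) (hθ' : 0 < u θ' 0) :
    unitTangent u t 0 ⬝ᵥ unitNormal u θ' 0 = -Real.sin (normalAngle u t 0 - normalAngle u θ' 0) := by
  rw [unitTangent_angle' ht, unitNormal_angle' hθ', Real.sin_sub]
  simp [dotProduct, Fin.sum_univ_two]; ring

/-- `n⃗(t) · τ⃗(θ') = sin(α(t) - α(θ'))`. [folklore] -/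
private theorem normal_dot_tangent' {t θ' : ℝ} (ht : 0 < u t 0) (hθ' : 0 < u θ' 0) :
    unitNormal u t 0 ⬝ᵥ unitTangent u θ' 0 = Real.sin (normalAngle u t 0 - normalAngle u θ' 0) := by
  rw [unitNormal_angle' ht, unitTangent_angle' hθ', Real.sin_sub]
  simp [dotProduct, Fin.sum_univ_two]; ring

/-- `τ⃗(t) · τ⃗(θ') = cos(α(t) - α(θ'))`. [folklore] -/
private theorem tangent_dot_tangent' {t θ' : ℝ} (ht : 0 < u t 0) (hθ' : 0 < u θ' 0) :
    unitTangent u t 0 ⬝ᵥ unitTangent u θ' 0 = Real.cos (normalAngle u t 0 - normalAngle u θ' 0) := by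
  rw [unitTangent_angle' ht, unitTangent_angle' hθ', Real.cos_sub]
  simp [dotProduct, Fin.sum_univ_two]; ring

/-- Orthonormal decomposition in the frame `(n⃗(θ), τ⃗(θ))` at `e = 0`: `v = (v·n⃗)n⃗ + (v·τ⃗)τ⃗`. [folklore] -/
private theorem frame_decomp' {θ : ℝ} (hu : 0 < u θ 0) (v : Fin 2 → ℝ) :
    v = (v ⬝ᵥ unitNormal u θ 0) • unitNormal u θ 0 + (v ⬝ᵥ unitTangent u θ 0) • unitTangent u θ 0 := by
  have hcs := Real.sin_sq_add_cos_sq (normalAngle u θ 0)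
  rw [unitNormal_angle' hu, unitTangent_angle' hu]
  ext i; fin_cases i
  · simp [dotProduct, Fin.sum_univ_two]
    linear_combination (-(v 0)) * hcs
  · simp [dotProduct, Fin.sum_univ_two]
    linear_combination (-(v 1)) * hcs

/-- `‖θ‖_{𝕋¹} ≤ π`. [folklore] -/
private theorem torusDist_le_pi' (x : ℝ) : torusDist x ≤ π := by
  have h := AddCircle.norm_le_half_period (2 * π) (x := ((x : ℝ) : AddCircle (2 * π))) two_pi_pos.ne'
  rw [abs_of_pos two_pi_pos] at h
  unfold torusDist
  linarith

/-- `0 ≤ ‖θ‖_{𝕋¹}`. [folklore] -/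
private theorem torusDist_nonneg (x : ℝ) : 0 ≤ torusDist x := norm_nonneg _

/-- `‖θ‖_{𝕋¹} = |θ|` when `|θ| ≤ π`. [folklore] -/
private theorem torusDist_eq_abs' {x : ℝ} (hx : |x| ≤ π) : torusDist x = |x| := by
  rw [torusDist, AddCircle.norm_coe_eq_abs_iff (2 * π) two_pi_pos.ne', abs_of_pos two_pi_pos]
  linarith

/-- The representative of `θ` in `[-π, π]` modulo `2π`: `‖θ‖_{𝕋¹} = |θ - 2πk|` with
`k = round(θ/2π)`. [folklore] -/
private theorem torusDist_eq_abs_sub_round' (x : ℝ) :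
    torusDist x = |x - round ((2 * π)⁻¹ * x) * (2 * π)| := by
  rw [torusDist, AddCircle.norm_eq]

/-- `‖θ + 2πk‖_{𝕋¹} = ‖θ‖_{𝕋¹}`. [folklore] -/
private theorem torusDist_add_int_mul' (x : ℝ) (k : ℤ) : torusDist (x + k * (2 * π)) = torusDist x := by
  unfold torusDist
  have h : ((x + k * (2 * π) : ℝ) : AddCircle (2 * π)) = ((x : ℝ) : AddCircle (2 * π)) := by
    rw [← sub_eq_zero, ← AddCircle.coe_sub, AddCircle.coe_eq_zero_iff]
    exact ⟨k, by rw [zsmul_eq_mul]; ring⟩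
  rw [h]

/-- `‖θ‖_{𝕋¹} ≤ |θ|`. [folklore] -/
private theorem torusDist_le_abs' (x : ℝ) : torusDist x ≤ |x| := by
  unfold torusDist
  exact QuotientAddGroup.norm_mk_le_norm.trans (le_of_eq (Real.norm_eq_abs _))

/-- `‖θ‖_{𝕋¹} = 0` iff `θ ∈ 2πℤ`. [folklore] -/
private theorem torusDist_eq_zero_iff (x : ℝ) : torusDist x = 0 ↔ ∃ k : ℤ, x = k * (2 * π) := by
  unfold torusDist
  rw [norm_eq_zero, AddCircle.coe_eq_zero_iff]
  constructor
  · rintro ⟨k, hk⟩; exact ⟨k, by rw [← hk, zsmul_eq_mul]⟩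
  · rintro ⟨k, hk⟩; exact ⟨k, by rw [hk, zsmul_eq_mul]⟩

/-- A decomposition `θ = 2πk + d̃` with `|d̃| = ‖θ‖_{𝕋¹} ≤ π`. [folklore] -/
private theorem torusDist_rep (x : ℝ) : ∃ (k : ℤ) (d : ℝ), x = d + k * (2 * π) ∧ |d| ≤ π ∧ torusDist x = |d| := by
  refine ⟨round ((2 * π)⁻¹ * x), x - round ((2 * π)⁻¹ * x) * (2 * π), by ring, ?_, torusDist_eq_abs_sub_round' x⟩
  rw [← torusDist_eq_abs_sub_round']; exact torusDist_le_pi' x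

/-- `|sin θ| ≤ ‖θ‖_{𝕋¹}`. [folklore] -/
private theorem abs_sin_le_torusDist (x : ℝ) : |Real.sin x| ≤ torusDist x := by
  obtain ⟨k, d, hx, -, hd⟩ := torusDist_rep x
  rw [hd, hx, Real.sin_add_int_mul_two_pi]
  exact Real.abs_sin_le_abs

/-- `‖0‖_{𝕋¹} = 0`. [folklore] -/
private theorem torusDist_zero : torusDist 0 = 0 := by
  rw [torusDist_eq_zero_iff]; exact ⟨0, by simp⟩

/-- `‖θ - π‖_{𝕋¹} = π - ‖θ‖_{𝕋¹}`. [folklore] -/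
private theorem torusDist_sub_pi (x : ℝ) : torusDist (x - π) = π - torusDist x := by
  obtain ⟨k, d, hx, hdπ, hd⟩ := torusDist_rep x
  rw [hd]
  rcases le_or_gt 0 d with h | h
  · have : x - π = (d - π) + k * (2 * π) := by rw [hx]; ring
    rw [this, torusDist_add_int_mul', torusDist_eq_abs' (by rw [abs_of_nonpos (by linarith [(abs_le.1 hdπ).2])]; linarith [(abs_le.1 hdπ).2]),
      abs_of_nonneg h, abs_of_nonpos (by linarith [(abs_le.1 hdπ).2])]
    ring
  · have : x - π = (d + π) + (k - 1 : ℤ) * (2 * π) := by rw [hx]; push_cast; ring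
    rw [this, torusDist_add_int_mul', torusDist_eq_abs' (by rw [abs_of_nonneg (by linarith [(abs_le.1 hdπ).1])]; linarith),
      abs_of_neg h, abs_of_nonneg (by linarith [(abs_le.1 hdπ).1])]
    ring

/-- `0 ≤ φ ≤ π/2`, `φ ≤ ‖θ₁ - θ₂‖`. [folklore] -/
private theorem pairAngle_bounds (θ₁ θ₂ : ℝ) :
    0 ≤ pairAngle θ₁ θ₂ ∧ pairAngle θ₁ θ₂ ≤ π / 2 ∧ pairAngle θ₁ θ₂ ≤ torusDist (θ₁ - θ₂) := by
  refine ⟨le_min (torusDist_nonneg _) (by linarith [torusDist_le_pi' (θ₁ - θ₂)]), ?_, min_le_left _ _⟩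
  rw [pairAngle]
  rcases le_or_gt (torusDist (θ₁ - θ₂)) (π / 2) with h | h
  · exact (min_le_left _ _).trans h
  · exact (min_le_right _ _).trans (by linarith)

/-- `φ(θ, θ) = 0`. [folklore] -/
private theorem pairAngle_self' (θ : ℝ) : pairAngle θ θ = 0 := by
  have h := pairAngle_bounds θ θ
  rw [sub_self, torusDist_zero] at h
  linarith [h.1, h.2.2]

/-- Jordan's inequality on the circle of length `π`: `(2/π) φ(θ₁,θ₂) ≤ |sin(θ₁ - θ₂)|`. [folklore] -/
private theorem pairAngle_le_abs_sin (θ₁ θ₂ : ℝ) : 2 / π * pairAngle θ₁ θ₂ ≤ |Real.sin (θ₁ - θ₂)| := by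
  obtain ⟨k, d, hx, hdπ, hd⟩ := torusDist_rep (θ₁ - θ₂)
  rw [pairAngle, hd, hx, Real.sin_add_int_mul_two_pi]
  -- `|sin d| = sin |d|` and Jordan on `[0, π]`
  have hsin : |Real.sin d| = Real.sin |d| := by
    rcases le_or_gt 0 d with h | h
    · rw [abs_of_nonneg h]
      exact abs_of_nonneg (Real.sin_nonneg_of_nonneg_of_le_pi h (by linarith [(abs_le.1 hdπ).2]))
    · rw [abs_of_neg h, Real.sin_neg]
      exact abs_of_nonpos (by
        have := Real.sin_nonneg_of_nonneg_of_le_pi (by linarith : 0 ≤ -d) (by linarith [(abs_le.1 hdπ).1])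
        rw [Real.sin_neg] at this; linarith)
  rw [hsin]
  set y := |d| with hy
  have hy0 : 0 ≤ y := abs_nonneg _
  rcases le_or_gt y (π / 2) with h | h
  · calc 2 / π * min y (π - y) ≤ 2 / π * y := mul_le_mul_of_nonneg_left (min_le_left _ _) (by positivity)
      _ ≤ Real.sin y := Real.mul_le_sin hy0 h
  · have h1 : 0 ≤ π - y := by linarith
    have h2 : π - y ≤ π / 2 := by linarith
    calc 2 / π * min y (π - y) ≤ 2 / π * (π - y) := mul_le_mul_of_nonneg_left (min_le_right _ _) (by positivity)
      _ ≤ Real.sin (π - y) := Real.mul_le_sin h1 h2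
      _ = Real.sin y := Real.sin_pi_sub y

/-- `φ(θ₁, θ₂) > 0 ⟹ (θ₁, θ₂) ∈ 𝒯`. [folklore] -/
private theorem mem_pairChartDomain_of_pos {θ₁ θ₂ : ℝ} (h : 0 < pairAngle θ₁ θ₂) : (θ₁, θ₂) ∈ pairChartDomain := by
  have h1 := pairAngle_le_abs_sin θ₁ θ₂
  have : 0 < |Real.sin (θ₁ - θ₂)| := lt_of_lt_of_le (by positivity) h1
  exact abs_pos.1 this

/-- With `α` `c₂`-Lipschitz on `𝕋¹` and `α(θ+π) = α(θ)+π` (Lemma 7.1):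
`|sin(α(t) - α(θ'))| ≤ c₂ φ(t, θ')`. [cite: BenfattoGiulianiMastropietro2003, §7.1 Lemma 7.1 (A1.9) p.26 (L54–63)] -/
private theorem abs_sin_normalAngle_sub_le {c₂ : ℝ}
    (hlip : ∀ θ₁ θ₂ : ℝ, torusDist (normalAngle u θ₂ 0 - normalAngle u θ₁ 0) ≤ c₂ * torusDist (θ₂ - θ₁))
    (hpi : ∀ θ : ℝ, normalAngle u (θ + π) 0 = normalAngle u θ 0 + π) (t θ' : ℝ) :
    |Real.sin (normalAngle u t 0 - normalAngle u θ' 0)| ≤ c₂ * pairAngle t θ' := by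
  have hc₂ : 0 ≤ c₂ := by
    have h := hlip 0 π
    have hπ : torusDist (π - 0) = π := by
      rw [sub_zero, torusDist_eq_abs' (by rw [abs_of_pos pi_pos]), abs_of_pos pi_pos]
    rw [hπ] at h
    nlinarith [torusDist_nonneg (normalAngle u π 0 - normalAngle u 0 0), pi_pos]
  have h1 : |Real.sin (normalAngle u t 0 - normalAngle u θ' 0)| ≤ c₂ * torusDist (t - θ') :=
    (abs_sin_le_torusDist _).trans (hlip θ' t)
  have h2 : |Real.sin (normalAngle u t 0 - normalAngle u θ' 0)| ≤ c₂ * (π - torusDist (t - θ')) := by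
    have h := (abs_sin_le_torusDist _).trans (hlip (θ' + π) t)
    rw [hpi θ', show normalAngle u t 0 - (normalAngle u θ' 0 + π) = normalAngle u t 0 - normalAngle u θ' 0 - π by ring,
      Real.sin_sub_pi, abs_neg, show t - (θ' + π) = t - θ' - π by ring, torusDist_sub_pi] at h
    exact h
  unfold pairAngle
  rcases le_or_gt (torusDist (t - θ')) (π - torusDist (t - θ')) with h | h
  · rw [min_eq_left h]; exact h1
  · rw [min_eq_right h.le]; exact h2

/-- `N w_n = 2^{n+1} · π/2^n = 2π`. [folklore] -/
private theorem sectorCount_mul_sectorWidth (n : ℕ) : (sectorCount n : ℝ) * sectorWidth n = 2 * π := by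
  rw [sectorCount, sectorWidth]; push_cast; rw [pow_succ]; field_simp

/-- `w_n = π 2^{-n} = π γ^{h/2}` (`γ = 4`, `h = -n`). [folklore] -/
private theorem sectorWidth_eq_zpow (n : ℕ) : sectorWidth n = π * (2 : ℝ) ^ (-(n : ℤ)) := by
  rw [sectorWidth, zpow_neg, zpow_natCast, div_eq_mul_inv]

open Classical in
/-- **Grid counting on the circle.** The number of sector centres `θ_{n,ω} = (ω + ½)w_n`,
`ω < N = 2^{n+1}`, within distance `D` of `θ*` modulo `2π` is at most `2D/w_n + 1`. [folklore] -/
private theorem card_centres_near_le (n : ℕ) (θs D : ℝ) (hD0 : 0 ≤ D) :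
    ((Finset.univ.filter (fun a : Fin (sectorCount n) =>
        ∃ k : ℤ, |sectorCenter n a - θs - k * (2 * π)| ≤ D)).card : ℝ) ≤ 2 * D / sectorWidth n + 1 := by
  classical
  set w := sectorWidth n with hw
  have hwpos : 0 < w := sectorWidth_pos n
  set N := sectorCount n with hN
  have hNw : (N : ℝ) * w = 2 * π := sectorCount_mul_sectorWidth n
  set W := Finset.univ.filter (fun a : Fin (sectorCount n) => ∃ k : ℤ, |sectorCenter n a - θs - k * (2 * π)| ≤ D)
    with hW
  -- the chosen winding numbers
  have hk : ∀ a ∈ W, ∃ k : ℤ, |sectorCenter n a - θs - k * (2 * π)| ≤ D := fun a ha =>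
    (Finset.mem_filter.1 ha).2
  choose! kf hkf using hk
  -- the injection into an integer interval
  set lo : ℤ := ⌈(θs - D) / w - 1 / 2⌉ with hlo
  set hi : ℤ := ⌊(θs + D) / w - 1 / 2⌋ with hhi
  set f : Fin (sectorCount n) → ℤ := fun a => (a : ℤ) - kf a * N with hf
  have hcen : ∀ a : Fin (sectorCount n), sectorCenter n a = ((a : ℕ) + 1 / 2 : ℝ) * w := fun a => rfl
  have hmaps : Set.MapsTo f W (Finset.Icc lo hi) := by
    intro a ha
    have h := hkf a ha
    rw [hcen] at h
    have hval : ((f a : ℝ) + 1 / 2) * w = ((a : ℕ) + 1 / 2 : ℝ) * w - kf a * (2 * π) := by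
      rw [hf]; push_cast; rw [← hNw]; ring
    have h1 : θs - D ≤ ((f a : ℝ) + 1 / 2) * w := by rw [hval]; linarith [(abs_le.1 h).1]
    have h2 : ((f a : ℝ) + 1 / 2) * w ≤ θs + D := by rw [hval]; linarith [(abs_le.1 h).2]
    rw [Finset.coe_Icc, Set.mem_Icc]
    constructor
    · rw [hlo]
      apply Int.ceil_le.2
      have : (θs - D) / w ≤ (f a : ℝ) + 1 / 2 := by rw [div_le_iff₀ hwpos]; exact h1
      linarith
    · rw [hhi]
      apply Int.le_floor.2
      have : (f a : ℝ) + 1 / 2 ≤ (θs + D) / w := by rw [le_div_iff₀ hwpos]; exact h2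
      linarith
  have hinj : Set.InjOn f W := by
    intro a ha b hb hab
    simp only [hf] at hab
    have hlt_a : ((a : ℕ) : ℤ) < N := by exact_mod_cast a.isLt
    have hlt_b : ((b : ℕ) : ℤ) < N := by exact_mod_cast b.isLt
    have h0a : (0 : ℤ) ≤ (a : ℕ) := by positivity
    have h0b : (0 : ℤ) ≤ (b : ℕ) := by positivity
    have hdiff : ((a : ℕ) : ℤ) - (b : ℕ) = (kf a - kf b) * N := by linarith
    have hk0 : kf a - kf b = 0 := by
      have hNpos : (0 : ℤ) < N := by exact_mod_cast sectorCount_pos n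
      have h1 : |(kf a - kf b) * (N : ℤ)| < N := by
        rw [← hdiff, abs_lt]; constructor <;> linarith
      rw [abs_mul, abs_of_pos hNpos] at h1
      have : |kf a - kf b| < 1 := by
        by_contra hcon
        have h2 := not_lt.1 hcon
        nlinarith
      exact Int.abs_lt_one_iff.1 this
    have : ((a : ℕ) : ℤ) = (b : ℕ) := by rw [hk0, zero_mul] at hdiff; linarith
    exact Fin.ext (by exact_mod_cast this)
  have hcard := Finset.card_le_card_of_injOn f hmaps hinj
  rw [Int.card_Icc] at hcard
  have hreal : ((hi + 1 - lo).toNat : ℝ) ≤ 2 * D / w + 1 := by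
    rcases le_or_gt (hi + 1 - lo) 0 with hneg | hpos
    · rw [Int.toNat_of_nonpos hneg]; push_cast; positivity
    · have : ((hi + 1 - lo).toNat : ℤ) = hi + 1 - lo := Int.toNat_of_nonneg hpos.le
      have h1 : ((hi + 1 - lo).toNat : ℝ) = (hi : ℝ) + 1 - lo := by exact_mod_cast this
      rw [h1]
      have hhi' : (hi : ℝ) ≤ (θs + D) / w - 1 / 2 := Int.floor_le _
      have hlo' : (θs - D) / w - 1 / 2 ≤ (lo : ℝ) := Int.le_ceil _
      have : (θs + D) / w - 1 / 2 - ((θs - D) / w - 1 / 2) = 2 * D / w := by field_simp; ring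
      linarith
  exact (Nat.cast_le.2 hcard).trans hreal

open Classical in
/-- Grid counting, torus-distance form: at most `2D/w_n + 1` centres within `‖·‖_{𝕋¹}`-distance `D`
of `θ*`. [folklore] -/
private theorem card_centres_torus_le (n : ℕ) (θs D : ℝ) (hD0 : 0 ≤ D) :
    ((Finset.univ.filter (fun a : Fin (sectorCount n) =>
        torusDist (sectorCenter n a - θs) ≤ D)).card : ℝ) ≤ 2 * D / sectorWidth n + 1 := by
  refine le_trans ?_ (card_centres_near_le n θs D hD0)
  have hsub : Finset.univ.filter (fun a : Fin (sectorCount n) => torusDist (sectorCenter n a - θs) ≤ D) ⊆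
      Finset.univ.filter (fun a : Fin (sectorCount n) =>
        ∃ k : ℤ, |sectorCenter n a - θs - k * (2 * π)| ≤ D) := by
    intro a ha
    rw [Finset.mem_filter] at ha ⊢
    exact ⟨ha.1, round ((2 * π)⁻¹ * (sectorCenter n a - θs)), by rw [← torusDist_eq_abs_sub_round']; exact ha.2⟩
  exact_mod_cast Finset.card_le_card hsub

open Classical in
/-- Grid counting modulo `π`: at most `2(2D/w_n + 1)` centres with `φ(θ_{n,ω}, θ*) ≤ D`. [folklore] -/
private theorem card_centres_modpi_le (n : ℕ) (θs D : ℝ) (hD0 : 0 ≤ D) :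
    ((Finset.univ.filter (fun a : Fin (sectorCount n) =>
        pairAngle (sectorCenter n a) θs ≤ D)).card : ℝ) ≤ 2 * (2 * D / sectorWidth n + 1) := by
  have h1 := card_centres_torus_le n θs D hD0
  have h2 := card_centres_torus_le n (θs + π) D hD0
  have hsub : Finset.univ.filter (fun a : Fin (sectorCount n) => pairAngle (sectorCenter n a) θs ≤ D) ⊆
      Finset.univ.filter (fun a : Fin (sectorCount n) => torusDist (sectorCenter n a - θs) ≤ D) ∪
      Finset.univ.filter (fun a : Fin (sectorCount n) => torusDist (sectorCenter n a - (θs + π)) ≤ D) := by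
    intro a ha
    rw [Finset.mem_filter] at ha
    rw [Finset.mem_union, Finset.mem_filter, Finset.mem_filter]
    have h := ha.2
    unfold pairAngle at h
    rcases min_le_iff.1 h with h' | h'
    · exact Or.inl ⟨Finset.mem_univ _, h'⟩
    · right
      refine ⟨Finset.mem_univ _, ?_⟩
      rw [show sectorCenter n a - (θs + π) = sectorCenter n a - θs - π by ring, torusDist_sub_pi]
      exact h'
  calc ((Finset.univ.filter (fun a : Fin (sectorCount n) => pairAngle (sectorCenter n a) θs ≤ D)).card : ℝ)
      ≤ ((Finset.univ.filter (fun a : Fin (sectorCount n) => torusDist (sectorCenter n a - θs) ≤ D) ∪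
          Finset.univ.filter (fun a : Fin (sectorCount n) =>
            torusDist (sectorCenter n a - (θs + π)) ≤ D)).card : ℝ) := by
        exact_mod_cast Finset.card_le_card hsub
    _ ≤ ((Finset.univ.filter (fun a : Fin (sectorCount n) => torusDist (sectorCenter n a - θs) ≤ D)).card : ℝ) +
          ((Finset.univ.filter (fun a : Fin (sectorCount n) =>
            torusDist (sectorCenter n a - (θs + π)) ≤ D)).card : ℝ) := by
        exact_mod_cast Finset.card_union_le _ _
    _ ≤ 2 * (2 * D / sectorWidth n + 1) := by linarith

/-- The Fermi point at a sector centre belongs to that sector: `p⃗_F(θ_{h,ω}) ∈ S_{h,ω}`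
(`ζ_{h,ω}(θ_{h,ω}) = 1`, plateau of the partition of unity). [cite: BenfattoGiulianiMastropietro2003, §2.6 (3.44a) p.13 (L101–106)] -/
private theorem fermiPoint_centre_mem_sSector (hD : DispersionHyp ε μ e₀ u) (n a : ℕ) :
    fermiPoint u (sectorCenter n a) ∈ sSector u e₀ n a := by
  refine ⟨sectorCenter n a, 0, ?_, ?_, rfl⟩
  · rw [abs_zero]; exact mul_nonneg (zpow_nonneg (by norm_num) _) hD.e₀_pos.le
  · have h1 : sectorWeightCirc n (a : ℤ) (sectorCenter n a) = 1 := by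
      apply sectorWeightCirc_eq_one (k := 0)
      rw [sectorCenter, Int.cast_natCast]
      have := (sectorWidth_pos n).le
      simp only [Int.cast_zero, mul_zero, sub_self, abs_zero]
      positivity
    rw [h1]; exact one_ne_zero

/-- `γ^{-h'/2}`-bookkeeping: `2^{-n} = 2^{n'-n} · 2^{-n'}` for `n ≤ n'`. [folklore] -/
private theorem zpow_split {n n' : ℕ} (hn : n ≤ n') :
    (2 : ℝ) ^ (-(n : ℤ)) = (2 : ℝ) ^ (n' - n) * (2 : ℝ) ^ (-(n' : ℤ)) := by
  obtain ⟨d, rfl⟩ := Nat.exists_eq_add_of_le hn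
  rw [Nat.add_sub_cancel_left, ← zpow_natCast, ← zpow_add₀ (by norm_num : (2 : ℝ) ≠ 0)]
  congr 1; push_cast; ring

open Classical in
/-- **(s1.23), counting form.** The number of scale-`h'` sectors contained in a given scale-`h`
sector is at most `3 γ^{(h-h')/2} = 3 · 2^{n'-n}`: such a sector contains its own Fermi centre point,
which by Lemma 7.2 lies within `πγ^{h/2}` of the coarse centre. [cite: BenfattoGiulianiMastropietro2003, §7.4 (s1.23) p.28 (L33–36)] -/
private theorem card_refinements_le (hD : DispersionHyp ε μ e₀ u) {n n' : ℕ} (hn : n ≤ n') {ωc : ℕ}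
    (hωc : ωc < sectorCount n) :
    (Finset.univ.filter (fun a : Fin (sectorCount n') => sSector u e₀ n' a ⊆ sSector u e₀ n ωc)).card ≤
      3 * 2 ^ (n' - n) := by
  obtain ⟨c, -, h72⟩ := lemma72_sectorPolar_holds ε μ e₀ u hD
  have h0 := abs_zero_le_e₀ hD
  obtain ⟨cu, hcu, hu⟩ := hD.u_pos
  set D := π * (2 : ℝ) ^ (-(n : ℤ)) with hDdef
  have hD0 : 0 ≤ D := by positivity
  have hsub : Finset.univ.filter (fun a : Fin (sectorCount n') => sSector u e₀ n' a ⊆ sSector u e₀ n ωc) ⊆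
      Finset.univ.filter (fun a : Fin (sectorCount n') => torusDist (sectorCenter n' a - sectorCenter n ωc) ≤ D) := by
    intro a ha
    rw [Finset.mem_filter] at ha ⊢
    refine ⟨ha.1, ?_⟩
    have hmem : fermiPoint u (sectorCenter n' a) ∈ sSector u e₀ n ωc := ha.2 (fermiPoint_centre_mem_sSector hD n' a)
    have hupos : 0 < u (sectorCenter n' a) 0 := lt_of_lt_of_le hcu (hu _ 0 h0)
    exact (h72 n ωc hωc _ hmem (u (sectorCenter n' a) 0) (sectorCenter n' a) hupos rfl).2
  have h1 := Finset.card_le_card hsub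
  have h2 := card_centres_torus_le n' (sectorCenter n ωc) D hD0
  have h3 : 2 * D / sectorWidth n' + 1 = 2 * (2 : ℝ) ^ (n' - n) + 1 := by
    rw [hDdef, sectorWidth_eq_zpow, zpow_split hn]
    have : (2 : ℝ) ^ (-(n' : ℤ)) ≠ 0 := (zpow_pos (by norm_num) _).ne'
    field_simp
  rw [h3] at h2
  have h4 : ((Finset.univ.filter (fun a : Fin (sectorCount n') => sSector u e₀ n' a ⊆ sSector u e₀ n ωc)).card : ℝ)
      ≤ 2 * (2 : ℝ) ^ (n' - n) + 1 := (Nat.cast_le.2 h1).trans h2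
  have h5 : (2 : ℝ) * 2 ^ (n' - n) + 1 ≤ 3 * 2 ^ (n' - n) := by
    have : (1 : ℝ) ≤ 2 ^ (n' - n) := one_le_pow₀ (by norm_num)
    linarith
  exact_mod_cast h4.trans h5

/-- **The solved pair is pinned (Lemma 7.5 + two-to-one).** If two chord sums differ by a vector
`r⃗` which, in the frame at `θ̄₁ = a₀`, has `|r₁| ≤ c₁ηφ₀`, `|r₂| ≤ η ≤ c₂φ₀`, `η ≤ η₀`
(`φ₀ = φ(a₀, b₀) > 0`), then Lemma 7.5 produces a solution `O(η)`-close to `(a₀, b₀)` and the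
two-to-one property of the chord-sum map identifies it with `(a, b)` up to exchange. [cite: BenfattoGiulianiMastropietro2003, §7.4 (s1.42) p.28 (L102–125)] -/
private theorem solved_pair_near (hD : DispersionHyp ε μ e₀ u) {c₁' c₀ c₂' η₀ : ℝ}
    (h75 : ∀ θ₁' θ₂' η r₁ r₂ : ℝ, (θ₁', θ₂') ∈ pairChartDomain →
        |r₁| ≤ c₁' * η * pairAngle θ₁' θ₂' → |r₂| ≤ η → η ≤ c₂' * pairAngle θ₁' θ₂' → η ≤ η₀ →
          fermiPoint u θ₁' + fermiPoint u θ₂' + (r₁ • unitNormal u θ₁' 0 + r₂ • unitTangent u θ₁' 0)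
              ∈ pairRange u ∧
          ∃ θ₁ θ₂ : ℝ,
            fermiPoint u θ₁' + fermiPoint u θ₂' + (r₁ • unitNormal u θ₁' 0 + r₂ • unitTangent u θ₁' 0) =
              fermiPoint u θ₁ + fermiPoint u θ₂ ∧
            |θ₁ - θ₁'| ≤ c₀ * η ∧ |θ₂ - θ₂'| ≤ c₀ * η)
    {a b a₀ b₀ η : ℝ} (r : Fin 2 → ℝ)
    (hF : fermiPoint u a + fermiPoint u b = fermiPoint u a₀ + fermiPoint u b₀ + r)
    (hφ₀ : 0 < pairAngle a₀ b₀) (hab : 0 < pairAngle a b)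
    (hr₁ : |r ⬝ᵥ unitNormal u a₀ 0| ≤ c₁' * η * pairAngle a₀ b₀) (hr₂ : |r ⬝ᵥ unitTangent u a₀ 0| ≤ η)
    (hη : η ≤ c₂' * pairAngle a₀ b₀) (hη₀ : η ≤ η₀) :
    (torusDist (a - a₀) ≤ c₀ * η ∧ torusDist (b - b₀) ≤ c₀ * η) ∨
      (torusDist (a - b₀) ≤ c₀ * η ∧ torusDist (b - a₀) ≤ c₀ * η) := by
  have h0 := abs_zero_le_e₀ hD
  obtain ⟨cu, hcu, hu⟩ := hD.u_pos
  have hupos : ∀ s, 0 < u s 0 := fun s => lt_of_lt_of_le hcu (hu s 0 h0)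
  have hframe := frame_decomp' (hupos a₀) r
  obtain ⟨-, θ₁, θ₂, hsol, h₁, h₂⟩ := h75 a₀ b₀ η (r ⬝ᵥ unitNormal u a₀ 0) (r ⬝ᵥ unitTangent u a₀ 0)
    (mem_pairChartDomain_of_pos hφ₀) hr₁ hr₂ hη hη₀
  rw [← hframe, ← hF] at hsol
  have hmod : ∀ {s t v : ℝ} (k : ℤ), s - t = k * (2 * π) → torusDist (t - v) ≤ |s - v| := by
    intro s t v k hk
    have : t - v = (s - v) + (-k : ℤ) * (2 * π) := by push_cast; linarith
    rw [this, torusDist_add_int_mul']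
    exact torusDist_le_abs' _
  rcases fermiSum_eq_cases hD (mem_pairChartDomain_of_pos hab) hsol.symm with ⟨⟨k₁, hk₁⟩, ⟨k₂, hk₂⟩⟩ | ⟨⟨k₁, hk₁⟩, ⟨k₂, hk₂⟩⟩
  · left
    exact ⟨(hmod k₁ hk₁).trans h₁, (hmod k₂ hk₂).trans h₂⟩
  · right
    exact ⟨(hmod k₂ hk₂).trans h₂, (hmod k₁ hk₁).trans h₁⟩

/-- `(4)^{-n} = 2^{-n} 2^{-n}`. [folklore] -/
private theorem four_zpow_neg (n : ℕ) : (4 : ℝ) ^ (-(n : ℤ)) = (2 : ℝ) ^ (-(n : ℤ)) * (2 : ℝ) ^ (-(n : ℤ)) := by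
  rw [← mul_zpow]; norm_num

/-- Frame change `θ_{k₀} → θ_{a₀}` plus Lemma 7.5 plus two-to-one: if the difference `r⃗` of two
chord sums has `|r⃗·n⃗(θ_c)| ≤ 2K₁Lδ₂φ₀`, `|r⃗·τ⃗(θ_c)| ≤ 4Lδ₂` with `φ(θ_c, a₀) ≤ φ₀ = φ(a₀,b₀)`,
then in the frame at `a₀` it satisfies the hypotheses of Lemma 7.5 with `η = K₂Lδ₂`,
`K₂ = K₁π + 4`, `c₁ = (2K₁ + 4c₂)/K₂`, and the solved pair is pinned up to exchange. [cite: BenfattoGiulianiMastropietro2003, §7.4 (s1.40)–(s1.42) p.28 (L95–125)] -/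
private theorem pair_pinned (hD : DispersionHyp ε μ e₀ u) {c₂ K₁ K₂ c₀ c₂' η₀ : ℝ}
    (hlip : ∀ θ₁ θ₂ : ℝ, torusDist (normalAngle u θ₂ 0 - normalAngle u θ₁ 0) ≤ c₂ * torusDist (θ₂ - θ₁))
    (hpi : ∀ θ : ℝ, normalAngle u (θ + π) 0 = normalAngle u θ 0 + π) (hc₂ : 0 ≤ c₂) (hK₁0 : 0 ≤ K₁)
    (hK₂ : K₂ = K₁ * π + 4)
    (h75 : ∀ θ₁' θ₂' η r₁ r₂ : ℝ, (θ₁', θ₂') ∈ pairChartDomain →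
        |r₁| ≤ (2 * K₁ + 4 * c₂) / K₂ * η * pairAngle θ₁' θ₂' → |r₂| ≤ η → η ≤ c₂' * pairAngle θ₁' θ₂' →
          η ≤ η₀ →
          fermiPoint u θ₁' + fermiPoint u θ₂' + (r₁ • unitNormal u θ₁' 0 + r₂ • unitTangent u θ₁' 0)
              ∈ pairRange u ∧
          ∃ θ₁ θ₂ : ℝ,
            fermiPoint u θ₁' + fermiPoint u θ₂' + (r₁ • unitNormal u θ₁' 0 + r₂ • unitTangent u θ₁' 0) =
              fermiPoint u θ₁ + fermiPoint u θ₂ ∧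
            |θ₁ - θ₁'| ≤ c₀ * η ∧ |θ₂ - θ₂'| ≤ c₀ * η)
    {a b a₀ b₀ θc Lr δ₂ : ℝ} (hLr : 0 ≤ Lr) (hδ₂ : 0 ≤ δ₂) (r : Fin 2 → ℝ)
    (hF : fermiPoint u a + fermiPoint u b = fermiPoint u a₀ + fermiPoint u b₀ + r)
    (hφ₀pos : 0 < pairAngle a₀ b₀) (habpos : 0 < pairAngle a b)
    (hrn₀ : |r ⬝ᵥ unitNormal u θc 0| ≤ 2 * K₁ * Lr * δ₂ * pairAngle a₀ b₀)
    (hrτ₀ : |r ⬝ᵥ unitTangent u θc 0| ≤ 4 * Lr * δ₂)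
    (hθc : pairAngle θc a₀ ≤ pairAngle a₀ b₀)
    (hη : K₂ * Lr * δ₂ ≤ c₂' * pairAngle a₀ b₀) (hη₀ : K₂ * Lr * δ₂ ≤ η₀) :
    (torusDist (a - a₀) ≤ c₀ * (K₂ * Lr * δ₂) ∧ torusDist (b - b₀) ≤ c₀ * (K₂ * Lr * δ₂)) ∨
      (torusDist (a - b₀) ≤ c₀ * (K₂ * Lr * δ₂) ∧ torusDist (b - a₀) ≤ c₀ * (K₂ * Lr * δ₂)) := by
  have h0 := abs_zero_le_e₀ hD
  obtain ⟨cu, hcu, hu⟩ := hD.u_pos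
  have hupos : ∀ s, 0 < u s 0 := fun s => lt_of_lt_of_le hcu (hu s 0 h0)
  have hK₂pos : 0 < K₂ := by rw [hK₂]; positivity
  set φ₀ := pairAngle a₀ b₀ with hφ₀
  have hφ₀le : φ₀ ≤ π / 2 := (pairAngle_bounds _ _).2.1
  have hφ₀nn : 0 ≤ φ₀ := (pairAngle_bounds _ _).1
  have hA0 : 0 ≤ 2 * K₁ * Lr * δ₂ := mul_nonneg (mul_nonneg (by positivity) hLr) hδ₂
  have hA1 : 0 ≤ 2 * K₁ * Lr * δ₂ * φ₀ := mul_nonneg hA0 hφ₀nn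
  have hB0 : 0 ≤ 4 * Lr * δ₂ := mul_nonneg (mul_nonneg (by norm_num) hLr) hδ₂
  set n₀ := unitNormal u θc 0 with hn₀
  set τ₀ := unitTangent u θc 0 with hτ₀
  set nA := unitNormal u a₀ 0 with hnA
  set τA := unitTangent u a₀ 0 with hτA
  have hframe := frame_decomp' (hupos θc) r
  rw [← hn₀, ← hτ₀] at hframe
  have hcos1 : |n₀ ⬝ᵥ nA| ≤ 1 := by
    rw [hn₀, hnA, normal_dot_normal' (hupos _) (hupos _)]; exact Real.abs_cos_le_one _
  have hcos2 : |n₀ ⬝ᵥ τA| ≤ 1 := by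
    rw [hn₀, hτA, normal_dot_tangent' (hupos _) (hupos _)]; exact Real.abs_sin_le_one _
  have hcos3 : |τ₀ ⬝ᵥ τA| ≤ 1 := by
    rw [hτ₀, hτA, tangent_dot_tangent' (hupos _) (hupos _)]; exact Real.abs_cos_le_one _
  have hsin : |τ₀ ⬝ᵥ nA| ≤ c₂ * φ₀ := by
    rw [hτ₀, hnA, tangent_dot_normal' (hupos _) (hupos _), abs_neg]
    exact (abs_sin_normalAngle_sub_le hlip hpi _ _).trans (mul_le_mul_of_nonneg_left hθc hc₂)
  have hr₁ : |r ⬝ᵥ nA| ≤ (2 * K₁ + 4 * c₂) / K₂ * (K₂ * Lr * δ₂) * φ₀ := by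
    have hexp : r ⬝ᵥ nA = (r ⬝ᵥ n₀) * (n₀ ⬝ᵥ nA) + (r ⬝ᵥ τ₀) * (τ₀ ⬝ᵥ nA) := by
      conv_lhs => rw [hframe]
      rw [add_dotProduct, smul_dotProduct, smul_dotProduct, smul_eq_mul, smul_eq_mul]
    rw [hexp]
    have h1 : |(r ⬝ᵥ n₀) * (n₀ ⬝ᵥ nA)| ≤ 2 * K₁ * Lr * δ₂ * φ₀ := by
      rw [abs_mul]
      calc |r ⬝ᵥ n₀| * |n₀ ⬝ᵥ nA| ≤ (2 * K₁ * Lr * δ₂ * φ₀) * 1 :=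
            mul_le_mul hrn₀ hcos1 (abs_nonneg _) hA1
        _ = 2 * K₁ * Lr * δ₂ * φ₀ := mul_one _
    have h2 : |(r ⬝ᵥ τ₀) * (τ₀ ⬝ᵥ nA)| ≤ 4 * Lr * δ₂ * (c₂ * φ₀) := by
      rw [abs_mul]; exact mul_le_mul hrτ₀ hsin (abs_nonneg _) hB0
    have h3 : (2 * K₁ + 4 * c₂) / K₂ * (K₂ * Lr * δ₂) * φ₀ = 2 * K₁ * Lr * δ₂ * φ₀ + 4 * Lr * δ₂ * (c₂ * φ₀) := by
      rw [div_mul_eq_mul_div, show (2 * K₁ + 4 * c₂) * (K₂ * Lr * δ₂) / K₂ =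
        (2 * K₁ + 4 * c₂) * (Lr * δ₂) * (K₂ / K₂) by ring, div_self hK₂pos.ne']
      ring
    rw [h3]
    exact (abs_add_le _ _).trans (add_le_add h1 h2)
  have hr₂ : |r ⬝ᵥ τA| ≤ K₂ * Lr * δ₂ := by
    have hexp : r ⬝ᵥ τA = (r ⬝ᵥ n₀) * (n₀ ⬝ᵥ τA) + (r ⬝ᵥ τ₀) * (τ₀ ⬝ᵥ τA) := by
      conv_lhs => rw [hframe]
      rw [add_dotProduct, smul_dotProduct, smul_dotProduct, smul_eq_mul, smul_eq_mul]
    rw [hexp]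
    have h1 : |(r ⬝ᵥ n₀) * (n₀ ⬝ᵥ τA)| ≤ 2 * K₁ * Lr * δ₂ * φ₀ := by
      rw [abs_mul]
      calc |r ⬝ᵥ n₀| * |n₀ ⬝ᵥ τA| ≤ (2 * K₁ * Lr * δ₂ * φ₀) * 1 :=
            mul_le_mul hrn₀ hcos2 (abs_nonneg _) hA1
        _ = 2 * K₁ * Lr * δ₂ * φ₀ := mul_one _
    have h2 : |(r ⬝ᵥ τ₀) * (τ₀ ⬝ᵥ τA)| ≤ 4 * Lr * δ₂ := by
      rw [abs_mul]
      calc |r ⬝ᵥ τ₀| * |τ₀ ⬝ᵥ τA| ≤ (4 * Lr * δ₂) * 1 := mul_le_mul hrτ₀ hcos3 (abs_nonneg _) hB0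
        _ = 4 * Lr * δ₂ := mul_one _
    have h3 : 2 * K₁ * Lr * δ₂ * φ₀ + 4 * Lr * δ₂ ≤ K₂ * Lr * δ₂ := by
      rw [hK₂]
      have h4 : 2 * K₁ * Lr * δ₂ * φ₀ ≤ 2 * K₁ * Lr * δ₂ * (π / 2) :=
        mul_le_mul_of_nonneg_left hφ₀le hA0
      have h5 : 2 * K₁ * Lr * δ₂ * (π / 2) + 4 * Lr * δ₂ = (K₁ * π + 4) * Lr * δ₂ := by ring
      linarith
    exact ((abs_add_le _ _).trans (add_le_add h1 h2)).trans h3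
  exact solved_pair_near hD h75 r hF hφ₀pos habpos hr₁ hr₂ hη hη₀

/-- Arithmetic of the small-`h'` regime: `η₀ < K₂ L c₃ t` gives `(2/t)² ≤ (4c₃²K₂²/η₀²) L²`. [folklore] -/
private theorem trivial_regime_bound {t η₀ K₂ c₃ Lr : ℝ} (ht : 0 < t) (hη₀ : 0 < η₀)
    (hlt : η₀ < K₂ * Lr * (c₃ * t)) : (2 / t) ^ 2 ≤ 4 * c₃ ^ 2 * K₂ ^ 2 / η₀ ^ 2 * Lr ^ 2 := by
  have h1 : 2 / t < 2 * c₃ * K₂ * Lr / η₀ := by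
    rw [div_lt_div_iff₀ ht hη₀]
    have : K₂ * Lr * (c₃ * t) * 2 = 2 * c₃ * K₂ * Lr * t := by ring
    linarith
  have h2 : 0 < 2 / t := by positivity
  calc (2 / t) ^ 2 ≤ (2 * c₃ * K₂ * Lr / η₀) ^ 2 := pow_le_pow_left₀ h2.le h1.le 2
    _ = 4 * c₃ ^ 2 * K₂ ^ 2 / η₀ ^ 2 * Lr ^ 2 := by field_simp; ring

end Bricks

section Target

/-! ### BGM 2003 §7.4 WITH A TARGET VECTOR («umklapp strings», `Σ k = 2πG`) and a TRANSVERSALITY PARAMETER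
(cell gate-hubbard-kl, seat p4 g13, memo HOME/prover-p4/ON-CLASS-KB.md «CLAIM U»): the relative sector count for strings whose momenta sum to a
prescribed vector `R` instead of `0`.  The printed proof uses `Σ = 0` at exactly one line, (s1.34) (`wedge_bound`: the anchored leg is parallel to the
bundle of the others); here that conclusion is a HYPOTHESIS with a free angle `Ψ` (the anchored leg within `Ψ` of the other legs, mod `π`), and the
price of transversality is carried explicitly: Lemma 7.5 is applied with the enlarged `η = K₂·L_Ψ·δ₂`, `L_Ψ = L + c₂Ψ/(K₁Φ)`, in the regime
`K₂ L_Ψ c₃ 2^{−n′} ≤ c₂′Φ` (i.e. `Φ ≳ max(L·2^{−n′}, √(Ψ·2^{−n′}))`), giving fibres `O(L_Ψ²)` instead of `O(L²)`. -/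

/-- **(s1.38)–(s1.40) WITH A TARGET VECTOR and the wedge as a HYPOTHESIS.** As `string_box`, but for strings whose momenta
sum to a prescribed vector `R` (e.g. a reciprocal-lattice vector `2πG`, «umklapp strings») instead of `0`, and with the anchored leg's
angular distance to the frame leg `θ_{k₀}` bounded by a free parameter `Ψ` (for `R = 0` this is `wedge_bound`'s `C_w L φ₀`; for
`R ≠ 0` the anchored leg may be TRANSVERSAL to the bundle, `Ψ = O(1)`): the defect `Σ_m p⃗_F(θ_m) − R` has normal component
`≤ (2 + c₂) L δ₂ φ₀ + c₂ δ₂ Ψ` and tangential component `≤ 2 L δ₂` in the frame at `θ_{k₀}`. [cite: BenfattoGiulianiMastropietro2003, §7.4 (s1.38)–(s1.40) p.28 (L81–101)] -/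
theorem string_box_target {ε : (Fin 2 → ℝ) → ℝ} {μ e₀ : ℝ} {u : ℝ → ℝ → ℝ} (hD : DispersionHyp ε μ e₀ u) {c₂ : ℝ}
    (hlip : ∀ θ₁ θ₂ : ℝ, torusDist (normalAngle u θ₂ 0 - normalAngle u θ₁ 0) ≤ c₂ * torusDist (θ₂ - θ₁))
    (hpi : ∀ θ : ℝ, normalAngle u (θ + π) 0 = normalAngle u θ 0 + π) (hc₂ : 0 ≤ c₂)
    {L : ℕ} (i₁ k₀ : Fin L) (θ : Fin L → ℝ) (θ₀ : ℝ) (hθ₀ : θ k₀ = θ₀) (k : Fin L → (Fin 2 → ℝ)) (x y : Fin L → ℝ)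
    (R : Fin 2 → ℝ) (hsum : ∑ m, k m = R)
    (hdec : ∀ m, k m = fermiPoint u (θ m) + (x m • unitNormal u (θ m) 0 + y m • unitTangent u (θ m) 0))
    {δ₁ δ₂ φ₀ Ψ : ℝ} (hx : ∀ m, |x m| ≤ δ₁) (hy : ∀ m, |y m| ≤ δ₂) (hδ₁₂ : δ₁ ≤ δ₂) (hδ₁ : δ₁ ≤ δ₂ * φ₀)
    (hδ₂ : 0 ≤ δ₂) (hφ₀ : 0 ≤ φ₀)
    (hclose : ∀ m, m ≠ i₁ → pairAngle (θ m) (θ k₀) ≤ φ₀)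
    (hwedge : pairAngle (θ i₁) (θ k₀) ≤ Ψ) :
    |(∑ m, fermiPoint u (θ m) - R) ⬝ᵥ unitNormal u θ₀ 0| ≤ (2 + c₂) * L * δ₂ * φ₀ + c₂ * δ₂ * Ψ ∧
      |(∑ m, fermiPoint u (θ m) - R) ⬝ᵥ unitTangent u θ₀ 0| ≤ 2 * L * δ₂ := by
  subst hθ₀
  have h0 := abs_zero_le_e₀ hD
  obtain ⟨cu, hcu, hu⟩ := hD.u_pos
  have hupos : ∀ s, 0 < u s 0 := fun s => lt_of_lt_of_le hcu (hu s 0 h0)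
  set d : Fin L → (Fin 2 → ℝ) := fun m => x m • unitNormal u (θ m) 0 + y m • unitTangent u (θ m) 0 with hd
  have hR : ∑ m, fermiPoint u (θ m) - R = -∑ m, d m := by
    have : ∑ m, k m = ∑ m, fermiPoint u (θ m) + ∑ m, d m := by
      rw [← Finset.sum_add_distrib]; exact Finset.sum_congr rfl fun m _ => hdec m
    rw [hsum] at this
    rw [this]; abel
  have hL1 : (1 : ℝ) ≤ L := by
    have : 1 ≤ L := Nat.succ_le_of_lt (Fin.pos i₁)
    exact_mod_cast this
  set n₀ := unitNormal u (θ k₀) 0 with hn₀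
  set τ₀ := unitTangent u (θ k₀) 0 with hτ₀
  -- normal components of the displacements
  have hdn : ∀ m, |d m ⬝ᵥ n₀| ≤ δ₁ + δ₂ * (c₂ * pairAngle (θ m) (θ k₀)) := by
    intro m
    have hexp : d m ⬝ᵥ n₀ = x m * Real.cos (normalAngle u (θ m) 0 - normalAngle u (θ k₀) 0) +
        y m * -Real.sin (normalAngle u (θ m) 0 - normalAngle u (θ k₀) 0) := by
      rw [hd]; simp only [add_dotProduct, smul_dotProduct, smul_eq_mul]
      rw [hn₀, normal_dot_normal' (hupos _) (hupos _), tangent_dot_normal' (hupos _) (hupos _)]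
    rw [hexp]
    have h1 : |x m * Real.cos (normalAngle u (θ m) 0 - normalAngle u (θ k₀) 0)| ≤ δ₁ := by
      rw [abs_mul]; exact (mul_le_of_le_one_right (abs_nonneg _) (Real.abs_cos_le_one _)).trans (hx m)
    have h2 : |y m * -Real.sin (normalAngle u (θ m) 0 - normalAngle u (θ k₀) 0)| ≤
        δ₂ * (c₂ * pairAngle (θ m) (θ k₀)) := by
      rw [abs_mul, abs_neg]
      exact mul_le_mul (hy m) (abs_sin_normalAngle_sub_le hlip hpi _ _) (abs_nonneg _) hδ₂
    exact (abs_add_le _ _).trans (add_le_add h1 h2)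
  -- tangential components
  have hdt : ∀ m, |d m ⬝ᵥ τ₀| ≤ δ₁ + δ₂ := by
    intro m
    have hexp : d m ⬝ᵥ τ₀ = x m * Real.sin (normalAngle u (θ m) 0 - normalAngle u (θ k₀) 0) +
        y m * Real.cos (normalAngle u (θ m) 0 - normalAngle u (θ k₀) 0) := by
      rw [hd]; simp only [add_dotProduct, smul_dotProduct, smul_eq_mul]
      rw [hτ₀, normal_dot_tangent' (hupos _) (hupos _), tangent_dot_tangent' (hupos _) (hupos _)]
    rw [hexp]
    have h1 : |x m * Real.sin (normalAngle u (θ m) 0 - normalAngle u (θ k₀) 0)| ≤ δ₁ := by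
      rw [abs_mul]; exact (mul_le_of_le_one_right (abs_nonneg _) (Real.abs_sin_le_one _)).trans (hx m)
    have h2 : |y m * Real.cos (normalAngle u (θ m) 0 - normalAngle u (θ k₀) 0)| ≤ δ₂ := by
      rw [abs_mul]; exact (mul_le_of_le_one_right (abs_nonneg _) (Real.abs_cos_le_one _)).trans (hy m)
    exact (abs_add_le _ _).trans (add_le_add h1 h2)
  constructor
  · rw [hR, neg_dotProduct, abs_neg, sum_dotProduct]
    have hsplit := Finset.add_sum_erase Finset.univ (fun m => d m ⬝ᵥ n₀) (Finset.mem_univ i₁)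
    rw [← hsplit]
    have hA : |d i₁ ⬝ᵥ n₀| ≤ δ₁ + δ₂ * (c₂ * Ψ) :=
      (hdn i₁).trans (by gcongr)
    have hB : |∑ m ∈ Finset.univ.erase i₁, d m ⬝ᵥ n₀| ≤ L * (δ₁ + δ₂ * (c₂ * φ₀)) := by
      calc |∑ m ∈ Finset.univ.erase i₁, d m ⬝ᵥ n₀| ≤ ∑ m ∈ Finset.univ.erase i₁, |d m ⬝ᵥ n₀| :=
            Finset.abs_sum_le_sum_abs _ _
        _ ≤ ∑ _m ∈ Finset.univ.erase i₁, (δ₁ + δ₂ * (c₂ * φ₀)) :=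
            Finset.sum_le_sum fun m hm => (hdn m).trans (by
              gcongr; exact hclose m (Finset.ne_of_mem_erase hm))
        _ = ((Finset.univ.erase i₁).card : ℝ) * (δ₁ + δ₂ * (c₂ * φ₀)) := by
            rw [Finset.sum_const, nsmul_eq_mul]
        _ ≤ L * (δ₁ + δ₂ * (c₂ * φ₀)) := by
            have hc : ((Finset.univ.erase i₁).card : ℝ) ≤ L := by
              have : (Finset.univ.erase i₁).card ≤ L := (Finset.card_erase_le).trans (by simp)
              exact_mod_cast this
            have hnn : 0 ≤ δ₁ + δ₂ * (c₂ * φ₀) := add_nonneg ((abs_nonneg _).trans (hx i₁)) (by positivity)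
            exact mul_le_mul_of_nonneg_right hc hnn
    calc |d i₁ ⬝ᵥ n₀ + ∑ m ∈ Finset.univ.erase i₁, d m ⬝ᵥ n₀|
        ≤ |d i₁ ⬝ᵥ n₀| + |∑ m ∈ Finset.univ.erase i₁, d m ⬝ᵥ n₀| := abs_add_le _ _
      _ ≤ (δ₁ + δ₂ * (c₂ * Ψ)) + L * (δ₁ + δ₂ * (c₂ * φ₀)) := add_le_add hA hB
      _ ≤ (2 + c₂) * L * δ₂ * φ₀ + c₂ * δ₂ * Ψ := by
          have h1 : δ₁ ≤ L * (δ₂ * φ₀) := hδ₁.trans (le_mul_of_one_le_left (by positivity) hL1)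
          nlinarith [hδ₂, hφ₀, hc₂, hL1, h1, hδ₁]
  · rw [hR, neg_dotProduct, abs_neg, sum_dotProduct]
    calc |∑ m, d m ⬝ᵥ τ₀| ≤ ∑ m, |d m ⬝ᵥ τ₀| := Finset.abs_sum_le_sum_abs _ _
      _ ≤ ∑ _m : Fin L, (δ₁ + δ₂) := Finset.sum_le_sum fun m _ => hdt m
      _ = L * (δ₁ + δ₂) := by rw [Finset.sum_const, nsmul_eq_mul, Finset.card_univ, Fintype.card_fin]
      _ ≤ 2 * L * δ₂ := by nlinarith [hL1, hδ₁₂]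

/-- Momenta, frames and displacements of a TARGET string (as `string_data`, with `Σ k = R`). [cite: BenfattoGiulianiMastropietro2003, §7.4 (s1.31)–(s1.32) p.28 (L60–69)] -/
theorem string_data_target {ε : (Fin 2 → ℝ) → ℝ} {μ e₀ : ℝ} {u : ℝ → ℝ → ℝ} (hD : DispersionHyp ε μ e₀ u) {c₃ : ℝ}
    (h73 : ∀ (n ω : ℕ), ω < sectorCount n → ∀ p ∈ sSector u e₀ n ω,
      ∃ k₁ k₂ : ℝ,
        p = fermiPoint u (sectorCenter n ω) + k₁ • unitNormal u (sectorCenter n ω) 0 +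
              k₂ • unitTangent u (sectorCenter n ω) 0 ∧
        |k₁| ≤ c₃ * (4 : ℝ) ^ (-(n : ℤ)) ∧ |k₂| ≤ c₃ * (2 : ℝ) ^ (-(n : ℤ)) ∧
        |fderiv ℝ ε p (unitTangent u (sectorCenter n ω) 0)| ≤ c₃ * (2 : ℝ) ^ (-(n : ℤ)))
    {n' L : ℕ} {ω : Fin L → Fin (sectorCount n')} (R : Fin 2 → ℝ)
    (hω : ∃ k : Fin L → (Fin 2 → ℝ), (∀ i : Fin L, k i ∈ sSector u e₀ n' (ω i : ℕ)) ∧ ∑ i, k i = R) :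
    ∃ (k : Fin L → (Fin 2 → ℝ)) (x y : Fin L → ℝ), ∑ m, k m = R ∧
      (∀ m, k m = fermiPoint u (sectorCenter n' (ω m)) +
        (x m • unitNormal u (sectorCenter n' (ω m)) 0 + y m • unitTangent u (sectorCenter n' (ω m)) 0)) ∧
      (∀ m, |x m| ≤ c₃ * (4 : ℝ) ^ (-(n' : ℤ))) ∧ ∀ m, |y m| ≤ c₃ * (2 : ℝ) ^ (-(n' : ℤ)) := by
  have _ := hD.e₀_pos
  obtain ⟨k, hk, hsum⟩ := hω
  have h : ∀ m : Fin L, ∃ k₁ k₂ : ℝ,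
      k m = fermiPoint u (sectorCenter n' (ω m)) + k₁ • unitNormal u (sectorCenter n' (ω m)) 0 +
              k₂ • unitTangent u (sectorCenter n' (ω m)) 0 ∧
        |k₁| ≤ c₃ * (4 : ℝ) ^ (-(n' : ℤ)) ∧ |k₂| ≤ c₃ * (2 : ℝ) ^ (-(n' : ℤ)) := by
    intro m
    obtain ⟨k₁, k₂, h1, h2, h3, -⟩ := h73 n' (ω m) (ω m).isLt (k m) (hk m)
    exact ⟨k₁, k₂, h1, h2, h3⟩
  choose x y hxy using h
  exact ⟨k, x, y, hsum, fun m => by rw [(hxy m).1, add_assoc], fun m => (hxy m).2.1, fun m => (hxy m).2.2⟩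


set_option maxHeartbeats 400000 in -- two Lemma-7.5 frame estimates per completing pair; 200k is ~10% short
/-- **The far fibre WITH A TARGET VECTOR and a transversality parameter** (target twin of `fibre_large`): completing pairs `(ω_i, ω_j)` of
TARGET strings (`Σ k = R`) sharing the legs off `{i, j}`, maximal pair `(i, j)` with angle `> Φ`, anchored leg within `Ψ` of the frame leg `k₀`;
Lemma 7.5 is run with `η = K₂ L_Ψ δ₂`, `L_Ψ = L + c₂Ψ/(K₁Φ)`, in the regime `K₂ L_Ψ c₃ 2^{−n′} ≤ c₂′ Φ`: at most `O(L_Ψ²)` pairs.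
[cite: BenfattoGiulianiMastropietro2003, §7.4 (s1.26)–(s1.42) p.28 (L44–125)] -/
theorem fibre_large_target {ε : (Fin 2 → ℝ) → ℝ} {μ e₀ : ℝ} {u : ℝ → ℝ → ℝ} (hD : DispersionHyp ε μ e₀ u) {c₂ c₃ K₁ K₂ c₀ c₂' η₀ : ℝ}
    (hlip : ∀ θ₁ θ₂ : ℝ, torusDist (normalAngle u θ₂ 0 - normalAngle u θ₁ 0) ≤ c₂ * torusDist (θ₂ - θ₁))
    (hpi : ∀ θ : ℝ, normalAngle u (θ + π) 0 = normalAngle u θ 0 + π) (hc₂ : 0 ≤ c₂) (hc₃ : 0 < c₃)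
    (h73 : ∀ (n ω : ℕ), ω < sectorCount n → ∀ p ∈ sSector u e₀ n ω,
      ∃ k₁ k₂ : ℝ,
        p = fermiPoint u (sectorCenter n ω) + k₁ • unitNormal u (sectorCenter n ω) 0 +
              k₂ • unitTangent u (sectorCenter n ω) 0 ∧
        |k₁| ≤ c₃ * (4 : ℝ) ^ (-(n : ℤ)) ∧ |k₂| ≤ c₃ * (2 : ℝ) ^ (-(n : ℤ)) ∧
        |fderiv ℝ ε p (unitTangent u (sectorCenter n ω) 0)| ≤ c₃ * (2 : ℝ) ^ (-(n : ℤ)))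
    (hK₁0 : 0 ≤ K₁)
    (hK₂ : K₂ = K₁ * π + 4) (hc₀ : 0 < c₀) (hc₂' : 0 < c₂') (hη₀ : 0 < η₀)
    (h75 : ∀ θ₁' θ₂' η r₁ r₂ : ℝ, (θ₁', θ₂') ∈ pairChartDomain →
        |r₁| ≤ (2 * K₁ + 4 * c₂) / K₂ * η * pairAngle θ₁' θ₂' → |r₂| ≤ η → η ≤ c₂' * pairAngle θ₁' θ₂' →
          η ≤ η₀ →
          fermiPoint u θ₁' + fermiPoint u θ₂' + (r₁ • unitNormal u θ₁' 0 + r₂ • unitTangent u θ₁' 0)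
              ∈ pairRange u ∧
          ∃ θ₁ θ₂ : ℝ,
            fermiPoint u θ₁' + fermiPoint u θ₂' + (r₁ • unitNormal u θ₁' 0 + r₂ • unitTangent u θ₁' 0) =
              fermiPoint u θ₁ + fermiPoint u θ₂ ∧
            |θ₁ - θ₁'| ≤ c₀ * η ∧ |θ₂ - θ₂'| ≤ c₀ * η)
    {n' L : ℕ} (hL1 : 1 ≤ L) {i₁ i j k₀ : Fin L} (hij : i ≠ j) (hi : i ≠ i₁)
    (hk₀i : k₀ ≠ i) (hk₀j : k₀ ≠ j) (hk₀ : k₀ ≠ i₁)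
    (ρ : Fin L → Fin (sectorCount n')) (R : Fin 2 → ℝ) {Φ Ψ LΨ : ℝ} (hΨ : 0 ≤ Ψ) (hK₁c : 2 + c₂ ≤ K₁)
    (hLΨ : LΨ = L + c₂ * Ψ / (K₁ * Φ)) (hΦt : (2 : ℝ) ^ (-(n' : ℤ)) ≤ Φ) (hΦδ : c₃ * (2 : ℝ) ^ (-(n' : ℤ)) ≤ Φ)
    (hΦη : K₂ * LΨ * (c₃ * (2 : ℝ) ^ (-(n' : ℤ))) ≤ c₂' * Φ)
    (E : Finset (Fin (sectorCount n') × Fin (sectorCount n')))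
    (hE : ∀ ab ∈ E,
        Φ < pairAngle (sectorCenter n' ab.1) (sectorCenter n' ab.2) ∧
        ∃ ω : Fin L → Fin (sectorCount n'),
          (∃ k : Fin L → (Fin 2 → ℝ), (∀ i : Fin L, k i ∈ sSector u e₀ n' (ω i : ℕ)) ∧ ∑ i, k i = R) ∧
          (∀ m l : Fin L, m ≠ i₁ → l ≠ i₁ →
            pairAngle (sectorCenter n' (ω m)) (sectorCenter n' (ω l)) ≤
              pairAngle (sectorCenter n' (ω i)) (sectorCenter n' (ω j))) ∧
          pairAngle (sectorCenter n' (ω i₁)) (sectorCenter n' (ω k₀)) ≤ Ψ ∧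
          (∀ m, m ≠ i → m ≠ j → ω m = ρ m) ∧ ω i = ab.1 ∧ ω j = ab.2) :
    (E.card : ℝ) ≤
      max ((2 * ((2 * c₀ * K₂ * c₃ / π + 1) * LΨ)) ^ 2) (4 * c₃ ^ 2 * K₂ ^ 2 / η₀ ^ 2 * LΨ ^ 2) := by
  classical
  have h0 := abs_zero_le_e₀ hD
  -- scales
  set t := (2 : ℝ) ^ (-(n' : ℤ)) with ht
  have htpos : 0 < t := zpow_pos (by norm_num) _
  have htle : t ≤ 1 := zpow_le_one_of_nonpos₀ (by norm_num) (by simp)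
  set δ₂ := c₃ * t with hδ₂
  set δ₁ := c₃ * (4 : ℝ) ^ (-(n' : ℤ)) with hδ₁
  have hδ₁t : δ₁ = δ₂ * t := by rw [hδ₁, four_zpow_neg, hδ₂, ht]; ring
  have hδ₂pos : 0 < δ₂ := by positivity
  have hδ₁₂ : δ₁ ≤ δ₂ := by rw [hδ₁t]; exact mul_le_of_le_one_right hδ₂pos.le htle
  have hL1r : (1 : ℝ) ≤ L := by exact_mod_cast hL1
  have hK₁pos : 0 < K₁ := by linarith
  have hK₂pos : 0 < K₂ := by rw [hK₂]; positivity
  -- consequences of the regime hypotheses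
  have hΦpos : 0 < Φ := lt_of_lt_of_le htpos hΦt
  have hΦδ' : δ₂ ≤ Φ := by rw [hδ₂]; exact hΦδ
  have hLΨL : (L : ℝ) ≤ LΨ := by
    rw [hLΨ]; have : 0 ≤ c₂ * Ψ / (K₁ * Φ) := by positivity
    linarith
  have hLΨ1 : (1 : ℝ) ≤ LΨ := hL1r.trans hLΨL
  have hLΨ0 : (0 : ℝ) ≤ LΨ := zero_le_one.trans hLΨ1
  have hΦη' : K₂ * LΨ * δ₂ ≤ c₂' * Φ := by rw [hδ₂]; exact hΦη
  -- trivial cases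
  rcases Finset.eq_empty_or_nonempty E with hE0 | hEne
  · rw [hE0, Finset.card_empty, Nat.cast_zero]
    exact le_max_of_le_left (by positivity)
  rcases lt_or_ge η₀ (K₂ * LΨ * δ₂) with hlt | hη
  · -- small `h'`: the trivial bound `|O_{h'}|²`
    have hcard : (E.card : ℝ) ≤ ((sectorCount n' : ℕ) : ℝ) ^ 2 := by
      have h1 : E.card ≤ (Finset.univ : Finset (Fin (sectorCount n') × Fin (sectorCount n'))).card :=
        Finset.card_le_card (Finset.subset_univ _)
      rw [Finset.card_univ, Fintype.card_prod, Fintype.card_fin] at h1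
      have h2 : ((sectorCount n' * sectorCount n' : ℕ) : ℝ) = ((sectorCount n' : ℕ) : ℝ) ^ 2 := by push_cast; ring
      exact (Nat.cast_le.2 h1).trans_eq h2
    have hNt : ((sectorCount n' : ℕ) : ℝ) * t = 2 := by
      rw [sectorCount, ht, Nat.cast_pow, Nat.cast_ofNat, pow_succ, zpow_neg, zpow_natCast]
      field_simp
    have hN2 : ((sectorCount n' : ℕ) : ℝ) = 2 / t := by rw [← hNt]; field_simp
    refine hcard.trans (le_max_of_le_right ?_)
    rw [hN2]
    exact trivial_regime_bound htpos hη₀ (by rw [hδ₂] at hlt; exact hlt)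
  -- the reference pair of maximal angle
  obtain ⟨⟨a₀, b₀⟩, hmem₀, hmax⟩ :=
    E.exists_max_image (fun ab => pairAngle (sectorCenter n' ab.1) (sectorCenter n' ab.2)) hEne
  obtain ⟨hΦ₀, ω₀, hω₀S, hMP₀, hW₀, hρ₀, hω₀i, hω₀j⟩ := hE _ hmem₀
  set φ₀ := pairAngle (sectorCenter n' a₀) (sectorCenter n' b₀) with hφ₀
  have hφ₀pos : 0 < φ₀ := lt_of_le_of_lt (htpos.le.trans hΦt) hΦ₀
  have hφ₀le : φ₀ ≤ π / 2 := (pairAngle_bounds _ _).2.1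
  have htφ : t ≤ φ₀ := hΦt.trans hΦ₀.le
  have hδφ : δ₂ ≤ φ₀ := hΦδ'.trans hΦ₀.le
  have hΦφ₀ : Φ ≤ φ₀ := hΦ₀.le
  have hφ₀nn : 0 ≤ φ₀ := hφ₀pos.le
  -- the transversality budget: `(2 + c₂) L δ₂ φ₀ + c₂ δ₂ Ψ ≤ K₁ L_Ψ δ₂ φ₀`
  have hkey : (2 + c₂) * L * δ₂ * φ₀ + c₂ * δ₂ * Ψ ≤ K₁ * LΨ * δ₂ * φ₀ := by
    have h1 : (2 + c₂) * L * δ₂ * φ₀ ≤ K₁ * L * δ₂ * φ₀ := by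
      have : 0 ≤ (L : ℝ) * δ₂ * φ₀ := by positivity
      nlinarith
    have h2 : c₂ * δ₂ * Ψ ≤ K₁ * (c₂ * Ψ / (K₁ * Φ)) * δ₂ * φ₀ := by
      have e : K₁ * (c₂ * Ψ / (K₁ * Φ)) * δ₂ * φ₀ = c₂ * δ₂ * Ψ * (φ₀ / Φ) := by
        field_simp
      rw [e]
      have h3 : 1 ≤ φ₀ / Φ := (one_le_div hΦpos).2 hΦφ₀
      have h0 : 0 ≤ c₂ * δ₂ * Ψ := by positivity
      exact le_mul_of_one_le_right h0 h3
    calc (2 + c₂) * L * δ₂ * φ₀ + c₂ * δ₂ * Ψ ≤ K₁ * L * δ₂ * φ₀ + K₁ * (c₂ * Ψ / (K₁ * Φ)) * δ₂ * φ₀ := add_le_add h1 h2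
      _ = K₁ * LΨ * δ₂ * φ₀ := by rw [hLΨ]; ring
  have hδ₁φ : δ₁ ≤ δ₂ * φ₀ := by rw [hδ₁t]; exact mul_le_mul_of_nonneg_left htφ hδ₂pos.le
  -- reference string data and estimates (frame at `θ₀ = θ_{ρ k₀}`)
  set θc := sectorCenter n' (ρ k₀) with hθc
  obtain ⟨kk₀, x₀, y₀, hsum₀, hdec₀, hx₀, hy₀⟩ := string_data_target hD h73 R hω₀S
  have hθ₀k₀ : (fun m => sectorCenter n' (ω₀ m)) k₀ = θc := by
    simp only [hθc]; rw [hρ₀ k₀ hk₀i hk₀j]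
  have hclose₀ : ∀ m, m ≠ i₁ → pairAngle ((fun m => sectorCenter n' (ω₀ m)) m) ((fun m => sectorCenter n' (ω₀ m)) k₀) ≤ φ₀ :=
    fun m hm => by
      have h1 := hMP₀ m k₀ hm hk₀
      rw [hω₀i, hω₀j] at h1
      exact h1
  have est₀ := string_box_target hD hlip hpi hc₂ i₁ k₀ (fun m => sectorCenter n' (ω₀ m)) θc hθ₀k₀ kk₀ x₀ y₀ R hsum₀ hdec₀
    hx₀ hy₀ hδ₁₂ hδ₁φ hδ₂pos.le hφ₀nn hclose₀ hW₀
  -- the target boxes on the grid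
  set D := c₀ * (K₂ * LΨ * δ₂) with hDdef
  have hD0 : 0 ≤ D := by positivity
  obtain ⟨W, hWdef⟩ : ∃ W : ℝ → Finset (Fin (sectorCount n')), ∀ θs, W θs =
      Finset.univ.filter (fun c : Fin (sectorCount n') => torusDist (sectorCenter n' c - θs) ≤ D) :=
    ⟨fun θs => Finset.univ.filter (fun c : Fin (sectorCount n') => torusDist (sectorCenter n' c - θs) ≤ D),
      fun θs => rfl⟩
  have hWmem : ∀ (θs : ℝ) (c : Fin (sectorCount n')), torusDist (sectorCenter n' c - θs) ≤ D → c ∈ W θs :=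
      fun θs c h => by
    rw [hWdef]; exact Finset.mem_filter.2 ⟨Finset.mem_univ _, h⟩
  have hWcard : ∀ θs, ((W θs).card : ℝ) ≤ (2 * c₀ * K₂ * c₃ / π + 1) * LΨ := by
    intro θs
    have h1 := card_centres_torus_le n' θs D hD0
    rw [← hWdef] at h1
    have h2 : 2 * D / sectorWidth n' + 1 = 2 * c₀ * K₂ * c₃ / π * LΨ + 1 := by
      rw [hDdef, hδ₂, sectorWidth_eq_zpow, ← ht]; field_simp
    rw [h2] at h1
    have h3 : (2 * c₀ * K₂ * c₃ / π + 1) * LΨ = 2 * c₀ * K₂ * c₃ / π * LΨ + LΨ := by ring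
    calc ((W θs).card : ℝ) ≤ 2 * c₀ * K₂ * c₃ / π * LΨ + 1 := h1
      _ ≤ (2 * c₀ * K₂ * c₃ / π + 1) * LΨ := by rw [h3]; linarith
  -- every completing pair lands in the boxes
  have hsub : E ⊆ (W (sectorCenter n' a₀) ∪ W (sectorCenter n' b₀)) ×ˢ
      (W (sectorCenter n' a₀) ∪ W (sectorCenter n' b₀)) := by
    rintro ⟨a, b⟩ hab
    have hφle : pairAngle (sectorCenter n' a) (sectorCenter n' b) ≤ φ₀ := hmax ⟨a, b⟩ hab
    obtain ⟨hΦab, ω, hωS, hMP, hW, hρω, hωi, hωj⟩ := hE _ hab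
    have habpos : 0 < pairAngle (sectorCenter n' a) (sectorCenter n' b) :=
      lt_of_le_of_lt (htpos.le.trans hΦt) hΦab
    obtain ⟨kk, x, y, hsum, hdec, hx, hy⟩ := string_data_target hD h73 R hωS
    have hθk₀ : (fun m => sectorCenter n' (ω m)) k₀ = θc := by
      simp only [hθc]; rw [hρω k₀ hk₀i hk₀j]
    have hcloseω : ∀ m, m ≠ i₁ → pairAngle ((fun m => sectorCenter n' (ω m)) m) ((fun m => sectorCenter n' (ω m)) k₀) ≤ φ₀ :=
      fun m hm => by
        have h1 := hMP m k₀ hm hk₀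
        rw [hωi, hωj] at h1
        exact h1.trans hφle
    have est := string_box_target hD hlip hpi hc₂ i₁ k₀ (fun m => sectorCenter n' (ω m)) θc hθk₀ kk x y R hsum hdec
      hx hy hδ₁₂ hδ₁φ hδ₂pos.le hφ₀nn hcloseω hW
    -- the difference of the two chord sums
    set r := ∑ m, fermiPoint u (sectorCenter n' (ω m)) - ∑ m, fermiPoint u (sectorCenter n' (ω₀ m)) with hr
    have hF : fermiPoint u (sectorCenter n' a) + fermiPoint u (sectorCenter n' b) =
        fermiPoint u (sectorCenter n' a₀) + fermiPoint u (sectorCenter n' b₀) + r := by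
      have hdiff : r = (fermiPoint u (sectorCenter n' a) - fermiPoint u (sectorCenter n' a₀)) +
          (fermiPoint u (sectorCenter n' b) - fermiPoint u (sectorCenter n' b₀)) := by
        rw [hr, ← Finset.sum_sub_distrib]
        rw [Fintype.sum_eq_add i j hij (fun m hm => by
          show fermiPoint u (sectorCenter n' (ω m)) - fermiPoint u (sectorCenter n' (ω₀ m)) = 0
          rw [hρω m hm.1 hm.2, hρ₀ m hm.1 hm.2, sub_self])]
        rw [hωi, hωj, hω₀i, hω₀j]
      rw [hdiff]; abel
    -- components of `r` in the common frame at `θc`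
    set n₀ := unitNormal u θc 0 with hn₀
    set τ₀ := unitTangent u θc 0 with hτ₀
    have hr' : r = (∑ m, fermiPoint u (sectorCenter n' (ω m)) - R) - (∑ m, fermiPoint u (sectorCenter n' (ω₀ m)) - R) := by
      rw [hr]; abel
    have hrn₀ : |r ⬝ᵥ n₀| ≤ 2 * K₁ * LΨ * δ₂ * φ₀ := by
      rw [hr', sub_dotProduct]
      have := abs_sub ((∑ m, fermiPoint u (sectorCenter n' (ω m)) - R) ⬝ᵥ n₀)
        ((∑ m, fermiPoint u (sectorCenter n' (ω₀ m)) - R) ⬝ᵥ n₀)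
      linarith [est.1, est₀.1, hkey]
    have hrτ₀ : |r ⬝ᵥ τ₀| ≤ 4 * LΨ * δ₂ := by
      rw [hr', sub_dotProduct]
      have := abs_sub ((∑ m, fermiPoint u (sectorCenter n' (ω m)) - R) ⬝ᵥ τ₀)
        ((∑ m, fermiPoint u (sectorCenter n' (ω₀ m)) - R) ⬝ᵥ τ₀)
      have hL4 : 4 * (L : ℝ) * δ₂ ≤ 4 * LΨ * δ₂ := by nlinarith [hLΨL, hδ₂pos.le]
      linarith [est.2, est₀.2]
    -- frame change, Lemma 7.5 and two-to-one
    have hθc' : pairAngle θc (sectorCenter n' a₀) ≤ φ₀ := by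
      have h1 := hMP₀ k₀ i hk₀ hi
      rw [hρ₀ k₀ hk₀i hk₀j, hω₀i, hω₀j] at h1
      exact h1
    have hnear := pair_pinned hD hlip hpi hc₂ hK₁0 hK₂ h75 hLΨ0 hδ₂pos.le r hF hφ₀pos habpos
      hrn₀ hrτ₀ hθc'
      (hΦη'.trans (mul_le_mul_of_nonneg_left hΦ₀.le hc₂'.le)) hη
    rw [Finset.mem_product, Finset.mem_union, Finset.mem_union]
    rcases hnear with ⟨h1, h2⟩ | ⟨h1, h2⟩
    · exact ⟨Or.inl (hWmem _ _ h1), Or.inr (hWmem _ _ h2)⟩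
    · exact ⟨Or.inr (hWmem _ _ h1), Or.inl (hWmem _ _ h2)⟩
  -- count
  have hU : (((W (sectorCenter n' a₀) ∪ W (sectorCenter n' b₀)).card : ℕ) : ℝ) ≤
      2 * ((2 * c₀ * K₂ * c₃ / π + 1) * LΨ) := by
    calc (((W (sectorCenter n' a₀) ∪ W (sectorCenter n' b₀)).card : ℕ) : ℝ)
        ≤ ((W (sectorCenter n' a₀)).card : ℝ) + ((W (sectorCenter n' b₀)).card : ℝ) := by
          exact_mod_cast Finset.card_union_le _ _
      _ ≤ 2 * ((2 * c₀ * K₂ * c₃ / π + 1) * LΨ) := by linarith [hWcard (sectorCenter n' a₀), hWcard (sectorCenter n' b₀)]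
  refine le_max_of_le_left ?_
  calc (E.card : ℝ) ≤ (((W (sectorCenter n' a₀) ∪ W (sectorCenter n' b₀)) ×ˢ
        (W (sectorCenter n' a₀) ∪ W (sectorCenter n' b₀))).card : ℝ) := by
        exact_mod_cast Finset.card_le_card hsub
    _ = (((W (sectorCenter n' a₀) ∪ W (sectorCenter n' b₀)).card : ℝ)) ^ 2 := by
        rw [Finset.card_product]; push_cast; ring
    _ ≤ (2 * ((2 * c₀ * K₂ * c₃ / π + 1) * LΨ)) ^ 2 := pow_le_pow_left₀ (by positivity) hU 2



/-- **The near fibre, target twin of `fibre_small`** (no conservation used): if the maximal pair `(i, j)` has angle `≤ Φ`, both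
`θ_i`, `θ_j` are within `Φ` (mod `π`) of the fixed angle of a third free leg: at most `(2(2Φ/w_{h'}+1))²` completing pairs. [cite: BenfattoGiulianiMastropietro2003, §7.4 (s1.24)–(s1.25) p.28 (L37–43)] -/
theorem fibre_small_target {n' L : ℕ} {i₁ i j k₀ : Fin L} (hi : i ≠ i₁) (hj : j ≠ i₁) (hk₀ : k₀ ≠ i₁)
    (hk₀i : k₀ ≠ i) (hk₀j : k₀ ≠ j)
    {u : ℝ → ℝ → ℝ} {e₀ : ℝ} (ρ : Fin L → Fin (sectorCount n')) (R : Fin 2 → ℝ)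
    {Φ Ψ : ℝ} (hΦ0 : 0 ≤ Φ)
    (E : Finset (Fin (sectorCount n') × Fin (sectorCount n')))
    (hE : ∀ ab ∈ E,
        pairAngle (sectorCenter n' ab.1) (sectorCenter n' ab.2) ≤ Φ ∧
        ∃ ω : Fin L → Fin (sectorCount n'),
          (∃ k : Fin L → (Fin 2 → ℝ), (∀ i : Fin L, k i ∈ sSector u e₀ n' (ω i : ℕ)) ∧ ∑ i, k i = R) ∧
          (∀ m l : Fin L, m ≠ i₁ → l ≠ i₁ →
            pairAngle (sectorCenter n' (ω m)) (sectorCenter n' (ω l)) ≤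
              pairAngle (sectorCenter n' (ω i)) (sectorCenter n' (ω j))) ∧
          pairAngle (sectorCenter n' (ω i₁)) (sectorCenter n' (ω k₀)) ≤ Ψ ∧
          (∀ m, m ≠ i → m ≠ j → ω m = ρ m) ∧ ω i = ab.1 ∧ ω j = ab.2) :
    (E.card : ℝ) ≤ (2 * (2 * Φ / sectorWidth n' + 1)) ^ 2 := by
  classical
  set Wp := Finset.univ.filter (fun c : Fin (sectorCount n') =>
    pairAngle (sectorCenter n' c) (sectorCenter n' (ρ k₀)) ≤ Φ) with hWp
  have hsub : E ⊆ Wp ×ˢ Wp := by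
    rintro ⟨a, b⟩ hab
    obtain ⟨hφ, ω, -, hMP, -, hρω, hωi, hωj⟩ := hE _ hab
    have hk : sectorCenter n' (ω k₀) = sectorCenter n' (ρ k₀) := by rw [hρω k₀ hk₀i hk₀j]
    rw [Finset.mem_product]
    simp only [hWp, Finset.mem_filter, Finset.mem_univ, true_and]
    constructor
    · have h1 := hMP i k₀ hi hk₀
      rw [hk, hωi, hωj] at h1
      exact h1.trans hφ
    · have h1 := hMP j k₀ hj hk₀
      rw [hk, hωi, hωj] at h1
      exact h1.trans hφ
  have hW := card_centres_modpi_le n' (sectorCenter n' (ρ k₀)) Φ hΦ0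
  rw [← hWp] at hW
  calc (E.card : ℝ) ≤ ((Wp ×ˢ Wp).card : ℝ) := by exact_mod_cast Finset.card_le_card hsub
    _ = (Wp.card : ℝ) ^ 2 := by rw [Finset.card_product]; push_cast; ring
    _ ≤ (2 * (2 * Φ / sectorWidth n' + 1)) ^ 2 := pow_le_pow_left₀ (by positivity) hW 2


/-- **The fibre of the solved pair, target twin of `fibre_bound`**: strings of one max-pair class agreeing off `{i, j}`, with target `R`
and anchored leg within `Ψ` of the frame leg, number at most `(2(2Φ/w′+1))² + max((2(2c₀K₂c₃/π+1)L_Ψ)², 4c₃²K₂²L_Ψ²/η₀²)` for any regime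
parameter `Φ` with `2^{−n′} ≤ Φ`, `c₃2^{−n′} ≤ Φ`, `K₂L_Ψc₃2^{−n′} ≤ c₂′Φ`. [cite: BenfattoGiulianiMastropietro2003, §7.4 (s1.24)–(s1.26) p.28 (L37–52)] -/
theorem fibre_bound_target {ε : (Fin 2 → ℝ) → ℝ} {μ e₀ : ℝ} {u : ℝ → ℝ → ℝ} (hD : DispersionHyp ε μ e₀ u) {c₂ c₃ K₁ K₂ c₀ c₂' η₀ : ℝ}
    (hlip : ∀ θ₁ θ₂ : ℝ, torusDist (normalAngle u θ₂ 0 - normalAngle u θ₁ 0) ≤ c₂ * torusDist (θ₂ - θ₁))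
    (hpi : ∀ θ : ℝ, normalAngle u (θ + π) 0 = normalAngle u θ 0 + π) (hc₂ : 0 ≤ c₂) (hc₃ : 0 < c₃)
    (h73 : ∀ (n ω : ℕ), ω < sectorCount n → ∀ p ∈ sSector u e₀ n ω,
      ∃ k₁ k₂ : ℝ,
        p = fermiPoint u (sectorCenter n ω) + k₁ • unitNormal u (sectorCenter n ω) 0 +
              k₂ • unitTangent u (sectorCenter n ω) 0 ∧
        |k₁| ≤ c₃ * (4 : ℝ) ^ (-(n : ℤ)) ∧ |k₂| ≤ c₃ * (2 : ℝ) ^ (-(n : ℤ)) ∧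
        |fderiv ℝ ε p (unitTangent u (sectorCenter n ω) 0)| ≤ c₃ * (2 : ℝ) ^ (-(n : ℤ)))
    (hK₁0 : 0 ≤ K₁)
    (hK₂ : K₂ = K₁ * π + 4) (hc₀ : 0 < c₀) (hc₂' : 0 < c₂') (hη₀ : 0 < η₀)
    (h75 : ∀ θ₁' θ₂' η r₁ r₂ : ℝ, (θ₁', θ₂') ∈ pairChartDomain →
        |r₁| ≤ (2 * K₁ + 4 * c₂) / K₂ * η * pairAngle θ₁' θ₂' → |r₂| ≤ η → η ≤ c₂' * pairAngle θ₁' θ₂' →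
          η ≤ η₀ →
          fermiPoint u θ₁' + fermiPoint u θ₂' + (r₁ • unitNormal u θ₁' 0 + r₂ • unitTangent u θ₁' 0)
              ∈ pairRange u ∧
          ∃ θ₁ θ₂ : ℝ,
            fermiPoint u θ₁' + fermiPoint u θ₂' + (r₁ • unitNormal u θ₁' 0 + r₂ • unitTangent u θ₁' 0) =
              fermiPoint u θ₁ + fermiPoint u θ₂ ∧
            |θ₁ - θ₁'| ≤ c₀ * η ∧ |θ₂ - θ₂'| ≤ c₀ * η)
    {n' L : ℕ} (hL : 4 ≤ L) (i₁ : Fin L)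
    {i j k₀ : Fin L} (hij : i ≠ j) (hi : i ≠ i₁) (hj : j ≠ i₁) (hk₀i : k₀ ≠ i) (hk₀j : k₀ ≠ j) (hk₀ : k₀ ≠ i₁)
    (ρ : Fin L → Fin (sectorCount n')) (R : Fin 2 → ℝ) {Φ Ψ LΨ : ℝ} (hΨ : 0 ≤ Ψ) (hK₁c : 2 + c₂ ≤ K₁)
    (hLΨ : LΨ = L + c₂ * Ψ / (K₁ * Φ)) (hΦt : (2 : ℝ) ^ (-(n' : ℤ)) ≤ Φ) (hΦδ : c₃ * (2 : ℝ) ^ (-(n' : ℤ)) ≤ Φ)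
    (hΦη : K₂ * LΨ * (c₃ * (2 : ℝ) ^ (-(n' : ℤ))) ≤ c₂' * Φ)
    (F : Finset (Fin L → Fin (sectorCount n')))
    (hF : ∀ ω ∈ F,
      (∃ k : Fin L → (Fin 2 → ℝ), (∀ i : Fin L, k i ∈ sSector u e₀ n' (ω i : ℕ)) ∧ ∑ i, k i = R) ∧
      (∀ m l : Fin L, m ≠ i₁ → l ≠ i₁ →
        pairAngle (sectorCenter n' (ω m)) (sectorCenter n' (ω l)) ≤
          pairAngle (sectorCenter n' (ω i)) (sectorCenter n' (ω j))) ∧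
      pairAngle (sectorCenter n' (ω i₁)) (sectorCenter n' (ω k₀)) ≤ Ψ ∧
      ∀ m, m ≠ i → m ≠ j → ω m = ρ m) :
    (F.card : ℝ) ≤ (2 * (2 * Φ / sectorWidth n' + 1)) ^ 2 +
      max ((2 * ((2 * c₀ * K₂ * c₃ / π + 1) * LΨ)) ^ 2) (4 * c₃ ^ 2 * K₂ ^ 2 / η₀ ^ 2 * LΨ ^ 2) := by
  classical
  have hL1 : 1 ≤ L := by omega
  have htpos : 0 < (2 : ℝ) ^ (-(n' : ℤ)) := zpow_pos (by norm_num) _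
  have hΦ0 : 0 ≤ Φ := htpos.le.trans hΦt
  set g : (Fin L → Fin (sectorCount n')) → Fin (sectorCount n') × Fin (sectorCount n') :=
    fun ω => (ω i, ω j) with hg
  have hinj : Set.InjOn g F := by
    intro ω hω ω' hω' hgg
    have h1 : ω i = ω' i := congrArg Prod.fst hgg
    have h2 : ω j = ω' j := congrArg Prod.snd hgg
    have hρ := (hF ω (Finset.mem_coe.1 hω)).2.2.2
    have hρ' := (hF ω' (Finset.mem_coe.1 hω')).2.2.2
    funext m
    by_cases hmi : m = i
    · rw [hmi]; exact h1
    by_cases hmj : m = j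
    · rw [hmj]; exact h2
    rw [hρ m hmi hmj, hρ' m hmi hmj]
  set Eρ := F.image g with hEρ
  have hcardF : F.card = Eρ.card := (Finset.card_image_of_injOn hinj).symm
  have hEρ_spec : ∀ ab ∈ Eρ, ∃ ω : Fin L → Fin (sectorCount n'),
      (∃ k : Fin L → (Fin 2 → ℝ), (∀ i : Fin L, k i ∈ sSector u e₀ n' (ω i : ℕ)) ∧ ∑ i, k i = R) ∧
      (∀ m l : Fin L, m ≠ i₁ → l ≠ i₁ →
        pairAngle (sectorCenter n' (ω m)) (sectorCenter n' (ω l)) ≤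
          pairAngle (sectorCenter n' (ω i)) (sectorCenter n' (ω j))) ∧
      pairAngle (sectorCenter n' (ω i₁)) (sectorCenter n' (ω k₀)) ≤ Ψ ∧
      (∀ m, m ≠ i → m ≠ j → ω m = ρ m) ∧ ω i = ab.1 ∧ ω j = ab.2 := by
    intro ab hab
    obtain ⟨ω, hωF, hωab⟩ := Finset.mem_image.1 hab
    obtain ⟨hωS, hωMP, hωW, hωρ⟩ := hF ω hωF
    exact ⟨ω, hωS, hωMP, hωW, hωρ, congrArg Prod.fst hωab, congrArg Prod.snd hωab⟩
  set Es := Eρ.filter (fun ab => pairAngle (sectorCenter n' ab.1) (sectorCenter n' ab.2) ≤ Φ) with hEs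
  set El := Eρ.filter (fun ab => ¬ pairAngle (sectorCenter n' ab.1) (sectorCenter n' ab.2) ≤ Φ) with hEl
  have hsplit : Eρ.card = Es.card + El.card :=
    (Finset.card_filter_add_card_filter_not _).symm
  have hEs_le := fibre_small_target hi hj hk₀ hk₀i hk₀j ρ R (Ψ := Ψ) hΦ0 Es (fun ab hab => by
    obtain ⟨h1, h2⟩ := Finset.mem_filter.1 hab
    exact ⟨h2, hEρ_spec ab h1⟩)
  have hEl_le := fibre_large_target hD hlip hpi hc₂ hc₃ h73 hK₁0 hK₂ hc₀ hc₂' hη₀ h75 hL1 hij hi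
    hk₀i hk₀j hk₀ ρ R hΨ hK₁c hLΨ hΦt hΦδ hΦη El (fun ab hab => by
    obtain ⟨h1, h2⟩ := Finset.mem_filter.1 hab
    exact ⟨not_le.1 h2, hEρ_spec ab h1⟩)
  rw [hcardF, hsplit, Nat.cast_add]
  exact add_le_add hEs_le hEl_le


/-- **One max-pair class, target twin of `class_bound`**: TARGET strings (`Σ k = R`) anchored at `ω₁`, refining `ωt` off the anchored leg,
anchored leg within `Ψ` of every other leg (mod `π`), with maximal pair `(i, j)`: projecting onto the legs `∉ {i, j}` lands in a product of
refinement sets of size `≤ (3·2^{n′−n})^{L−3}` and each fibre has `≤ B_fib` elements (`fibre_bound_target`). [cite: BenfattoGiulianiMastropietro2003, §7.4 (s1.23)–(s1.25a) p.28 (L33–52)] -/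
theorem class_bound_target {ε : (Fin 2 → ℝ) → ℝ} {μ e₀ : ℝ} {u : ℝ → ℝ → ℝ} (hD : DispersionHyp ε μ e₀ u) {c₂ c₃ K₁ K₂ c₀ c₂' η₀ : ℝ}
    (hlip : ∀ θ₁ θ₂ : ℝ, torusDist (normalAngle u θ₂ 0 - normalAngle u θ₁ 0) ≤ c₂ * torusDist (θ₂ - θ₁))
    (hpi : ∀ θ : ℝ, normalAngle u (θ + π) 0 = normalAngle u θ 0 + π) (hc₂ : 0 ≤ c₂) (hc₃ : 0 < c₃)
    (h73 : ∀ (n ω : ℕ), ω < sectorCount n → ∀ p ∈ sSector u e₀ n ω,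
      ∃ k₁ k₂ : ℝ,
        p = fermiPoint u (sectorCenter n ω) + k₁ • unitNormal u (sectorCenter n ω) 0 +
              k₂ • unitTangent u (sectorCenter n ω) 0 ∧
        |k₁| ≤ c₃ * (4 : ℝ) ^ (-(n : ℤ)) ∧ |k₂| ≤ c₃ * (2 : ℝ) ^ (-(n : ℤ)) ∧
        |fderiv ℝ ε p (unitTangent u (sectorCenter n ω) 0)| ≤ c₃ * (2 : ℝ) ^ (-(n : ℤ)))
    (hK₁0 : 0 ≤ K₁)
    (hK₂ : K₂ = K₁ * π + 4) (hc₀ : 0 < c₀) (hc₂' : 0 < c₂') (hη₀ : 0 < η₀)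
    (h75 : ∀ θ₁' θ₂' η r₁ r₂ : ℝ, (θ₁', θ₂') ∈ pairChartDomain →
        |r₁| ≤ (2 * K₁ + 4 * c₂) / K₂ * η * pairAngle θ₁' θ₂' → |r₂| ≤ η → η ≤ c₂' * pairAngle θ₁' θ₂' →
          η ≤ η₀ →
          fermiPoint u θ₁' + fermiPoint u θ₂' + (r₁ • unitNormal u θ₁' 0 + r₂ • unitTangent u θ₁' 0)
              ∈ pairRange u ∧
          ∃ θ₁ θ₂ : ℝ,
            fermiPoint u θ₁' + fermiPoint u θ₂' + (r₁ • unitNormal u θ₁' 0 + r₂ • unitTangent u θ₁' 0) =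
              fermiPoint u θ₁ + fermiPoint u θ₂ ∧
            |θ₁ - θ₁'| ≤ c₀ * η ∧ |θ₂ - θ₂'| ≤ c₀ * η)
    {n n' : ℕ} (hn : n ≤ n') {L : ℕ} (hL : 4 ≤ L) (i₁ : Fin L) {ω₁ : ℕ} (hω₁ : ω₁ < sectorCount n')
    {ωt : Fin L → ℕ} (hωt : ∀ i, ωt i < sectorCount n)
    {i j : Fin L} (hij : i ≠ j) (hi : i ≠ i₁) (hj : j ≠ i₁)
    (R : Fin 2 → ℝ) {Φ Ψ LΨ Bfib : ℝ} (hΨ : 0 ≤ Ψ) (hK₁c : 2 + c₂ ≤ K₁)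
    (hLΨ : LΨ = L + c₂ * Ψ / (K₁ * Φ)) (hΦt : (2 : ℝ) ^ (-(n' : ℤ)) ≤ Φ) (hΦδ : c₃ * (2 : ℝ) ^ (-(n' : ℤ)) ≤ Φ)
    (hΦη : K₂ * LΨ * (c₃ * (2 : ℝ) ^ (-(n' : ℤ))) ≤ c₂' * Φ)
    (hBfib : (2 * (2 * Φ / sectorWidth n' + 1)) ^ 2 +
      max ((2 * ((2 * c₀ * K₂ * c₃ / π + 1) * LΨ)) ^ 2) (4 * c₃ ^ 2 * K₂ ^ 2 / η₀ ^ 2 * LΨ ^ 2) ≤ Bfib)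
    (T : Finset (Fin L → Fin (sectorCount n')))
    (hT : ∀ ω ∈ T,
      ((ω i₁ : ℕ) = ω₁ ∧ (∀ i' : Fin L, i' ≠ i₁ → sSector u e₀ n' (ω i' : ℕ) ⊆ sSector u e₀ n (ωt i')) ∧
        ∃ k : Fin L → (Fin 2 → ℝ), (∀ i' : Fin L, k i' ∈ sSector u e₀ n' (ω i' : ℕ)) ∧ ∑ i', k i' = R) ∧
      (∀ m l : Fin L, m ≠ i₁ → l ≠ i₁ →
        pairAngle (sectorCenter n' (ω m)) (sectorCenter n' (ω l)) ≤
          pairAngle (sectorCenter n' (ω i)) (sectorCenter n' (ω j))) ∧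
      (∀ m : Fin L, m ≠ i₁ → pairAngle (sectorCenter n' (ω i₁)) (sectorCenter n' (ω m)) ≤ Ψ)) :
    (T.card : ℝ) ≤ Bfib * (3 * (2 : ℝ) ^ (n' - n)) ^ (L - 3) := by
  classical
  have hBfib0 : 0 ≤ Bfib := by
    refine le_trans ?_ hBfib
    have h1 : 0 ≤ (2 * (2 * Φ / sectorWidth n' + 1)) ^ 2 := sq_nonneg _
    have h2 : 0 ≤ max ((2 * ((2 * c₀ * K₂ * c₃ / π + 1) * LΨ)) ^ 2) (4 * c₃ ^ 2 * K₂ ^ 2 / η₀ ^ 2 * LΨ ^ 2) :=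
      le_max_of_le_left (sq_nonneg _)
    linarith
  -- a third free leg `k₀`
  obtain ⟨k₀, hk₀mem⟩ : (((Finset.univ.erase i₁).erase i).erase j).Nonempty := by
    rw [← Finset.card_pos]
    have h1 : i ∈ Finset.univ.erase i₁ := Finset.mem_erase.2 ⟨hi, Finset.mem_univ _⟩
    have h2 : j ∈ (Finset.univ.erase i₁).erase i := Finset.mem_erase.2 ⟨hij.symm, Finset.mem_erase.2 ⟨hj, Finset.mem_univ _⟩⟩
    rw [Finset.card_erase_of_mem h2, Finset.card_erase_of_mem h1, Finset.card_erase_of_mem (Finset.mem_univ _),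
      Finset.card_univ, Fintype.card_fin]
    omega
  have hk₀j : k₀ ≠ j := Finset.ne_of_mem_erase hk₀mem
  have hk₀i : k₀ ≠ i := Finset.ne_of_mem_erase (Finset.mem_of_mem_erase hk₀mem)
  have hk₀ : k₀ ≠ i₁ := Finset.ne_of_mem_erase (Finset.mem_of_mem_erase (Finset.mem_of_mem_erase hk₀mem))
  -- the projection onto the other legs and its target
  set z : Fin (sectorCount n') := ⟨0, sectorCount_pos n'⟩ with hz
  set proj : (Fin L → Fin (sectorCount n')) → (Fin L → Fin (sectorCount n')) :=
    fun ω => Function.update (Function.update ω i z) j z with hproj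
  have hproj_i : ∀ ω, proj ω i = z := fun ω => by
    simp only [hproj]; rw [Function.update_of_ne hij, Function.update_self]
  have hproj_j : ∀ ω, proj ω j = z := fun ω => by simp only [hproj]; rw [Function.update_self]
  have hproj_o : ∀ ω m, m ≠ i → m ≠ j → proj ω m = ω m := fun ω m hmi hmj => by
    simp only [hproj]; rw [Function.update_of_ne hmj, Function.update_of_ne hmi]
  obtain ⟨Ref, hRef⟩ : ∃ Ref : Fin L → Finset (Fin (sectorCount n')),
      ∀ m, Ref m = Finset.univ.filter (fun a : Fin (sectorCount n') => sSector u e₀ n' a ⊆ sSector u e₀ n (ωt m)) :=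
    ⟨_, fun m => rfl⟩
  have hRefcard : ∀ m, (Ref m).card ≤ 3 * 2 ^ (n' - n) := fun m => by
    rw [hRef]; exact card_refinements_le hD hn (hωt m)
  set tf : Fin L → Finset (Fin (sectorCount n')) :=
    fun m => if m = i ∨ m = j then {z} else if m = i₁ then {⟨ω₁, hω₁⟩} else Ref m with htf
  set A := Fintype.piFinset tf with hA
  -- strings of the class project into `A`
  have hmaps : ∀ ω ∈ T, proj ω ∈ A := by
    intro ω hω
    obtain ⟨hωS, -⟩ := hT ω hω
    obtain ⟨hω₁eq, hsub, -⟩ := hωS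
    rw [hA, Fintype.mem_piFinset]
    intro m
    simp only [htf]
    by_cases hm : m = i ∨ m = j
    · rw [if_pos hm, Finset.mem_singleton]
      rcases hm with rfl | rfl
      · exact hproj_i ω
      · exact hproj_j ω
    · rw [if_neg hm]
      rw [not_or] at hm
      rw [hproj_o ω m hm.1 hm.2]
      by_cases hm₁ : m = i₁
      · rw [if_pos hm₁, Finset.mem_singleton, hm₁]
        exact Fin.ext hω₁eq
      · rw [if_neg hm₁, hRef, Finset.mem_filter]
        exact ⟨Finset.mem_univ _, hsub m hm₁⟩
  -- the fibres: the solved pair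
  have hfib : ∀ ρ ∈ A, ((T).filter (fun ω => proj ω = ρ)).card ≤ ⌊Bfib⌋₊ := by
    intro ρ _
    apply Nat.le_floor
    refine le_trans (fibre_bound_target hD hlip hpi hc₂ hc₃ h73 hK₁0 hK₂ hc₀ hc₂' hη₀ h75 hL i₁
      hij hi hj hk₀i hk₀j hk₀ ρ R hΨ hK₁c hLΨ hΦt hΦδ hΦη _ (fun ω hω => ?_)) hBfib
    obtain ⟨hωT, hωρ⟩ := Finset.mem_filter.1 hω
    obtain ⟨⟨-, -, hk⟩, hωMP, hωW⟩ := hT ω hωT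
    exact ⟨hk, hωMP, hωW k₀ hk₀, fun m hmi hmj => by rw [← hproj_o ω m hmi hmj, hωρ]⟩
  -- the size of the target `A`: (s1.23) for each of the `L - 3` free legs
  have hAcard : A.card ≤ (3 * 2 ^ (n' - n)) ^ (L - 3) := by
    rw [hA, Fintype.card_piFinset]
    have hle : ∀ m, (tf m).card ≤ if m = i ∨ m = j ∨ m = i₁ then 1 else 3 * 2 ^ (n' - n) := by
      intro m
      simp only [htf]
      by_cases hm : m = i ∨ m = j
      · rw [if_pos hm, if_pos (by tauto), Finset.card_singleton]
      · rw [if_neg hm]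
        by_cases hm₁ : m = i₁
        · rw [if_pos hm₁, if_pos (by tauto), Finset.card_singleton]
        · rw [if_neg hm₁, if_neg (by tauto)]; exact hRefcard m
    calc ∏ m, (tf m).card ≤ ∏ m : Fin L, (if m = i ∨ m = j ∨ m = i₁ then 1 else 3 * 2 ^ (n' - n)) :=
          Finset.prod_le_prod' fun m _ => hle m
      _ = (3 * 2 ^ (n' - n)) ^ (Finset.univ.filter (fun m : Fin L => ¬(m = i ∨ m = j ∨ m = i₁))).card := by
          rw [Finset.prod_ite, Finset.prod_const_one, one_mul, Finset.prod_const]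
      _ = (3 * 2 ^ (n' - n)) ^ (L - 3) := by
          congr 1
          have h3 : (Finset.univ.filter (fun m : Fin L => m = i ∨ m = j ∨ m = i₁)).card = 3 := by
            rw [Finset.card_eq_three]
            refine ⟨i, j, i₁, hij, hi, hj, ?_⟩
            ext m; simp
          have := Finset.card_filter_add_card_filter_not (s := (Finset.univ : Finset (Fin L)))
            (fun m : Fin L => m = i ∨ m = j ∨ m = i₁)
          rw [h3, Finset.card_univ, Fintype.card_fin] at this
          omega
  -- assemble the class bound
  have hTle := Finset.card_le_mul_card_image_of_maps_to hmaps (⌊Bfib⌋₊) hfib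
  have h1 : ((T).card : ℝ) ≤ (⌊Bfib⌋₊ : ℝ) * (A.card : ℝ) := by exact_mod_cast hTle
  have h2 : (⌊Bfib⌋₊ : ℝ) ≤ Bfib := Nat.floor_le hBfib0
  have h3 : (A.card : ℝ) ≤ (3 * (2 : ℝ) ^ (n' - n)) ^ (L - 3) := by exact_mod_cast hAcard
  calc ((T).card : ℝ) ≤ (⌊Bfib⌋₊ : ℝ) * (A.card : ℝ) := h1
    _ ≤ Bfib * (3 * (2 : ℝ) ^ (n' - n)) ^ (L - 3) :=
        mul_le_mul h2 h3 (by positivity) hBfib0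


/-- **BGM 2003 Lemma 3.1 WITH A TARGET VECTOR and a transversality parameter** («CLAIM U», cell gate-hubbard-kl): the number of strings
of scale-`n′` sectors anchored at `ω₁`, refining the coarse string `ωt` off the anchored leg, whose anchored leg is within `Ψ` (mod `π`) of
every other leg, and which carry momenta summing to the prescribed vector `R`, is at most `L² · B_fib · (3·2^{n′−n})^{L−3}` for any regime
parameter `Φ` (`2^{−n′} ≤ Φ`, `c₃2^{−n′} ≤ Φ`, `K₂ L_Ψ c₃ 2^{−n′} ≤ c₂′ Φ`, `L_Ψ = L + c₂Ψ/(K₁Φ)`) and any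
`B_fib ≥ (2(2Φ/w′+1))² + max((2(2c₀K₂c₃/π+1)L_Ψ)², 4c₃²K₂²L_Ψ²/η₀²)`.  For `R = 0` every string satisfies the wedge hypothesis with
`Ψ = C_w·L·(max pair angle)` (`wedge_bound`) and the printed Lemma 3.1 follows; for `R = 2πG ≠ 0` («umklapp strings») the loss of a
transversal anchored leg is the factor `L_Ψ²/L²`. [cite: BenfattoGiulianiMastropietro2003, §3.1 Lemma 3.1 (4.3) p.17 (L46–58) and §7.4 (4.3app)–(s1.42) p.28 (L6–125)] -/
theorem count_target {ε : (Fin 2 → ℝ) → ℝ} {μ e₀ : ℝ} {u : ℝ → ℝ → ℝ} (hD : DispersionHyp ε μ e₀ u) {c₂ c₃ K₁ K₂ c₀ c₂' η₀ : ℝ}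
    (hlip : ∀ θ₁ θ₂ : ℝ, torusDist (normalAngle u θ₂ 0 - normalAngle u θ₁ 0) ≤ c₂ * torusDist (θ₂ - θ₁))
    (hpi : ∀ θ : ℝ, normalAngle u (θ + π) 0 = normalAngle u θ 0 + π) (hc₂ : 0 ≤ c₂) (hc₃ : 0 < c₃)
    (h73 : ∀ (n ω : ℕ), ω < sectorCount n → ∀ p ∈ sSector u e₀ n ω,
      ∃ k₁ k₂ : ℝ,
        p = fermiPoint u (sectorCenter n ω) + k₁ • unitNormal u (sectorCenter n ω) 0 +
              k₂ • unitTangent u (sectorCenter n ω) 0 ∧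
        |k₁| ≤ c₃ * (4 : ℝ) ^ (-(n : ℤ)) ∧ |k₂| ≤ c₃ * (2 : ℝ) ^ (-(n : ℤ)) ∧
        |fderiv ℝ ε p (unitTangent u (sectorCenter n ω) 0)| ≤ c₃ * (2 : ℝ) ^ (-(n : ℤ)))
    (hK₁0 : 0 ≤ K₁)
    (hK₂ : K₂ = K₁ * π + 4) (hc₀ : 0 < c₀) (hc₂' : 0 < c₂') (hη₀ : 0 < η₀)
    (h75 : ∀ θ₁' θ₂' η r₁ r₂ : ℝ, (θ₁', θ₂') ∈ pairChartDomain →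
        |r₁| ≤ (2 * K₁ + 4 * c₂) / K₂ * η * pairAngle θ₁' θ₂' → |r₂| ≤ η → η ≤ c₂' * pairAngle θ₁' θ₂' →
          η ≤ η₀ →
          fermiPoint u θ₁' + fermiPoint u θ₂' + (r₁ • unitNormal u θ₁' 0 + r₂ • unitTangent u θ₁' 0)
              ∈ pairRange u ∧
          ∃ θ₁ θ₂ : ℝ,
            fermiPoint u θ₁' + fermiPoint u θ₂' + (r₁ • unitNormal u θ₁' 0 + r₂ • unitTangent u θ₁' 0) =
              fermiPoint u θ₁ + fermiPoint u θ₂ ∧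
            |θ₁ - θ₁'| ≤ c₀ * η ∧ |θ₂ - θ₂'| ≤ c₀ * η)
    {n n' : ℕ} (hn : n ≤ n') {L : ℕ} (hL : 4 ≤ L) (i₁ : Fin L) {ω₁ : ℕ} (hω₁ : ω₁ < sectorCount n')
    {ωt : Fin L → ℕ} (hωt : ∀ i, ωt i < sectorCount n)
    (R : Fin 2 → ℝ) {Φ Ψ LΨ Bfib : ℝ} (hΨ : 0 ≤ Ψ) (hK₁c : 2 + c₂ ≤ K₁)
    (hLΨ : LΨ = L + c₂ * Ψ / (K₁ * Φ)) (hΦt : (2 : ℝ) ^ (-(n' : ℤ)) ≤ Φ) (hΦδ : c₃ * (2 : ℝ) ^ (-(n' : ℤ)) ≤ Φ)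
    (hΦη : K₂ * LΨ * (c₃ * (2 : ℝ) ^ (-(n' : ℤ))) ≤ c₂' * Φ)
    (hBfib : (2 * (2 * Φ / sectorWidth n' + 1)) ^ 2 +
      max ((2 * ((2 * c₀ * K₂ * c₃ / π + 1) * LΨ)) ^ 2) (4 * c₃ ^ 2 * K₂ ^ 2 / η₀ ^ 2 * LΨ ^ 2) ≤ Bfib) :
    (Nat.card {ω : Fin L → Fin (sectorCount n') |
        (ω i₁ : ℕ) = ω₁ ∧ (∀ i' : Fin L, i' ≠ i₁ → sSector u e₀ n' (ω i' : ℕ) ⊆ sSector u e₀ n (ωt i')) ∧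
        (∀ m : Fin L, m ≠ i₁ → pairAngle (sectorCenter n' (ω i₁)) (sectorCenter n' (ω m)) ≤ Ψ) ∧
        ∃ k : Fin L → (Fin 2 → ℝ), (∀ i' : Fin L, k i' ∈ sSector u e₀ n' (ω i' : ℕ)) ∧ ∑ i', k i' = R} : ℝ) ≤
      L ^ 2 * (Bfib * (3 * (2 : ℝ) ^ (n' - n)) ^ (L - 3)) := by
  classical
  -- the strings as a Finset
  set Str : Set (Fin L → Fin (sectorCount n')) := {ω : Fin L → Fin (sectorCount n') |
        (ω i₁ : ℕ) = ω₁ ∧ (∀ i' : Fin L, i' ≠ i₁ → sSector u e₀ n' (ω i' : ℕ) ⊆ sSector u e₀ n (ωt i')) ∧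
        (∀ m : Fin L, m ≠ i₁ → pairAngle (sectorCenter n' (ω i₁)) (sectorCenter n' (ω m)) ≤ Ψ) ∧
        ∃ k : Fin L → (Fin 2 → ℝ), (∀ i' : Fin L, k i' ∈ sSector u e₀ n' (ω i' : ℕ)) ∧ ∑ i', k i' = R} with hStr
  set S := Str.toFinset with hS
  have hmemS : ∀ ω, ω ∈ S ↔ ω ∈ Str := fun ω => Set.mem_toFinset
  have hcardS : Nat.card Str = S.card := by
    rw [hS, Nat.card_eq_card_toFinset]
  rw [hcardS]
  -- the classes
  obtain ⟨T, hT⟩ : ∃ T : Fin L × Fin L → Finset (Fin L → Fin (sectorCount n')),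
      ∀ p ω, ω ∈ T p ↔ ω ∈ S ∧ ∀ m l : Fin L, m ≠ i₁ → l ≠ i₁ →
        pairAngle (sectorCenter n' (ω m)) (sectorCenter n' (ω l)) ≤
          pairAngle (sectorCenter n' (ω p.1)) (sectorCenter n' (ω p.2)) :=
    ⟨fun p => S.filter (fun ω => ∀ m l : Fin L, m ≠ i₁ → l ≠ i₁ →
        pairAngle (sectorCenter n' (ω m)) (sectorCenter n' (ω l)) ≤
          pairAngle (sectorCenter n' (ω p.1)) (sectorCenter n' (ω p.2))), fun p ω => Finset.mem_filter⟩
  obtain ⟨Pairs, hPairs⟩ : ∃ Pairs : Finset (Fin L × Fin L),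
      ∀ p, p ∈ Pairs ↔ p.1 ≠ p.2 ∧ p.1 ≠ i₁ ∧ p.2 ≠ i₁ :=
    ⟨Finset.univ.filter (fun p : Fin L × Fin L => p.1 ≠ p.2 ∧ p.1 ≠ i₁ ∧ p.2 ≠ i₁), fun p => by simp⟩
  -- (s1.22): every string has a maximal pair among the legs `≠ i₁`
  have hcover : S ⊆ Pairs.biUnion T := by
    intro ω hω
    have hPne : Pairs.Nonempty := by
      have hcard : 1 < (Finset.univ.erase i₁).card := by
        rw [Finset.card_erase_of_mem (Finset.mem_univ _), Finset.card_univ, Fintype.card_fin]; omega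
      obtain ⟨a, ha, b, hb, hab⟩ := Finset.one_lt_card.1 hcard
      exact ⟨(a, b), (hPairs _).2 ⟨hab, Finset.ne_of_mem_erase ha, Finset.ne_of_mem_erase hb⟩⟩
    obtain ⟨p, hp, hmax⟩ := Pairs.exists_max_image
      (fun q : Fin L × Fin L => pairAngle (sectorCenter n' (ω q.1)) (sectorCenter n' (ω q.2))) hPne
    rw [Finset.mem_biUnion]
    refine ⟨p, hp, (hT p ω).2 ⟨hω, fun m l hm hl => ?_⟩⟩
    by_cases hml : m = l
    · rw [hml, pairAngle_self']; exact (pairAngle_bounds _ _).1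
    · exact hmax (m, l) ((hPairs _).2 ⟨hml, hm, hl⟩)
  -- the bound for one class
  have hclass : ∀ p ∈ Pairs, ((T p).card : ℝ) ≤ Bfib * (3 * (2 : ℝ) ^ (n' - n)) ^ (L - 3) := by
    rintro ⟨i, j⟩ hp
    obtain ⟨hij, hi, hj⟩ := (hPairs _).1 hp
    exact class_bound_target hD hlip hpi hc₂ hc₃ h73 hK₁0 hK₂ hc₀ hc₂' hη₀ h75 hn hL i₁
      hω₁ hωt hij hi hj R hΨ hK₁c hLΨ hΦt hΦδ hΦη hBfib (T (i, j)) (fun ω hω => by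
        obtain ⟨h1, h2⟩ := (hT _ ω).1 hω
        have h1' := (hmemS ω).1 h1
        rw [hStr] at h1'
        obtain ⟨hω₁eq, hsub, hW, hk⟩ := h1'
        exact ⟨⟨hω₁eq, hsub, hk⟩, h2, hW⟩)
  -- sum over the classes
  have hPcard : (Pairs.card : ℝ) ≤ L ^ 2 := by
    have : Pairs.card ≤ (Finset.univ : Finset (Fin L × Fin L)).card := Finset.card_le_card (Finset.subset_univ _)
    rw [Finset.card_univ, Fintype.card_prod, Fintype.card_fin] at this
    exact_mod_cast this.trans_eq (by ring)
  have hBfib0 : 0 ≤ Bfib := by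
    refine le_trans ?_ hBfib
    have h1 : 0 ≤ (2 * (2 * Φ / sectorWidth n' + 1)) ^ 2 := sq_nonneg _
    have h2 : 0 ≤ max ((2 * ((2 * c₀ * K₂ * c₃ / π + 1) * LΨ)) ^ 2) (4 * c₃ ^ 2 * K₂ ^ 2 / η₀ ^ 2 * LΨ ^ 2) :=
      le_max_of_le_left (sq_nonneg _)
    linarith
  calc (S.card : ℝ) ≤ ((Pairs.biUnion T).card : ℝ) := by exact_mod_cast Finset.card_le_card hcover
    _ ≤ ∑ p ∈ Pairs, ((T p).card : ℝ) := by exact_mod_cast Finset.card_biUnion_le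
    _ ≤ ∑ _p ∈ Pairs, Bfib * (3 * (2 : ℝ) ^ (n' - n)) ^ (L - 3) := Finset.sum_le_sum hclass
    _ = Pairs.card * (Bfib * (3 * (2 : ℝ) ^ (n' - n)) ^ (L - 3)) := by
        rw [Finset.sum_const, nsmul_eq_mul]
    _ ≤ L ^ 2 * (Bfib * (3 * (2 : ℝ) ^ (n' - n)) ^ (L - 3)) := by gcongr


/-! ### WIDE-bundle variants (no near-fibre term) -/

/-- **One max-pair class, WIDE-bundle variant of `class_bound_target`**: if two legs `i₀, j₀ ≠ i₁` have pair angle `> Φ` in every string of the class, the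
near fibre is EMPTY (the maximal pair dominates `(i₀, j₀)`), so only the far-fibre bound is charged — no `(2(2Φ/w′+1))²` term — and `Φ` may be taken as large
as that angle allows (honest wide-bundle loss `L_Ψ/L = 1 + c₂Ψ/(K₁LΦ)`).  Original docstring: **One max-pair class, target twin of `class_bound`**: TARGET strings (`Σ k = R`) anchored at `ω₁`, refining `ωt` off the anchored leg,
anchored leg within `Ψ` of every other leg (mod `π`), with maximal pair `(i, j)`: projecting onto the legs `∉ {i, j}` lands in a product of
refinement sets of size `≤ (3·2^{n′−n})^{L−3}` and each fibre has `≤ B_fib` elements (`fibre_bound_target`). [cite: BenfattoGiulianiMastropietro2003, §7.4 (s1.23)–(s1.25a) p.28 (L33–52)] -/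
theorem class_bound_target_wide {ε : (Fin 2 → ℝ) → ℝ} {μ e₀ : ℝ} {u : ℝ → ℝ → ℝ} (hD : DispersionHyp ε μ e₀ u) {c₂ c₃ K₁ K₂ c₀ c₂' η₀ : ℝ}
    (hlip : ∀ θ₁ θ₂ : ℝ, torusDist (normalAngle u θ₂ 0 - normalAngle u θ₁ 0) ≤ c₂ * torusDist (θ₂ - θ₁))
    (hpi : ∀ θ : ℝ, normalAngle u (θ + π) 0 = normalAngle u θ 0 + π) (hc₂ : 0 ≤ c₂) (hc₃ : 0 < c₃)
    (h73 : ∀ (n ω : ℕ), ω < sectorCount n → ∀ p ∈ sSector u e₀ n ω,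
      ∃ k₁ k₂ : ℝ,
        p = fermiPoint u (sectorCenter n ω) + k₁ • unitNormal u (sectorCenter n ω) 0 +
              k₂ • unitTangent u (sectorCenter n ω) 0 ∧
        |k₁| ≤ c₃ * (4 : ℝ) ^ (-(n : ℤ)) ∧ |k₂| ≤ c₃ * (2 : ℝ) ^ (-(n : ℤ)) ∧
        |fderiv ℝ ε p (unitTangent u (sectorCenter n ω) 0)| ≤ c₃ * (2 : ℝ) ^ (-(n : ℤ)))
    (hK₁0 : 0 ≤ K₁)
    (hK₂ : K₂ = K₁ * π + 4) (hc₀ : 0 < c₀) (hc₂' : 0 < c₂') (hη₀ : 0 < η₀)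
    (h75 : ∀ θ₁' θ₂' η r₁ r₂ : ℝ, (θ₁', θ₂') ∈ pairChartDomain →
        |r₁| ≤ (2 * K₁ + 4 * c₂) / K₂ * η * pairAngle θ₁' θ₂' → |r₂| ≤ η → η ≤ c₂' * pairAngle θ₁' θ₂' →
          η ≤ η₀ →
          fermiPoint u θ₁' + fermiPoint u θ₂' + (r₁ • unitNormal u θ₁' 0 + r₂ • unitTangent u θ₁' 0)
              ∈ pairRange u ∧
          ∃ θ₁ θ₂ : ℝ,
            fermiPoint u θ₁' + fermiPoint u θ₂' + (r₁ • unitNormal u θ₁' 0 + r₂ • unitTangent u θ₁' 0) =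
              fermiPoint u θ₁ + fermiPoint u θ₂ ∧
            |θ₁ - θ₁'| ≤ c₀ * η ∧ |θ₂ - θ₂'| ≤ c₀ * η)
    {n n' : ℕ} (hn : n ≤ n') {L : ℕ} (hL : 4 ≤ L) (i₁ : Fin L) {ω₁ : ℕ} (hω₁ : ω₁ < sectorCount n')
    {ωt : Fin L → ℕ} (hωt : ∀ i, ωt i < sectorCount n)
    {i j : Fin L} (hij : i ≠ j) (hi : i ≠ i₁) (hj : j ≠ i₁)
    (R : Fin 2 → ℝ) {Φ Ψ LΨ Bfib : ℝ} (hΨ : 0 ≤ Ψ) (hK₁c : 2 + c₂ ≤ K₁)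
    (hLΨ : LΨ = L + c₂ * Ψ / (K₁ * Φ)) (hΦt : (2 : ℝ) ^ (-(n' : ℤ)) ≤ Φ) (hΦδ : c₃ * (2 : ℝ) ^ (-(n' : ℤ)) ≤ Φ)
    (hΦη : K₂ * LΨ * (c₃ * (2 : ℝ) ^ (-(n' : ℤ))) ≤ c₂' * Φ)
    (hBfib : max ((2 * ((2 * c₀ * K₂ * c₃ / π + 1) * LΨ)) ^ 2) (4 * c₃ ^ 2 * K₂ ^ 2 / η₀ ^ 2 * LΨ ^ 2) ≤ Bfib)
    {i₀ j₀ : Fin L} (hi₀ : i₀ ≠ i₁) (hj₀ : j₀ ≠ i₁)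
    (T : Finset (Fin L → Fin (sectorCount n')))
    (hwide : ∀ ω ∈ T, Φ < pairAngle (sectorCenter n' (ω i₀)) (sectorCenter n' (ω j₀)))
    (hT : ∀ ω ∈ T,
      ((ω i₁ : ℕ) = ω₁ ∧ (∀ i' : Fin L, i' ≠ i₁ → sSector u e₀ n' (ω i' : ℕ) ⊆ sSector u e₀ n (ωt i')) ∧
        ∃ k : Fin L → (Fin 2 → ℝ), (∀ i' : Fin L, k i' ∈ sSector u e₀ n' (ω i' : ℕ)) ∧ ∑ i', k i' = R) ∧
      (∀ m l : Fin L, m ≠ i₁ → l ≠ i₁ →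
        pairAngle (sectorCenter n' (ω m)) (sectorCenter n' (ω l)) ≤
          pairAngle (sectorCenter n' (ω i)) (sectorCenter n' (ω j))) ∧
      (∀ m : Fin L, m ≠ i₁ → pairAngle (sectorCenter n' (ω i₁)) (sectorCenter n' (ω m)) ≤ Ψ)) :
    (T.card : ℝ) ≤ Bfib * (3 * (2 : ℝ) ^ (n' - n)) ^ (L - 3) := by
  classical
  have hBfib0 : 0 ≤ Bfib := le_trans (le_max_of_le_left (sq_nonneg _)) hBfib
  have htpos : 0 < (2 : ℝ) ^ (-(n' : ℤ)) := zpow_pos (by norm_num) _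
  have hΦ0 : 0 ≤ Φ := htpos.le.trans hΦt
  -- a third free leg `k₀`
  obtain ⟨k₀, hk₀mem⟩ : (((Finset.univ.erase i₁).erase i).erase j).Nonempty := by
    rw [← Finset.card_pos]
    have h1 : i ∈ Finset.univ.erase i₁ := Finset.mem_erase.2 ⟨hi, Finset.mem_univ _⟩
    have h2 : j ∈ (Finset.univ.erase i₁).erase i := Finset.mem_erase.2 ⟨hij.symm, Finset.mem_erase.2 ⟨hj, Finset.mem_univ _⟩⟩
    rw [Finset.card_erase_of_mem h2, Finset.card_erase_of_mem h1, Finset.card_erase_of_mem (Finset.mem_univ _),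
      Finset.card_univ, Fintype.card_fin]
    omega
  have hk₀j : k₀ ≠ j := Finset.ne_of_mem_erase hk₀mem
  have hk₀i : k₀ ≠ i := Finset.ne_of_mem_erase (Finset.mem_of_mem_erase hk₀mem)
  have hk₀ : k₀ ≠ i₁ := Finset.ne_of_mem_erase (Finset.mem_of_mem_erase (Finset.mem_of_mem_erase hk₀mem))
  -- the projection onto the other legs and its target
  set z : Fin (sectorCount n') := ⟨0, sectorCount_pos n'⟩ with hz
  set proj : (Fin L → Fin (sectorCount n')) → (Fin L → Fin (sectorCount n')) :=
    fun ω => Function.update (Function.update ω i z) j z with hproj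
  have hproj_i : ∀ ω, proj ω i = z := fun ω => by
    simp only [hproj]; rw [Function.update_of_ne hij, Function.update_self]
  have hproj_j : ∀ ω, proj ω j = z := fun ω => by simp only [hproj]; rw [Function.update_self]
  have hproj_o : ∀ ω m, m ≠ i → m ≠ j → proj ω m = ω m := fun ω m hmi hmj => by
    simp only [hproj]; rw [Function.update_of_ne hmj, Function.update_of_ne hmi]
  obtain ⟨Ref, hRef⟩ : ∃ Ref : Fin L → Finset (Fin (sectorCount n')),
      ∀ m, Ref m = Finset.univ.filter (fun a : Fin (sectorCount n') => sSector u e₀ n' a ⊆ sSector u e₀ n (ωt m)) :=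
    ⟨_, fun m => rfl⟩
  have hRefcard : ∀ m, (Ref m).card ≤ 3 * 2 ^ (n' - n) := fun m => by
    rw [hRef]; exact card_refinements_le hD hn (hωt m)
  set tf : Fin L → Finset (Fin (sectorCount n')) :=
    fun m => if m = i ∨ m = j then {z} else if m = i₁ then {⟨ω₁, hω₁⟩} else Ref m with htf
  set A := Fintype.piFinset tf with hA
  -- strings of the class project into `A`
  have hmaps : ∀ ω ∈ T, proj ω ∈ A := by
    intro ω hω
    obtain ⟨hωS, -⟩ := hT ω hω
    obtain ⟨hω₁eq, hsub, -⟩ := hωS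
    rw [hA, Fintype.mem_piFinset]
    intro m
    simp only [htf]
    by_cases hm : m = i ∨ m = j
    · rw [if_pos hm, Finset.mem_singleton]
      rcases hm with rfl | rfl
      · exact hproj_i ω
      · exact hproj_j ω
    · rw [if_neg hm]
      rw [not_or] at hm
      rw [hproj_o ω m hm.1 hm.2]
      by_cases hm₁ : m = i₁
      · rw [if_pos hm₁, Finset.mem_singleton, hm₁]
        exact Fin.ext hω₁eq
      · rw [if_neg hm₁, hRef, Finset.mem_filter]
        exact ⟨Finset.mem_univ _, hsub m hm₁⟩
  -- the fibres: the solved pair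
  have hfib : ∀ ρ ∈ A, ((T).filter (fun ω => proj ω = ρ)).card ≤ ⌊Bfib⌋₊ := by
    intro ρ _
    apply Nat.le_floor
    set F := (T).filter (fun ω => proj ω = ρ) with hFdef
    -- the pair map and its image: every completing pair has angle `> Φ` (wide bundle), so only the far fibre is charged
    set g : (Fin L → Fin (sectorCount n')) → Fin (sectorCount n') × Fin (sectorCount n') := fun ω => (ω i, ω j) with hg
    have hinjg : Set.InjOn g F := by
      intro ω hω ω' hω' hgg
      have h1 : ω i = ω' i := congrArg Prod.fst hgg
      have h2 : ω j = ω' j := congrArg Prod.snd hgg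
      have hρ1 := (Finset.mem_filter.1 (Finset.mem_coe.1 hω)).2
      have hρ2 := (Finset.mem_filter.1 (Finset.mem_coe.1 hω')).2
      funext m
      by_cases hmi : m = i
      · rw [hmi]; exact h1
      by_cases hmj : m = j
      · rw [hmj]; exact h2
      rw [← hproj_o ω m hmi hmj, ← hproj_o ω' m hmi hmj, hρ1, hρ2]
    have hcardF : F.card = (F.image g).card := (Finset.card_image_of_injOn hinjg).symm
    have hEl := fibre_large_target hD hlip hpi hc₂ hc₃ h73 hK₁0 hK₂ hc₀ hc₂' hη₀ h75 (by omega) hij hi hk₀i hk₀j hk₀ ρ R hΨ hK₁c hLΨ hΦt hΦδ hΦη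
      (F.image g) (fun ab hab => by
        obtain ⟨ω, hωF, hωab⟩ := Finset.mem_image.1 hab
        obtain ⟨hωT, hωρ⟩ := Finset.mem_filter.1 hωF
        obtain ⟨⟨-, -, hk⟩, hωMP, hωW⟩ := hT ω hωT
        have hab1 : ω i = ab.1 := congrArg Prod.fst hωab
        have hab2 : ω j = ab.2 := congrArg Prod.snd hωab
        refine ⟨?_, ω, hk, hωMP, hωW k₀ hk₀, fun m hmi hmj => by rw [← hproj_o ω m hmi hmj, hωρ], hab1, hab2⟩
        rw [← hab1, ← hab2]
        exact (hwide ω hωT).trans_le (hωMP i₀ j₀ hi₀ hj₀))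
    rw [hcardF]
    exact hEl.trans hBfib
  -- the size of the target `A`: (s1.23) for each of the `L - 3` free legs
  have hAcard : A.card ≤ (3 * 2 ^ (n' - n)) ^ (L - 3) := by
    rw [hA, Fintype.card_piFinset]
    have hle : ∀ m, (tf m).card ≤ if m = i ∨ m = j ∨ m = i₁ then 1 else 3 * 2 ^ (n' - n) := by
      intro m
      simp only [htf]
      by_cases hm : m = i ∨ m = j
      · rw [if_pos hm, if_pos (by tauto), Finset.card_singleton]
      · rw [if_neg hm]
        by_cases hm₁ : m = i₁
        · rw [if_pos hm₁, if_pos (by tauto), Finset.card_singleton]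
        · rw [if_neg hm₁, if_neg (by tauto)]; exact hRefcard m
    calc ∏ m, (tf m).card ≤ ∏ m : Fin L, (if m = i ∨ m = j ∨ m = i₁ then 1 else 3 * 2 ^ (n' - n)) :=
          Finset.prod_le_prod' fun m _ => hle m
      _ = (3 * 2 ^ (n' - n)) ^ (Finset.univ.filter (fun m : Fin L => ¬(m = i ∨ m = j ∨ m = i₁))).card := by
          rw [Finset.prod_ite, Finset.prod_const_one, one_mul, Finset.prod_const]
      _ = (3 * 2 ^ (n' - n)) ^ (L - 3) := by
          congr 1
          have h3 : (Finset.univ.filter (fun m : Fin L => m = i ∨ m = j ∨ m = i₁)).card = 3 := by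
            rw [Finset.card_eq_three]
            refine ⟨i, j, i₁, hij, hi, hj, ?_⟩
            ext m; simp
          have := Finset.card_filter_add_card_filter_not (s := (Finset.univ : Finset (Fin L)))
            (fun m : Fin L => m = i ∨ m = j ∨ m = i₁)
          rw [h3, Finset.card_univ, Fintype.card_fin] at this
          omega
  -- assemble the class bound
  have hTle := Finset.card_le_mul_card_image_of_maps_to hmaps (⌊Bfib⌋₊) hfib
  have h1 : ((T).card : ℝ) ≤ (⌊Bfib⌋₊ : ℝ) * (A.card : ℝ) := by exact_mod_cast hTle
  have h2 : (⌊Bfib⌋₊ : ℝ) ≤ Bfib := Nat.floor_le hBfib0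
  have h3 : (A.card : ℝ) ≤ (3 * (2 : ℝ) ^ (n' - n)) ^ (L - 3) := by exact_mod_cast hAcard
  calc ((T).card : ℝ) ≤ (⌊Bfib⌋₊ : ℝ) * (A.card : ℝ) := h1
    _ ≤ Bfib * (3 * (2 : ℝ) ^ (n' - n)) ^ (L - 3) :=
        mul_le_mul h2 h3 (by positivity) hBfib0


/-- **BGM 2003 Lemma 3.1 WITH A TARGET VECTOR, WIDE-bundle variant** («CLAIM U», bulk reading): as `count_target`, for the strings in which two given
legs `i₀, j₀ ≠ i₁` have pair angle `> Φ` — then no near-fibre term is charged and `B_fib ≥ max((2(2c₀K₂c₃/π+1)L_Ψ)², 4c₃²K₂²L_Ψ²/η₀²)` suffices, with `Φ`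
as large as the wide pair allows (loss `(1 + c₂Ψ/(K₁LΦ))²` only).  Original docstring: **BGM 2003 Lemma 3.1 WITH A TARGET VECTOR and a transversality parameter** («CLAIM U», cell gate-hubbard-kl): the number of strings
of scale-`n′` sectors anchored at `ω₁`, refining the coarse string `ωt` off the anchored leg, whose anchored leg is within `Ψ` (mod `π`) of
every other leg, and which carry momenta summing to the prescribed vector `R`, is at most `L² · B_fib · (3·2^{n′−n})^{L−3}` for any regime
parameter `Φ` (`2^{−n′} ≤ Φ`, `c₃2^{−n′} ≤ Φ`, `K₂ L_Ψ c₃ 2^{−n′} ≤ c₂′ Φ`, `L_Ψ = L + c₂Ψ/(K₁Φ)`) and any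
`B_fib ≥ (2(2Φ/w′+1))² + max((2(2c₀K₂c₃/π+1)L_Ψ)², 4c₃²K₂²L_Ψ²/η₀²)`.  For `R = 0` every string satisfies the wedge hypothesis with
`Ψ = C_w·L·(max pair angle)` (`wedge_bound`) and the printed Lemma 3.1 follows; for `R = 2πG ≠ 0` («umklapp strings») the loss of a
transversal anchored leg is the factor `L_Ψ²/L²`. [cite: BenfattoGiulianiMastropietro2003, §3.1 Lemma 3.1 (4.3) p.17 (L46–58) and §7.4 (4.3app)–(s1.42) p.28 (L6–125)] -/
theorem count_target_wide {ε : (Fin 2 → ℝ) → ℝ} {μ e₀ : ℝ} {u : ℝ → ℝ → ℝ} (hD : DispersionHyp ε μ e₀ u) {c₂ c₃ K₁ K₂ c₀ c₂' η₀ : ℝ}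
    (hlip : ∀ θ₁ θ₂ : ℝ, torusDist (normalAngle u θ₂ 0 - normalAngle u θ₁ 0) ≤ c₂ * torusDist (θ₂ - θ₁))
    (hpi : ∀ θ : ℝ, normalAngle u (θ + π) 0 = normalAngle u θ 0 + π) (hc₂ : 0 ≤ c₂) (hc₃ : 0 < c₃)
    (h73 : ∀ (n ω : ℕ), ω < sectorCount n → ∀ p ∈ sSector u e₀ n ω,
      ∃ k₁ k₂ : ℝ,
        p = fermiPoint u (sectorCenter n ω) + k₁ • unitNormal u (sectorCenter n ω) 0 +
              k₂ • unitTangent u (sectorCenter n ω) 0 ∧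
        |k₁| ≤ c₃ * (4 : ℝ) ^ (-(n : ℤ)) ∧ |k₂| ≤ c₃ * (2 : ℝ) ^ (-(n : ℤ)) ∧
        |fderiv ℝ ε p (unitTangent u (sectorCenter n ω) 0)| ≤ c₃ * (2 : ℝ) ^ (-(n : ℤ)))
    (hK₁0 : 0 ≤ K₁)
    (hK₂ : K₂ = K₁ * π + 4) (hc₀ : 0 < c₀) (hc₂' : 0 < c₂') (hη₀ : 0 < η₀)
    (h75 : ∀ θ₁' θ₂' η r₁ r₂ : ℝ, (θ₁', θ₂') ∈ pairChartDomain →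
        |r₁| ≤ (2 * K₁ + 4 * c₂) / K₂ * η * pairAngle θ₁' θ₂' → |r₂| ≤ η → η ≤ c₂' * pairAngle θ₁' θ₂' →
          η ≤ η₀ →
          fermiPoint u θ₁' + fermiPoint u θ₂' + (r₁ • unitNormal u θ₁' 0 + r₂ • unitTangent u θ₁' 0)
              ∈ pairRange u ∧
          ∃ θ₁ θ₂ : ℝ,
            fermiPoint u θ₁' + fermiPoint u θ₂' + (r₁ • unitNormal u θ₁' 0 + r₂ • unitTangent u θ₁' 0) =
              fermiPoint u θ₁ + fermiPoint u θ₂ ∧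
            |θ₁ - θ₁'| ≤ c₀ * η ∧ |θ₂ - θ₂'| ≤ c₀ * η)
    {n n' : ℕ} (hn : n ≤ n') {L : ℕ} (hL : 4 ≤ L) (i₁ : Fin L) {ω₁ : ℕ} (hω₁ : ω₁ < sectorCount n')
    {ωt : Fin L → ℕ} (hωt : ∀ i, ωt i < sectorCount n)
    (R : Fin 2 → ℝ) {Φ Ψ LΨ Bfib : ℝ} (hΨ : 0 ≤ Ψ) (hK₁c : 2 + c₂ ≤ K₁)
    (hLΨ : LΨ = L + c₂ * Ψ / (K₁ * Φ)) (hΦt : (2 : ℝ) ^ (-(n' : ℤ)) ≤ Φ) (hΦδ : c₃ * (2 : ℝ) ^ (-(n' : ℤ)) ≤ Φ)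
    (hΦη : K₂ * LΨ * (c₃ * (2 : ℝ) ^ (-(n' : ℤ))) ≤ c₂' * Φ)
    (hBfib : max ((2 * ((2 * c₀ * K₂ * c₃ / π + 1) * LΨ)) ^ 2) (4 * c₃ ^ 2 * K₂ ^ 2 / η₀ ^ 2 * LΨ ^ 2) ≤ Bfib)
    {i₀ j₀ : Fin L} (hi₀ : i₀ ≠ i₁) (hj₀ : j₀ ≠ i₁) :
    (Nat.card {ω : Fin L → Fin (sectorCount n') |
        (ω i₁ : ℕ) = ω₁ ∧ (∀ i' : Fin L, i' ≠ i₁ → sSector u e₀ n' (ω i' : ℕ) ⊆ sSector u e₀ n (ωt i')) ∧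
        (∀ m : Fin L, m ≠ i₁ → pairAngle (sectorCenter n' (ω i₁)) (sectorCenter n' (ω m)) ≤ Ψ) ∧
        Φ < pairAngle (sectorCenter n' (ω i₀)) (sectorCenter n' (ω j₀)) ∧
        ∃ k : Fin L → (Fin 2 → ℝ), (∀ i' : Fin L, k i' ∈ sSector u e₀ n' (ω i' : ℕ)) ∧ ∑ i', k i' = R} : ℝ) ≤
      L ^ 2 * (Bfib * (3 * (2 : ℝ) ^ (n' - n)) ^ (L - 3)) := by
  classical
  -- the strings as a Finset
  set Str : Set (Fin L → Fin (sectorCount n')) := {ω : Fin L → Fin (sectorCount n') |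
        (ω i₁ : ℕ) = ω₁ ∧ (∀ i' : Fin L, i' ≠ i₁ → sSector u e₀ n' (ω i' : ℕ) ⊆ sSector u e₀ n (ωt i')) ∧
        (∀ m : Fin L, m ≠ i₁ → pairAngle (sectorCenter n' (ω i₁)) (sectorCenter n' (ω m)) ≤ Ψ) ∧
        Φ < pairAngle (sectorCenter n' (ω i₀)) (sectorCenter n' (ω j₀)) ∧
        ∃ k : Fin L → (Fin 2 → ℝ), (∀ i' : Fin L, k i' ∈ sSector u e₀ n' (ω i' : ℕ)) ∧ ∑ i', k i' = R} with hStr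
  set S := Str.toFinset with hS
  have hmemS : ∀ ω, ω ∈ S ↔ ω ∈ Str := fun ω => Set.mem_toFinset
  have hcardS : Nat.card Str = S.card := by
    rw [hS, Nat.card_eq_card_toFinset]
  rw [hcardS]
  -- the classes
  obtain ⟨T, hT⟩ : ∃ T : Fin L × Fin L → Finset (Fin L → Fin (sectorCount n')),
      ∀ p ω, ω ∈ T p ↔ ω ∈ S ∧ ∀ m l : Fin L, m ≠ i₁ → l ≠ i₁ →
        pairAngle (sectorCenter n' (ω m)) (sectorCenter n' (ω l)) ≤
          pairAngle (sectorCenter n' (ω p.1)) (sectorCenter n' (ω p.2)) :=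
    ⟨fun p => S.filter (fun ω => ∀ m l : Fin L, m ≠ i₁ → l ≠ i₁ →
        pairAngle (sectorCenter n' (ω m)) (sectorCenter n' (ω l)) ≤
          pairAngle (sectorCenter n' (ω p.1)) (sectorCenter n' (ω p.2))), fun p ω => Finset.mem_filter⟩
  obtain ⟨Pairs, hPairs⟩ : ∃ Pairs : Finset (Fin L × Fin L),
      ∀ p, p ∈ Pairs ↔ p.1 ≠ p.2 ∧ p.1 ≠ i₁ ∧ p.2 ≠ i₁ :=
    ⟨Finset.univ.filter (fun p : Fin L × Fin L => p.1 ≠ p.2 ∧ p.1 ≠ i₁ ∧ p.2 ≠ i₁), fun p => by simp⟩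
  -- (s1.22): every string has a maximal pair among the legs `≠ i₁`
  have hcover : S ⊆ Pairs.biUnion T := by
    intro ω hω
    have hPne : Pairs.Nonempty := by
      have hcard : 1 < (Finset.univ.erase i₁).card := by
        rw [Finset.card_erase_of_mem (Finset.mem_univ _), Finset.card_univ, Fintype.card_fin]; omega
      obtain ⟨a, ha, b, hb, hab⟩ := Finset.one_lt_card.1 hcard
      exact ⟨(a, b), (hPairs _).2 ⟨hab, Finset.ne_of_mem_erase ha, Finset.ne_of_mem_erase hb⟩⟩
    obtain ⟨p, hp, hmax⟩ := Pairs.exists_max_image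
      (fun q : Fin L × Fin L => pairAngle (sectorCenter n' (ω q.1)) (sectorCenter n' (ω q.2))) hPne
    rw [Finset.mem_biUnion]
    refine ⟨p, hp, (hT p ω).2 ⟨hω, fun m l hm hl => ?_⟩⟩
    by_cases hml : m = l
    · rw [hml, pairAngle_self']; exact (pairAngle_bounds _ _).1
    · exact hmax (m, l) ((hPairs _).2 ⟨hml, hm, hl⟩)
  -- the bound for one class
  have hclass : ∀ p ∈ Pairs, ((T p).card : ℝ) ≤ Bfib * (3 * (2 : ℝ) ^ (n' - n)) ^ (L - 3) := by
    rintro ⟨i, j⟩ hp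
    obtain ⟨hij, hi, hj⟩ := (hPairs _).1 hp
    exact class_bound_target_wide hD hlip hpi hc₂ hc₃ h73 hK₁0 hK₂ hc₀ hc₂' hη₀ h75 hn hL i₁
      hω₁ hωt hij hi hj R hΨ hK₁c hLΨ hΦt hΦδ hΦη hBfib hi₀ hj₀ (T (i, j))
      (fun ω hω => by
        obtain ⟨h1, -⟩ := (hT _ ω).1 hω
        have h1' := (hmemS ω).1 h1
        rw [hStr] at h1'
        exact h1'.2.2.2.1)
      (fun ω hω => by
        obtain ⟨h1, h2⟩ := (hT _ ω).1 hω
        have h1' := (hmemS ω).1 h1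
        rw [hStr] at h1'
        obtain ⟨hω₁eq, hsub, hW, -, hk⟩ := h1'
        exact ⟨⟨hω₁eq, hsub, hk⟩, h2, hW⟩)
  -- sum over the classes
  have hPcard : (Pairs.card : ℝ) ≤ L ^ 2 := by
    have : Pairs.card ≤ (Finset.univ : Finset (Fin L × Fin L)).card := Finset.card_le_card (Finset.subset_univ _)
    rw [Finset.card_univ, Fintype.card_prod, Fintype.card_fin] at this
    exact_mod_cast this.trans_eq (by ring)
  have hBfib0 : 0 ≤ Bfib := le_trans (le_max_of_le_left (sq_nonneg _)) hBfib
  calc (S.card : ℝ) ≤ ((Pairs.biUnion T).card : ℝ) := by exact_mod_cast Finset.card_le_card hcover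
    _ ≤ ∑ p ∈ Pairs, ((T p).card : ℝ) := by exact_mod_cast Finset.card_biUnion_le
    _ ≤ ∑ _p ∈ Pairs, Bfib * (3 * (2 : ℝ) ^ (n' - n)) ^ (L - 3) := Finset.sum_le_sum hclass
    _ = Pairs.card * (Bfib * (3 * (2 : ℝ) ^ (n' - n)) ^ (L - 3)) := by
        rw [Finset.sum_const, nsmul_eq_mul]
    _ ≤ L ^ 2 * (Bfib * (3 * (2 : ℝ) ^ (n' - n)) ^ (L - 3)) := by gcongr

/-! ### Several prescribed legs (cell gate-hubbard-kl, seat p4 g14, memo HOME/prover-p4/TIGHT-RELCOUNT-LAW.md «(R)»): the WIDE-bundle target count with a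
SET `E` of prescribed legs — each prescribed leg beyond the first gains a full relative factor `3·2^{n′−n}` as soon as two FREE legs are spread by more than the
regime angle `Φ`; the transversality of the prescribed legs (each within `Ψ` of the free legs, mod `π`) is paid in `L_Ψ = L + c₂|E|Ψ/(K₁Φ)` exactly as the
single anchored leg's is in `count_target_wide`.  This is the honest complement of `count_prescribed_generic` (`BGM2003SectorCountingProof`, classes whose maximal
pair avoids `E`): here the pair is maximal among the FREE legs only, and the prescribed legs may be far from the free bundle (the graded «redundant» class of
memo TWO-ANCHOR-FALSE, whose tight end — all free legs within `Φ` — admits no such gain). -/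

/-- **(s1.38)–(s1.40) with a target vector and a SET of prescribed legs.** As `string_box_target`, but the legs of a prescribed set `E` — each within
`Ψ` (mod `π`) of the frame leg `θ_{k₀}` — are separated from the other legs (within `φ₀` of the frame leg): the defect `Σ_m p⃗_F(θ_m) − R` has normal
component `≤ (2 + c₂) L δ₂ φ₀ + c₂ δ₂ (|E| Ψ)` and tangential component `≤ 2 L δ₂` in the frame at `θ_{k₀}`.
[cite: BenfattoGiulianiMastropietro2003, §7.4 (s1.38)–(s1.40) p.28 (L81–101)] -/
theorem string_box_target_prescribed {ε : (Fin 2 → ℝ) → ℝ} {μ e₀ : ℝ} {u : ℝ → ℝ → ℝ} (hD : DispersionHyp ε μ e₀ u) {c₂ : ℝ}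
    (hlip : ∀ θ₁ θ₂ : ℝ, torusDist (normalAngle u θ₂ 0 - normalAngle u θ₁ 0) ≤ c₂ * torusDist (θ₂ - θ₁))
    (hpi : ∀ θ : ℝ, normalAngle u (θ + π) 0 = normalAngle u θ 0 + π) (hc₂ : 0 ≤ c₂)
    {L : ℕ} (E : Finset (Fin L)) (k₀ : Fin L) (θ : Fin L → ℝ) (θ₀ : ℝ) (hθ₀ : θ k₀ = θ₀) (k : Fin L → (Fin 2 → ℝ)) (x y : Fin L → ℝ)
    (R : Fin 2 → ℝ) (hsum : ∑ m, k m = R)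
    (hdec : ∀ m, k m = fermiPoint u (θ m) + (x m • unitNormal u (θ m) 0 + y m • unitTangent u (θ m) 0))
    {δ₁ δ₂ φ₀ Ψ : ℝ} (hx : ∀ m, |x m| ≤ δ₁) (hy : ∀ m, |y m| ≤ δ₂) (hδ₁₂ : δ₁ ≤ δ₂) (hδ₁ : δ₁ ≤ δ₂ * φ₀)
    (hδ₂ : 0 ≤ δ₂) (hφ₀ : 0 ≤ φ₀)
    (hclose : ∀ m, m ∉ E → pairAngle (θ m) (θ k₀) ≤ φ₀)
    (hwedge : ∀ e ∈ E, pairAngle (θ e) (θ k₀) ≤ Ψ) :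
    |(∑ m, fermiPoint u (θ m) - R) ⬝ᵥ unitNormal u θ₀ 0| ≤ (2 + c₂) * L * δ₂ * φ₀ + c₂ * δ₂ * (E.card * Ψ) ∧
      |(∑ m, fermiPoint u (θ m) - R) ⬝ᵥ unitTangent u θ₀ 0| ≤ 2 * L * δ₂ := by
  subst hθ₀
  have h0 := abs_zero_le_e₀ hD
  obtain ⟨cu, hcu, hu⟩ := hD.u_pos
  have hupos : ∀ s, 0 < u s 0 := fun s => lt_of_lt_of_le hcu (hu s 0 h0)
  set d : Fin L → (Fin 2 → ℝ) := fun m => x m • unitNormal u (θ m) 0 + y m • unitTangent u (θ m) 0 with hd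
  have hR : ∑ m, fermiPoint u (θ m) - R = -∑ m, d m := by
    have : ∑ m, k m = ∑ m, fermiPoint u (θ m) + ∑ m, d m := by
      rw [← Finset.sum_add_distrib]; exact Finset.sum_congr rfl fun m _ => hdec m
    rw [hsum] at this
    rw [this]; abel
  have hL1 : (1 : ℝ) ≤ L := by
    have : 1 ≤ L := Nat.succ_le_of_lt (Fin.pos k₀)
    exact_mod_cast this
  have hEc : (E.card : ℝ) ≤ L := by
    have : E.card ≤ L := (Finset.card_le_univ E).trans_eq (Fintype.card_fin L)
    exact_mod_cast this
  have hδ₁0 : 0 ≤ δ₁ := (abs_nonneg _).trans (hx k₀)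
  set n₀ := unitNormal u (θ k₀) 0 with hn₀
  set τ₀ := unitTangent u (θ k₀) 0 with hτ₀
  -- normal components of the displacements
  have hdn : ∀ m, |d m ⬝ᵥ n₀| ≤ δ₁ + δ₂ * (c₂ * pairAngle (θ m) (θ k₀)) := by
    intro m
    have hexp : d m ⬝ᵥ n₀ = x m * Real.cos (normalAngle u (θ m) 0 - normalAngle u (θ k₀) 0) +
        y m * -Real.sin (normalAngle u (θ m) 0 - normalAngle u (θ k₀) 0) := by
      rw [hd]; simp only [add_dotProduct, smul_dotProduct, smul_eq_mul]
      rw [hn₀, normal_dot_normal' (hupos _) (hupos _), tangent_dot_normal' (hupos _) (hupos _)]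
    rw [hexp]
    have h1 : |x m * Real.cos (normalAngle u (θ m) 0 - normalAngle u (θ k₀) 0)| ≤ δ₁ := by
      rw [abs_mul]; exact (mul_le_of_le_one_right (abs_nonneg _) (Real.abs_cos_le_one _)).trans (hx m)
    have h2 : |y m * -Real.sin (normalAngle u (θ m) 0 - normalAngle u (θ k₀) 0)| ≤
        δ₂ * (c₂ * pairAngle (θ m) (θ k₀)) := by
      rw [abs_mul, abs_neg]
      exact mul_le_mul (hy m) (abs_sin_normalAngle_sub_le hlip hpi _ _) (abs_nonneg _) hδ₂
    exact (abs_add_le _ _).trans (add_le_add h1 h2)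
  -- tangential components
  have hdt : ∀ m, |d m ⬝ᵥ τ₀| ≤ δ₁ + δ₂ := by
    intro m
    have hexp : d m ⬝ᵥ τ₀ = x m * Real.sin (normalAngle u (θ m) 0 - normalAngle u (θ k₀) 0) +
        y m * Real.cos (normalAngle u (θ m) 0 - normalAngle u (θ k₀) 0) := by
      rw [hd]; simp only [add_dotProduct, smul_dotProduct, smul_eq_mul]
      rw [hτ₀, normal_dot_tangent' (hupos _) (hupos _), tangent_dot_tangent' (hupos _) (hupos _)]
    rw [hexp]
    have h1 : |x m * Real.sin (normalAngle u (θ m) 0 - normalAngle u (θ k₀) 0)| ≤ δ₁ := by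
      rw [abs_mul]; exact (mul_le_of_le_one_right (abs_nonneg _) (Real.abs_sin_le_one _)).trans (hx m)
    have h2 : |y m * Real.cos (normalAngle u (θ m) 0 - normalAngle u (θ k₀) 0)| ≤ δ₂ := by
      rw [abs_mul]; exact (mul_le_of_le_one_right (abs_nonneg _) (Real.abs_cos_le_one _)).trans (hy m)
    exact (abs_add_le _ _).trans (add_le_add h1 h2)
  constructor
  · rw [hR, neg_dotProduct, abs_neg, sum_dotProduct]
    -- split the legs into the prescribed set `E` and the rest
    rw [← Finset.sum_filter_add_sum_filter_not Finset.univ (fun m : Fin L => m ∈ E)]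
    have hEeq : Finset.univ.filter (fun m : Fin L => m ∈ E) = E := by ext m; simp
    have hA : |∑ m ∈ Finset.univ.filter (fun m : Fin L => m ∈ E), d m ⬝ᵥ n₀| ≤ E.card * (δ₁ + δ₂ * (c₂ * Ψ)) := by
      rw [hEeq]
      calc |∑ m ∈ E, d m ⬝ᵥ n₀| ≤ ∑ m ∈ E, |d m ⬝ᵥ n₀| := Finset.abs_sum_le_sum_abs _ _
        _ ≤ ∑ _m ∈ E, (δ₁ + δ₂ * (c₂ * Ψ)) :=
            Finset.sum_le_sum fun m hm => (hdn m).trans (by gcongr; exact hwedge m hm)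
        _ = E.card * (δ₁ + δ₂ * (c₂ * Ψ)) := by rw [Finset.sum_const, nsmul_eq_mul]
    have hB : |∑ m ∈ Finset.univ.filter (fun m : Fin L => ¬ m ∈ E), d m ⬝ᵥ n₀| ≤ L * (δ₁ + δ₂ * (c₂ * φ₀)) := by
      calc |∑ m ∈ Finset.univ.filter (fun m : Fin L => ¬ m ∈ E), d m ⬝ᵥ n₀|
          ≤ ∑ m ∈ Finset.univ.filter (fun m : Fin L => ¬ m ∈ E), |d m ⬝ᵥ n₀| := Finset.abs_sum_le_sum_abs _ _
        _ ≤ ∑ _m ∈ Finset.univ.filter (fun m : Fin L => ¬ m ∈ E), (δ₁ + δ₂ * (c₂ * φ₀)) :=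
            Finset.sum_le_sum fun m hm => (hdn m).trans (by
              gcongr; exact hclose m (Finset.mem_filter.1 hm).2)
        _ = ((Finset.univ.filter (fun m : Fin L => ¬ m ∈ E)).card : ℝ) * (δ₁ + δ₂ * (c₂ * φ₀)) := by
            rw [Finset.sum_const, nsmul_eq_mul]
        _ ≤ L * (δ₁ + δ₂ * (c₂ * φ₀)) := by
            have hc : ((Finset.univ.filter (fun m : Fin L => ¬ m ∈ E)).card : ℝ) ≤ L := by
              have : (Finset.univ.filter (fun m : Fin L => ¬ m ∈ E)).card ≤ L :=
                (Finset.card_filter_le _ _).trans (by simp)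
              exact_mod_cast this
            have hnn : 0 ≤ δ₁ + δ₂ * (c₂ * φ₀) := add_nonneg hδ₁0 (by positivity)
            exact mul_le_mul_of_nonneg_right hc hnn
    have hsplitE : (E.card : ℝ) * (δ₁ + δ₂ * (c₂ * Ψ)) = E.card * δ₁ + c₂ * δ₂ * (E.card * Ψ) := by ring
    have hE1 : (E.card : ℝ) * δ₁ ≤ L * (δ₂ * φ₀) :=
      (mul_le_mul_of_nonneg_right hEc hδ₁0).trans (mul_le_mul_of_nonneg_left hδ₁ (by positivity))
    have hB1 : (L : ℝ) * (δ₁ + δ₂ * (c₂ * φ₀)) ≤ L * (δ₂ * φ₀) + c₂ * L * δ₂ * φ₀ := by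
      have : (L : ℝ) * (δ₁ + δ₂ * (c₂ * φ₀)) = L * δ₁ + c₂ * L * δ₂ * φ₀ := by ring
      rw [this]
      have : (L : ℝ) * δ₁ ≤ L * (δ₂ * φ₀) := mul_le_mul_of_nonneg_left hδ₁ (by positivity)
      linarith
    calc |∑ m ∈ Finset.univ.filter (fun m : Fin L => m ∈ E), d m ⬝ᵥ n₀ +
          ∑ m ∈ Finset.univ.filter (fun m : Fin L => ¬ m ∈ E), d m ⬝ᵥ n₀|
        ≤ |∑ m ∈ Finset.univ.filter (fun m : Fin L => m ∈ E), d m ⬝ᵥ n₀| +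
            |∑ m ∈ Finset.univ.filter (fun m : Fin L => ¬ m ∈ E), d m ⬝ᵥ n₀| := abs_add_le _ _
      _ ≤ E.card * (δ₁ + δ₂ * (c₂ * Ψ)) + L * (δ₁ + δ₂ * (c₂ * φ₀)) := add_le_add hA hB
      _ ≤ (2 + c₂) * L * δ₂ * φ₀ + c₂ * δ₂ * (E.card * Ψ) := by
          rw [hsplitE]
          have : (2 + c₂) * (L : ℝ) * δ₂ * φ₀ = L * (δ₂ * φ₀) + L * (δ₂ * φ₀) + c₂ * L * δ₂ * φ₀ := by ring
          rw [this]
          linarith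
  · rw [hR, neg_dotProduct, abs_neg, sum_dotProduct]
    calc |∑ m, d m ⬝ᵥ τ₀| ≤ ∑ m, |d m ⬝ᵥ τ₀| := Finset.abs_sum_le_sum_abs _ _
      _ ≤ ∑ _m : Fin L, (δ₁ + δ₂) := Finset.sum_le_sum fun m _ => hdt m
      _ = L * (δ₁ + δ₂) := by rw [Finset.sum_const, nsmul_eq_mul, Finset.card_univ, Fintype.card_fin]
      _ ≤ 2 * L * δ₂ := by nlinarith [hL1, hδ₁₂]


set_option maxHeartbeats 400000 in -- two Lemma-7.5 frame estimates per completing pair, as `fibre_large_target`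
/-- **The far fibre with a target vector and a SET of prescribed legs** (prescribed-set twin of `fibre_large_target`; cell gate-hubbard-kl,
graded redundant class «(R)»): completing pairs `(ω_i, ω_j)` of TARGET strings (`Σ k = R`) sharing the legs off `{i, j}`, the pair `(i, j)` taken OUTSIDE the
prescribed set `E` and maximal among the legs outside `E`, with angle `> Φ`; every prescribed leg within `Ψ` (mod `π`) of the frame leg `k₀ ∉ E`.  The normal
budget of `string_box_target_prescribed` is `(2 + c₂)Lδ₂φ₀ + c₂δ₂|E|Ψ`, so Lemma 7.5 runs with `L_Ψ = L + c₂|E|Ψ/(K₁Φ)` in the regime `K₂ L_Ψ c₃ 2^{−n′} ≤ c₂′Φ`: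
at most `O(L_Ψ²)` pairs. [cite: BenfattoGiulianiMastropietro2003, §7.4 (s1.26)–(s1.42) p.28 (L44–125)] -/
theorem fibre_large_target_prescribed {ε : (Fin 2 → ℝ) → ℝ} {μ e₀ : ℝ} {u : ℝ → ℝ → ℝ} (hD : DispersionHyp ε μ e₀ u) {c₂ c₃ K₁ K₂ c₀ c₂' η₀ : ℝ}
    (hlip : ∀ θ₁ θ₂ : ℝ, torusDist (normalAngle u θ₂ 0 - normalAngle u θ₁ 0) ≤ c₂ * torusDist (θ₂ - θ₁))
    (hpi : ∀ θ : ℝ, normalAngle u (θ + π) 0 = normalAngle u θ 0 + π) (hc₂ : 0 ≤ c₂) (hc₃ : 0 < c₃)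
    (h73 : ∀ (n ω : ℕ), ω < sectorCount n → ∀ p ∈ sSector u e₀ n ω,
      ∃ k₁ k₂ : ℝ,
        p = fermiPoint u (sectorCenter n ω) + k₁ • unitNormal u (sectorCenter n ω) 0 +
              k₂ • unitTangent u (sectorCenter n ω) 0 ∧
        |k₁| ≤ c₃ * (4 : ℝ) ^ (-(n : ℤ)) ∧ |k₂| ≤ c₃ * (2 : ℝ) ^ (-(n : ℤ)) ∧
        |fderiv ℝ ε p (unitTangent u (sectorCenter n ω) 0)| ≤ c₃ * (2 : ℝ) ^ (-(n : ℤ)))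
    (hK₁0 : 0 ≤ K₁)
    (hK₂ : K₂ = K₁ * π + 4) (hc₀ : 0 < c₀) (hc₂' : 0 < c₂') (hη₀ : 0 < η₀)
    (h75 : ∀ θ₁' θ₂' η r₁ r₂ : ℝ, (θ₁', θ₂') ∈ pairChartDomain →
        |r₁| ≤ (2 * K₁ + 4 * c₂) / K₂ * η * pairAngle θ₁' θ₂' → |r₂| ≤ η → η ≤ c₂' * pairAngle θ₁' θ₂' →
          η ≤ η₀ →
          fermiPoint u θ₁' + fermiPoint u θ₂' + (r₁ • unitNormal u θ₁' 0 + r₂ • unitTangent u θ₁' 0)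
              ∈ pairRange u ∧
          ∃ θ₁ θ₂ : ℝ,
            fermiPoint u θ₁' + fermiPoint u θ₂' + (r₁ • unitNormal u θ₁' 0 + r₂ • unitTangent u θ₁' 0) =
              fermiPoint u θ₁ + fermiPoint u θ₂ ∧
            |θ₁ - θ₁'| ≤ c₀ * η ∧ |θ₂ - θ₂'| ≤ c₀ * η)
    {n' L : ℕ} (hL1 : 1 ≤ L) (E : Finset (Fin L)) {i j k₀ : Fin L} (hij : i ≠ j) (hi : i ∉ E)
    (hk₀i : k₀ ≠ i) (hk₀j : k₀ ≠ j) (hk₀ : k₀ ∉ E)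
    (ρ : Fin L → Fin (sectorCount n')) (R : Fin 2 → ℝ) {Φ Ψ LΨ : ℝ} (hΨ : 0 ≤ Ψ) (hK₁c : 2 + c₂ ≤ K₁)
    (hLΨ : LΨ = L + c₂ * (E.card * Ψ) / (K₁ * Φ)) (hΦt : (2 : ℝ) ^ (-(n' : ℤ)) ≤ Φ) (hΦδ : c₃ * (2 : ℝ) ^ (-(n' : ℤ)) ≤ Φ)
    (hΦη : K₂ * LΨ * (c₃ * (2 : ℝ) ^ (-(n' : ℤ))) ≤ c₂' * Φ)
    (P : Finset (Fin (sectorCount n') × Fin (sectorCount n')))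
    (hP : ∀ ab ∈ P,
        Φ < pairAngle (sectorCenter n' ab.1) (sectorCenter n' ab.2) ∧
        ∃ ω : Fin L → Fin (sectorCount n'),
          (∃ k : Fin L → (Fin 2 → ℝ), (∀ i : Fin L, k i ∈ sSector u e₀ n' (ω i : ℕ)) ∧ ∑ i, k i = R) ∧
          (∀ m l : Fin L, m ∉ E → l ∉ E →
            pairAngle (sectorCenter n' (ω m)) (sectorCenter n' (ω l)) ≤
              pairAngle (sectorCenter n' (ω i)) (sectorCenter n' (ω j))) ∧
          (∀ e ∈ E, pairAngle (sectorCenter n' (ω e)) (sectorCenter n' (ω k₀)) ≤ Ψ) ∧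
          (∀ m, m ≠ i → m ≠ j → ω m = ρ m) ∧ ω i = ab.1 ∧ ω j = ab.2) :
    (P.card : ℝ) ≤
      max ((2 * ((2 * c₀ * K₂ * c₃ / π + 1) * LΨ)) ^ 2) (4 * c₃ ^ 2 * K₂ ^ 2 / η₀ ^ 2 * LΨ ^ 2) := by
  classical
  have h0 := abs_zero_le_e₀ hD
  -- scales
  set t := (2 : ℝ) ^ (-(n' : ℤ)) with ht
  have htpos : 0 < t := zpow_pos (by norm_num) _
  have htle : t ≤ 1 := zpow_le_one_of_nonpos₀ (by norm_num) (by simp)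
  set δ₂ := c₃ * t with hδ₂
  set δ₁ := c₃ * (4 : ℝ) ^ (-(n' : ℤ)) with hδ₁
  have hδ₁t : δ₁ = δ₂ * t := by rw [hδ₁, four_zpow_neg, hδ₂, ht]; ring
  have hδ₂pos : 0 < δ₂ := by positivity
  have hδ₁₂ : δ₁ ≤ δ₂ := by rw [hδ₁t]; exact mul_le_of_le_one_right hδ₂pos.le htle
  have hL1r : (1 : ℝ) ≤ L := by exact_mod_cast hL1
  have hK₁pos : 0 < K₁ := by linarith
  have hK₂pos : 0 < K₂ := by rw [hK₂]; positivity
  -- consequences of the regime hypotheses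
  have hΦpos : 0 < Φ := lt_of_lt_of_le htpos hΦt
  have hΦδ' : δ₂ ≤ Φ := by rw [hδ₂]; exact hΦδ
  have hLΨL : (L : ℝ) ≤ LΨ := by
    rw [hLΨ]; have : 0 ≤ c₂ * (E.card * Ψ) / (K₁ * Φ) := by positivity
    linarith
  have hLΨ1 : (1 : ℝ) ≤ LΨ := hL1r.trans hLΨL
  have hLΨ0 : (0 : ℝ) ≤ LΨ := zero_le_one.trans hLΨ1
  have hΦη' : K₂ * LΨ * δ₂ ≤ c₂' * Φ := by rw [hδ₂]; exact hΦη
  -- trivial cases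
  rcases Finset.eq_empty_or_nonempty P with hE0 | hEne
  · rw [hE0, Finset.card_empty, Nat.cast_zero]
    exact le_max_of_le_left (by positivity)
  rcases lt_or_ge η₀ (K₂ * LΨ * δ₂) with hlt | hη
  · -- small `h'`: the trivial bound `|O_{h'}|²`
    have hcard : (P.card : ℝ) ≤ ((sectorCount n' : ℕ) : ℝ) ^ 2 := by
      have h1 : P.card ≤ (Finset.univ : Finset (Fin (sectorCount n') × Fin (sectorCount n'))).card :=
        Finset.card_le_card (Finset.subset_univ _)
      rw [Finset.card_univ, Fintype.card_prod, Fintype.card_fin] at h1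
      have h2 : ((sectorCount n' * sectorCount n' : ℕ) : ℝ) = ((sectorCount n' : ℕ) : ℝ) ^ 2 := by push_cast; ring
      exact (Nat.cast_le.2 h1).trans_eq h2
    have hNt : ((sectorCount n' : ℕ) : ℝ) * t = 2 := by
      rw [sectorCount, ht, Nat.cast_pow, Nat.cast_ofNat, pow_succ, zpow_neg, zpow_natCast]
      field_simp
    have hN2 : ((sectorCount n' : ℕ) : ℝ) = 2 / t := by rw [← hNt]; field_simp
    refine hcard.trans (le_max_of_le_right ?_)
    rw [hN2]
    exact trivial_regime_bound htpos hη₀ (by rw [hδ₂] at hlt; exact hlt)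
  -- the reference pair of maximal angle
  obtain ⟨⟨a₀, b₀⟩, hmem₀, hmax⟩ :=
    P.exists_max_image (fun ab => pairAngle (sectorCenter n' ab.1) (sectorCenter n' ab.2)) hEne
  obtain ⟨hΦ₀, ω₀, hω₀S, hMP₀, hW₀, hρ₀, hω₀i, hω₀j⟩ := hP _ hmem₀
  set φ₀ := pairAngle (sectorCenter n' a₀) (sectorCenter n' b₀) with hφ₀
  have hφ₀pos : 0 < φ₀ := lt_of_le_of_lt (htpos.le.trans hΦt) hΦ₀
  have hφ₀le : φ₀ ≤ π / 2 := (pairAngle_bounds _ _).2.1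
  have htφ : t ≤ φ₀ := hΦt.trans hΦ₀.le
  have hδφ : δ₂ ≤ φ₀ := hΦδ'.trans hΦ₀.le
  have hΦφ₀ : Φ ≤ φ₀ := hΦ₀.le
  have hφ₀nn : 0 ≤ φ₀ := hφ₀pos.le
  -- the transversality budget: `(2 + c₂) L δ₂ φ₀ + c₂ δ₂ Ψ ≤ K₁ L_Ψ δ₂ φ₀`
  have hkey : (2 + c₂) * L * δ₂ * φ₀ + c₂ * δ₂ * (E.card * Ψ) ≤ K₁ * LΨ * δ₂ * φ₀ := by
    have h1 : (2 + c₂) * L * δ₂ * φ₀ ≤ K₁ * L * δ₂ * φ₀ := by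
      have : 0 ≤ (L : ℝ) * δ₂ * φ₀ := by positivity
      nlinarith
    have h2 : c₂ * δ₂ * (E.card * Ψ) ≤ K₁ * (c₂ * (E.card * Ψ) / (K₁ * Φ)) * δ₂ * φ₀ := by
      have e : K₁ * (c₂ * (E.card * Ψ) / (K₁ * Φ)) * δ₂ * φ₀ = c₂ * δ₂ * (E.card * Ψ) * (φ₀ / Φ) := by
        field_simp
      rw [e]
      have h3 : 1 ≤ φ₀ / Φ := (one_le_div hΦpos).2 hΦφ₀
      have h0 : 0 ≤ c₂ * δ₂ * (E.card * Ψ) := by positivity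
      exact le_mul_of_one_le_right h0 h3
    calc (2 + c₂) * L * δ₂ * φ₀ + c₂ * δ₂ * (E.card * Ψ) ≤ K₁ * L * δ₂ * φ₀ + K₁ * (c₂ * (E.card * Ψ) / (K₁ * Φ)) * δ₂ * φ₀ := add_le_add h1 h2
      _ = K₁ * LΨ * δ₂ * φ₀ := by rw [hLΨ]; ring
  have hδ₁φ : δ₁ ≤ δ₂ * φ₀ := by rw [hδ₁t]; exact mul_le_mul_of_nonneg_left htφ hδ₂pos.le
  -- reference string data and estimates (frame at `θ₀ = θ_{ρ k₀}`)
  set θc := sectorCenter n' (ρ k₀) with hθc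
  obtain ⟨kk₀, x₀, y₀, hsum₀, hdec₀, hx₀, hy₀⟩ := string_data_target hD h73 R hω₀S
  have hθ₀k₀ : (fun m => sectorCenter n' (ω₀ m)) k₀ = θc := by
    simp only [hθc]; rw [hρ₀ k₀ hk₀i hk₀j]
  have hclose₀ : ∀ m, m ∉ E → pairAngle ((fun m => sectorCenter n' (ω₀ m)) m) ((fun m => sectorCenter n' (ω₀ m)) k₀) ≤ φ₀ :=
    fun m hm => by
      have h1 := hMP₀ m k₀ hm hk₀
      rw [hω₀i, hω₀j] at h1
      exact h1
  have est₀ := string_box_target_prescribed hD hlip hpi hc₂ E k₀ (fun m => sectorCenter n' (ω₀ m)) θc hθ₀k₀ kk₀ x₀ y₀ R hsum₀ hdec₀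
    hx₀ hy₀ hδ₁₂ hδ₁φ hδ₂pos.le hφ₀nn hclose₀ hW₀
  -- the target boxes on the grid
  set D := c₀ * (K₂ * LΨ * δ₂) with hDdef
  have hD0 : 0 ≤ D := by positivity
  obtain ⟨W, hWdef⟩ : ∃ W : ℝ → Finset (Fin (sectorCount n')), ∀ θs, W θs =
      Finset.univ.filter (fun c : Fin (sectorCount n') => torusDist (sectorCenter n' c - θs) ≤ D) :=
    ⟨fun θs => Finset.univ.filter (fun c : Fin (sectorCount n') => torusDist (sectorCenter n' c - θs) ≤ D),
      fun θs => rfl⟩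
  have hWmem : ∀ (θs : ℝ) (c : Fin (sectorCount n')), torusDist (sectorCenter n' c - θs) ≤ D → c ∈ W θs :=
      fun θs c h => by
    rw [hWdef]; exact Finset.mem_filter.2 ⟨Finset.mem_univ _, h⟩
  have hWcard : ∀ θs, ((W θs).card : ℝ) ≤ (2 * c₀ * K₂ * c₃ / π + 1) * LΨ := by
    intro θs
    have h1 := card_centres_torus_le n' θs D hD0
    rw [← hWdef] at h1
    have h2 : 2 * D / sectorWidth n' + 1 = 2 * c₀ * K₂ * c₃ / π * LΨ + 1 := by
      rw [hDdef, hδ₂, sectorWidth_eq_zpow, ← ht]; field_simp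
    rw [h2] at h1
    have h3 : (2 * c₀ * K₂ * c₃ / π + 1) * LΨ = 2 * c₀ * K₂ * c₃ / π * LΨ + LΨ := by ring
    calc ((W θs).card : ℝ) ≤ 2 * c₀ * K₂ * c₃ / π * LΨ + 1 := h1
      _ ≤ (2 * c₀ * K₂ * c₃ / π + 1) * LΨ := by rw [h3]; linarith
  -- every completing pair lands in the boxes
  have hsub : P ⊆ (W (sectorCenter n' a₀) ∪ W (sectorCenter n' b₀)) ×ˢ
      (W (sectorCenter n' a₀) ∪ W (sectorCenter n' b₀)) := by
    rintro ⟨a, b⟩ hab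
    have hφle : pairAngle (sectorCenter n' a) (sectorCenter n' b) ≤ φ₀ := hmax ⟨a, b⟩ hab
    obtain ⟨hΦab, ω, hωS, hMP, hW, hρω, hωi, hωj⟩ := hP _ hab
    have habpos : 0 < pairAngle (sectorCenter n' a) (sectorCenter n' b) :=
      lt_of_le_of_lt (htpos.le.trans hΦt) hΦab
    obtain ⟨kk, x, y, hsum, hdec, hx, hy⟩ := string_data_target hD h73 R hωS
    have hθk₀ : (fun m => sectorCenter n' (ω m)) k₀ = θc := by
      simp only [hθc]; rw [hρω k₀ hk₀i hk₀j]
    have hcloseω : ∀ m, m ∉ E → pairAngle ((fun m => sectorCenter n' (ω m)) m) ((fun m => sectorCenter n' (ω m)) k₀) ≤ φ₀ :=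
      fun m hm => by
        have h1 := hMP m k₀ hm hk₀
        rw [hωi, hωj] at h1
        exact h1.trans hφle
    have est := string_box_target_prescribed hD hlip hpi hc₂ E k₀ (fun m => sectorCenter n' (ω m)) θc hθk₀ kk x y R hsum hdec
      hx hy hδ₁₂ hδ₁φ hδ₂pos.le hφ₀nn hcloseω hW
    -- the difference of the two chord sums
    set r := ∑ m, fermiPoint u (sectorCenter n' (ω m)) - ∑ m, fermiPoint u (sectorCenter n' (ω₀ m)) with hr
    have hF : fermiPoint u (sectorCenter n' a) + fermiPoint u (sectorCenter n' b) =
        fermiPoint u (sectorCenter n' a₀) + fermiPoint u (sectorCenter n' b₀) + r := by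
      have hdiff : r = (fermiPoint u (sectorCenter n' a) - fermiPoint u (sectorCenter n' a₀)) +
          (fermiPoint u (sectorCenter n' b) - fermiPoint u (sectorCenter n' b₀)) := by
        rw [hr, ← Finset.sum_sub_distrib]
        rw [Fintype.sum_eq_add i j hij (fun m hm => by
          show fermiPoint u (sectorCenter n' (ω m)) - fermiPoint u (sectorCenter n' (ω₀ m)) = 0
          rw [hρω m hm.1 hm.2, hρ₀ m hm.1 hm.2, sub_self])]
        rw [hωi, hωj, hω₀i, hω₀j]
      rw [hdiff]; abel
    -- components of `r` in the common frame at `θc`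
    set n₀ := unitNormal u θc 0 with hn₀
    set τ₀ := unitTangent u θc 0 with hτ₀
    have hr' : r = (∑ m, fermiPoint u (sectorCenter n' (ω m)) - R) - (∑ m, fermiPoint u (sectorCenter n' (ω₀ m)) - R) := by
      rw [hr]; abel
    have hrn₀ : |r ⬝ᵥ n₀| ≤ 2 * K₁ * LΨ * δ₂ * φ₀ := by
      rw [hr', sub_dotProduct]
      have := abs_sub ((∑ m, fermiPoint u (sectorCenter n' (ω m)) - R) ⬝ᵥ n₀)
        ((∑ m, fermiPoint u (sectorCenter n' (ω₀ m)) - R) ⬝ᵥ n₀)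
      linarith [est.1, est₀.1, hkey]
    have hrτ₀ : |r ⬝ᵥ τ₀| ≤ 4 * LΨ * δ₂ := by
      rw [hr', sub_dotProduct]
      have := abs_sub ((∑ m, fermiPoint u (sectorCenter n' (ω m)) - R) ⬝ᵥ τ₀)
        ((∑ m, fermiPoint u (sectorCenter n' (ω₀ m)) - R) ⬝ᵥ τ₀)
      have hL4 : 4 * (L : ℝ) * δ₂ ≤ 4 * LΨ * δ₂ := by nlinarith [hLΨL, hδ₂pos.le]
      linarith [est.2, est₀.2]
    -- frame change, Lemma 7.5 and two-to-one
    have hθc' : pairAngle θc (sectorCenter n' a₀) ≤ φ₀ := by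
      have h1 := hMP₀ k₀ i hk₀ hi
      rw [hρ₀ k₀ hk₀i hk₀j, hω₀i, hω₀j] at h1
      exact h1
    have hnear := pair_pinned hD hlip hpi hc₂ hK₁0 hK₂ h75 hLΨ0 hδ₂pos.le r hF hφ₀pos habpos
      hrn₀ hrτ₀ hθc'
      (hΦη'.trans (mul_le_mul_of_nonneg_left hΦ₀.le hc₂'.le)) hη
    rw [Finset.mem_product, Finset.mem_union, Finset.mem_union]
    rcases hnear with ⟨h1, h2⟩ | ⟨h1, h2⟩
    · exact ⟨Or.inl (hWmem _ _ h1), Or.inr (hWmem _ _ h2)⟩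
    · exact ⟨Or.inr (hWmem _ _ h1), Or.inl (hWmem _ _ h2)⟩
  -- count
  have hU : (((W (sectorCenter n' a₀) ∪ W (sectorCenter n' b₀)).card : ℕ) : ℝ) ≤
      2 * ((2 * c₀ * K₂ * c₃ / π + 1) * LΨ) := by
    calc (((W (sectorCenter n' a₀) ∪ W (sectorCenter n' b₀)).card : ℕ) : ℝ)
        ≤ ((W (sectorCenter n' a₀)).card : ℝ) + ((W (sectorCenter n' b₀)).card : ℝ) := by
          exact_mod_cast Finset.card_union_le _ _
      _ ≤ 2 * ((2 * c₀ * K₂ * c₃ / π + 1) * LΨ) := by linarith [hWcard (sectorCenter n' a₀), hWcard (sectorCenter n' b₀)]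
  refine le_max_of_le_left ?_
  calc (P.card : ℝ) ≤ (((W (sectorCenter n' a₀) ∪ W (sectorCenter n' b₀)) ×ˢ
        (W (sectorCenter n' a₀) ∪ W (sectorCenter n' b₀))).card : ℝ) := by
        exact_mod_cast Finset.card_le_card hsub
    _ = (((W (sectorCenter n' a₀) ∪ W (sectorCenter n' b₀)).card : ℝ)) ^ 2 := by
        rw [Finset.card_product]; push_cast; ring
    _ ≤ (2 * ((2 * c₀ * K₂ * c₃ / π + 1) * LΨ)) ^ 2 := pow_le_pow_left₀ (by positivity) hU 2


/-- **One max-pair class, WIDE-bundle variant, with a SET `E` of prescribed legs** (prescribed-set twin of `class_bound_target_wide`; cell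
gate-hubbard-kl, graded redundant class «(R)»): TARGET strings (`Σ k = R`) with `ω e = τ e` for every `e ∈ E` (`|E| + 3 ≤ L`), refining `ωt` off `E`, every
prescribed leg within `Ψ` (mod `π`) of every free leg, with maximal FREE pair `(i, j)` (`i, j ∉ E`) and two free legs `i₀, j₀` at angle `> Φ`: projecting onto the
legs `∉ {i, j}` lands in a product of refinement sets of size `≤ (3·2^{n′−n})^{L−|E|−2}` (the prescribed legs contribute singletons) and each fibre has
`≤ B_fib` elements (`fibre_large_target_prescribed`, `L_Ψ = L + c₂|E|Ψ/(K₁Φ)`) — the second, third, … prescribed legs EACH gain a factor `3·2^{n′−n}` on this class.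
[cite: BenfattoGiulianiMastropietro2003, §7.4 (s1.23)–(s1.25a) p.28 (L33–52)] -/
theorem class_bound_target_wide_prescribed {ε : (Fin 2 → ℝ) → ℝ} {μ e₀ : ℝ} {u : ℝ → ℝ → ℝ} (hD : DispersionHyp ε μ e₀ u) {c₂ c₃ K₁ K₂ c₀ c₂' η₀ : ℝ}
    (hlip : ∀ θ₁ θ₂ : ℝ, torusDist (normalAngle u θ₂ 0 - normalAngle u θ₁ 0) ≤ c₂ * torusDist (θ₂ - θ₁))
    (hpi : ∀ θ : ℝ, normalAngle u (θ + π) 0 = normalAngle u θ 0 + π) (hc₂ : 0 ≤ c₂) (hc₃ : 0 < c₃)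
    (h73 : ∀ (n ω : ℕ), ω < sectorCount n → ∀ p ∈ sSector u e₀ n ω,
      ∃ k₁ k₂ : ℝ,
        p = fermiPoint u (sectorCenter n ω) + k₁ • unitNormal u (sectorCenter n ω) 0 +
              k₂ • unitTangent u (sectorCenter n ω) 0 ∧
        |k₁| ≤ c₃ * (4 : ℝ) ^ (-(n : ℤ)) ∧ |k₂| ≤ c₃ * (2 : ℝ) ^ (-(n : ℤ)) ∧
        |fderiv ℝ ε p (unitTangent u (sectorCenter n ω) 0)| ≤ c₃ * (2 : ℝ) ^ (-(n : ℤ)))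
    (hK₁0 : 0 ≤ K₁)
    (hK₂ : K₂ = K₁ * π + 4) (hc₀ : 0 < c₀) (hc₂' : 0 < c₂') (hη₀ : 0 < η₀)
    (h75 : ∀ θ₁' θ₂' η r₁ r₂ : ℝ, (θ₁', θ₂') ∈ pairChartDomain →
        |r₁| ≤ (2 * K₁ + 4 * c₂) / K₂ * η * pairAngle θ₁' θ₂' → |r₂| ≤ η → η ≤ c₂' * pairAngle θ₁' θ₂' →
          η ≤ η₀ →
          fermiPoint u θ₁' + fermiPoint u θ₂' + (r₁ • unitNormal u θ₁' 0 + r₂ • unitTangent u θ₁' 0)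
              ∈ pairRange u ∧
          ∃ θ₁ θ₂ : ℝ,
            fermiPoint u θ₁' + fermiPoint u θ₂' + (r₁ • unitNormal u θ₁' 0 + r₂ • unitTangent u θ₁' 0) =
              fermiPoint u θ₁ + fermiPoint u θ₂ ∧
            |θ₁ - θ₁'| ≤ c₀ * η ∧ |θ₂ - θ₂'| ≤ c₀ * η)
    {n n' : ℕ} (hn : n ≤ n') {L : ℕ} (E : Finset (Fin L)) (hEL : E.card + 3 ≤ L) (τ : Fin L → Fin (sectorCount n'))
    {ωt : Fin L → ℕ} (hωt : ∀ i, ωt i < sectorCount n)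
    {i j : Fin L} (hij : i ≠ j) (hi : i ∉ E) (hj : j ∉ E)
    (R : Fin 2 → ℝ) {Φ Ψ LΨ Bfib : ℝ} (hΨ : 0 ≤ Ψ) (hK₁c : 2 + c₂ ≤ K₁)
    (hLΨ : LΨ = L + c₂ * (E.card * Ψ) / (K₁ * Φ)) (hΦt : (2 : ℝ) ^ (-(n' : ℤ)) ≤ Φ) (hΦδ : c₃ * (2 : ℝ) ^ (-(n' : ℤ)) ≤ Φ)
    (hΦη : K₂ * LΨ * (c₃ * (2 : ℝ) ^ (-(n' : ℤ))) ≤ c₂' * Φ)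
    (hBfib : max ((2 * ((2 * c₀ * K₂ * c₃ / π + 1) * LΨ)) ^ 2) (4 * c₃ ^ 2 * K₂ ^ 2 / η₀ ^ 2 * LΨ ^ 2) ≤ Bfib)
    {i₀ j₀ : Fin L} (hi₀ : i₀ ∉ E) (hj₀ : j₀ ∉ E)
    (T : Finset (Fin L → Fin (sectorCount n')))
    (hwide : ∀ ω ∈ T, Φ < pairAngle (sectorCenter n' (ω i₀)) (sectorCenter n' (ω j₀)))
    (hT : ∀ ω ∈ T,
      ((∀ e ∈ E, ω e = τ e) ∧ (∀ i' : Fin L, i' ∉ E → sSector u e₀ n' (ω i' : ℕ) ⊆ sSector u e₀ n (ωt i')) ∧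
        ∃ k : Fin L → (Fin 2 → ℝ), (∀ i' : Fin L, k i' ∈ sSector u e₀ n' (ω i' : ℕ)) ∧ ∑ i', k i' = R) ∧
      (∀ m l : Fin L, m ∉ E → l ∉ E →
        pairAngle (sectorCenter n' (ω m)) (sectorCenter n' (ω l)) ≤
          pairAngle (sectorCenter n' (ω i)) (sectorCenter n' (ω j))) ∧
      (∀ e ∈ E, ∀ m : Fin L, m ∉ E → pairAngle (sectorCenter n' (ω e)) (sectorCenter n' (ω m)) ≤ Ψ)) :
    (T.card : ℝ) ≤ Bfib * (3 * (2 : ℝ) ^ (n' - n)) ^ (L - E.card - 2) := by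
  classical
  have hBfib0 : 0 ≤ Bfib := le_trans (le_max_of_le_left (sq_nonneg _)) hBfib
  have htpos : 0 < (2 : ℝ) ^ (-(n' : ℤ)) := zpow_pos (by norm_num) _
  have hΦ0 : 0 ≤ Φ := htpos.le.trans hΦt
  -- a third free leg `k₀ ∉ E`
  have hFc : (Finset.univ.filter (fun m : Fin L => m ∉ E)).card = L - E.card := by
    have h := Finset.card_filter_add_card_filter_not (s := (Finset.univ : Finset (Fin L))) (fun m : Fin L => m ∈ E)
    have hEeq : Finset.univ.filter (fun m : Fin L => m ∈ E) = E := by ext m; simp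
    rw [hEeq, Finset.card_univ, Fintype.card_fin] at h
    omega
  obtain ⟨k₀, hk₀mem⟩ : (((Finset.univ.filter (fun m : Fin L => m ∉ E)).erase i).erase j).Nonempty := by
    rw [← Finset.card_pos]
    have h1 : i ∈ Finset.univ.filter (fun m : Fin L => m ∉ E) := Finset.mem_filter.2 ⟨Finset.mem_univ _, hi⟩
    have h2 : j ∈ (Finset.univ.filter (fun m : Fin L => m ∉ E)).erase i :=
      Finset.mem_erase.2 ⟨hij.symm, Finset.mem_filter.2 ⟨Finset.mem_univ _, hj⟩⟩
    rw [Finset.card_erase_of_mem h2, Finset.card_erase_of_mem h1, hFc]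
    omega
  have hk₀j : k₀ ≠ j := Finset.ne_of_mem_erase hk₀mem
  have hk₀i : k₀ ≠ i := Finset.ne_of_mem_erase (Finset.mem_of_mem_erase hk₀mem)
  have hk₀ : k₀ ∉ E := (Finset.mem_filter.1 (Finset.mem_of_mem_erase (Finset.mem_of_mem_erase hk₀mem))).2
  -- the projection onto the other legs and its target
  set z : Fin (sectorCount n') := ⟨0, sectorCount_pos n'⟩ with hz
  set proj : (Fin L → Fin (sectorCount n')) → (Fin L → Fin (sectorCount n')) :=
    fun ω => Function.update (Function.update ω i z) j z with hproj
  have hproj_i : ∀ ω, proj ω i = z := fun ω => by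
    simp only [hproj]; rw [Function.update_of_ne hij, Function.update_self]
  have hproj_j : ∀ ω, proj ω j = z := fun ω => by simp only [hproj]; rw [Function.update_self]
  have hproj_o : ∀ ω m, m ≠ i → m ≠ j → proj ω m = ω m := fun ω m hmi hmj => by
    simp only [hproj]; rw [Function.update_of_ne hmj, Function.update_of_ne hmi]
  obtain ⟨Ref, hRef⟩ : ∃ Ref : Fin L → Finset (Fin (sectorCount n')),
      ∀ m, Ref m = Finset.univ.filter (fun a : Fin (sectorCount n') => sSector u e₀ n' a ⊆ sSector u e₀ n (ωt m)) :=
    ⟨_, fun m => rfl⟩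
  have hRefcard : ∀ m, (Ref m).card ≤ 3 * 2 ^ (n' - n) := fun m => by
    rw [hRef]; exact card_refinements_le hD hn (hωt m)
  set tf : Fin L → Finset (Fin (sectorCount n')) :=
    fun m => if m = i ∨ m = j then {z} else if m ∈ E then {τ m} else Ref m with htf
  set A := Fintype.piFinset tf with hA
  -- strings of the class project into `A`
  have hmaps : ∀ ω ∈ T, proj ω ∈ A := by
    intro ω hω
    obtain ⟨hωS, -⟩ := hT ω hω
    obtain ⟨hω₁eq, hsub, -⟩ := hωS
    rw [hA, Fintype.mem_piFinset]
    intro m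
    simp only [htf]
    by_cases hm : m = i ∨ m = j
    · rw [if_pos hm, Finset.mem_singleton]
      rcases hm with rfl | rfl
      · exact hproj_i ω
      · exact hproj_j ω
    · rw [if_neg hm]
      rw [not_or] at hm
      rw [hproj_o ω m hm.1 hm.2]
      by_cases hm₁ : m ∈ E
      · rw [if_pos hm₁, Finset.mem_singleton]
        exact hω₁eq m hm₁
      · rw [if_neg hm₁, hRef, Finset.mem_filter]
        exact ⟨Finset.mem_univ _, hsub m hm₁⟩
  -- the fibres: the solved pair
  have hfib : ∀ ρ ∈ A, ((T).filter (fun ω => proj ω = ρ)).card ≤ ⌊Bfib⌋₊ := by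
    intro ρ _
    apply Nat.le_floor
    set F := (T).filter (fun ω => proj ω = ρ) with hFdef
    -- the pair map and its image: every completing pair has angle `> Φ` (wide bundle), so only the far fibre is charged
    set g : (Fin L → Fin (sectorCount n')) → Fin (sectorCount n') × Fin (sectorCount n') := fun ω => (ω i, ω j) with hg
    have hinjg : Set.InjOn g F := by
      intro ω hω ω' hω' hgg
      have h1 : ω i = ω' i := congrArg Prod.fst hgg
      have h2 : ω j = ω' j := congrArg Prod.snd hgg
      have hρ1 := (Finset.mem_filter.1 (Finset.mem_coe.1 hω)).2
      have hρ2 := (Finset.mem_filter.1 (Finset.mem_coe.1 hω')).2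
      funext m
      by_cases hmi : m = i
      · rw [hmi]; exact h1
      by_cases hmj : m = j
      · rw [hmj]; exact h2
      rw [← hproj_o ω m hmi hmj, ← hproj_o ω' m hmi hmj, hρ1, hρ2]
    have hcardF : F.card = (F.image g).card := (Finset.card_image_of_injOn hinjg).symm
    have hEl := fibre_large_target_prescribed hD hlip hpi hc₂ hc₃ h73 hK₁0 hK₂ hc₀ hc₂' hη₀ h75 (by omega) E hij hi hk₀i hk₀j hk₀ ρ R hΨ hK₁c hLΨ hΦt hΦδ hΦη
      (F.image g) (fun ab hab => by
        obtain ⟨ω, hωF, hωab⟩ := Finset.mem_image.1 hab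
        obtain ⟨hωT, hωρ⟩ := Finset.mem_filter.1 hωF
        obtain ⟨⟨-, -, hk⟩, hωMP, hωW⟩ := hT ω hωT
        have hab1 : ω i = ab.1 := congrArg Prod.fst hωab
        have hab2 : ω j = ab.2 := congrArg Prod.snd hωab
        refine ⟨?_, ω, hk, hωMP, fun e he => hωW e he k₀ hk₀, fun m hmi hmj => by rw [← hproj_o ω m hmi hmj, hωρ], hab1, hab2⟩
        rw [← hab1, ← hab2]
        exact (hwide ω hωT).trans_le (hωMP i₀ j₀ hi₀ hj₀))
    rw [hcardF]
    exact hEl.trans hBfib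
  -- the size of the target `A`: (s1.23) for each of the `L - 3` free legs
  have hAcard : A.card ≤ (3 * 2 ^ (n' - n)) ^ (L - E.card - 2) := by
    rw [hA, Fintype.card_piFinset]
    have hle : ∀ m, (tf m).card ≤ if m = i ∨ m = j ∨ m ∈ E then 1 else 3 * 2 ^ (n' - n) := by
      intro m
      simp only [htf]
      by_cases hm : m = i ∨ m = j
      · rw [if_pos hm, if_pos (by tauto), Finset.card_singleton]
      · rw [if_neg hm]
        by_cases hm₁ : m ∈ E
        · rw [if_pos hm₁, if_pos (by tauto), Finset.card_singleton]
        · rw [if_neg hm₁, if_neg (by tauto)]; exact hRefcard m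
    calc ∏ m, (tf m).card ≤ ∏ m : Fin L, (if m = i ∨ m = j ∨ m ∈ E then 1 else 3 * 2 ^ (n' - n)) :=
          Finset.prod_le_prod' fun m _ => hle m
      _ = (3 * 2 ^ (n' - n)) ^ (Finset.univ.filter (fun m : Fin L => ¬(m = i ∨ m = j ∨ m ∈ E))).card := by
          rw [Finset.prod_ite, Finset.prod_const_one, one_mul, Finset.prod_const]
      _ = (3 * 2 ^ (n' - n)) ^ (L - E.card - 2) := by
          congr 1
          have h3 : (Finset.univ.filter (fun m : Fin L => m = i ∨ m = j ∨ m ∈ E)).card = E.card + 2 := by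
            have hset : Finset.univ.filter (fun m : Fin L => m = i ∨ m = j ∨ m ∈ E) = insert i (insert j E) := by
              ext m; simp [Finset.mem_insert]
            have hi' : i ∉ insert j E := by
              rw [Finset.mem_insert, not_or]; exact ⟨hij, hi⟩
            rw [hset, Finset.card_insert_of_notMem hi', Finset.card_insert_of_notMem hj]
          have := Finset.card_filter_add_card_filter_not (s := (Finset.univ : Finset (Fin L)))
            (fun m : Fin L => m = i ∨ m = j ∨ m ∈ E)
          rw [h3, Finset.card_univ, Fintype.card_fin] at this
          omega
  -- assemble the class bound
  have hTle := Finset.card_le_mul_card_image_of_maps_to hmaps (⌊Bfib⌋₊) hfib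
  have h1 : ((T).card : ℝ) ≤ (⌊Bfib⌋₊ : ℝ) * (A.card : ℝ) := by exact_mod_cast hTle
  have h2 : (⌊Bfib⌋₊ : ℝ) ≤ Bfib := Nat.floor_le hBfib0
  have h3 : (A.card : ℝ) ≤ (3 * (2 : ℝ) ^ (n' - n)) ^ (L - E.card - 2) := by exact_mod_cast hAcard
  calc ((T).card : ℝ) ≤ (⌊Bfib⌋₊ : ℝ) * (A.card : ℝ) := h1
    _ ≤ Bfib * (3 * (2 : ℝ) ^ (n' - n)) ^ (L - E.card - 2) :=
        mul_le_mul h2 h3 (by positivity) hBfib0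


/-- **BGM 2003 Lemma 3.1 WITH A TARGET VECTOR, WIDE-bundle variant, SEVERAL prescribed legs** (cell gate-hubbard-kl, graded redundant class «(R)» of
memo TWO-ANCHOR-FALSE / TIGHT-RELCOUNT-LAW): the number of TARGET strings (`Σ k = R`) whose legs in the prescribed set `E` (`|E| + 3 ≤ L`) are fixed to `τ`,
whose free legs refine the coarse string `ωt`, in which every prescribed leg is within `Ψ` (mod `π`) of every free leg and two given FREE legs `i₀, j₀ ∉ E` have pair
angle `> Φ`, is at most `L² · B_fib · (3·2^{n′−n})^{L−|E|−2}` for any regime parameter `Φ` (`2^{−n′} ≤ Φ`, `c₃2^{−n′} ≤ Φ`, `K₂ L_Ψ c₃ 2^{−n′} ≤ c₂′Φ`,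
`L_Ψ = L + c₂|E|Ψ/(K₁Φ)`) and `B_fib ≥ max((2(2c₀K₂c₃/π+1)L_Ψ)², 4c₃²K₂²L_Ψ²/η₀²)`: EVERY prescribed leg beyond the first gains a full `3·2^{n′−n}` as long as the
free legs are spread by more than `Φ` — the honest complement of `count_prescribed_generic` (BGM2003SectorCountingProof) on the classes whose maximal pair meets `E`,
with the transversality of the prescribed legs paid in `L_Ψ` (loss `(1 + c₂|E|Ψ/(K₁LΦ))²`).  For `|E| = 1` this is `count_target_wide`.
[cite: BenfattoGiulianiMastropietro2003, §3.1 Lemma 3.1 (4.3) p.17 (L46–58) and §7.4 (4.3app)–(s1.42) p.28 (L6–125)] -/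
theorem count_target_wide_prescribed {ε : (Fin 2 → ℝ) → ℝ} {μ e₀ : ℝ} {u : ℝ → ℝ → ℝ} (hD : DispersionHyp ε μ e₀ u) {c₂ c₃ K₁ K₂ c₀ c₂' η₀ : ℝ}
    (hlip : ∀ θ₁ θ₂ : ℝ, torusDist (normalAngle u θ₂ 0 - normalAngle u θ₁ 0) ≤ c₂ * torusDist (θ₂ - θ₁))
    (hpi : ∀ θ : ℝ, normalAngle u (θ + π) 0 = normalAngle u θ 0 + π) (hc₂ : 0 ≤ c₂) (hc₃ : 0 < c₃)
    (h73 : ∀ (n ω : ℕ), ω < sectorCount n → ∀ p ∈ sSector u e₀ n ω,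
      ∃ k₁ k₂ : ℝ,
        p = fermiPoint u (sectorCenter n ω) + k₁ • unitNormal u (sectorCenter n ω) 0 +
              k₂ • unitTangent u (sectorCenter n ω) 0 ∧
        |k₁| ≤ c₃ * (4 : ℝ) ^ (-(n : ℤ)) ∧ |k₂| ≤ c₃ * (2 : ℝ) ^ (-(n : ℤ)) ∧
        |fderiv ℝ ε p (unitTangent u (sectorCenter n ω) 0)| ≤ c₃ * (2 : ℝ) ^ (-(n : ℤ)))
    (hK₁0 : 0 ≤ K₁)
    (hK₂ : K₂ = K₁ * π + 4) (hc₀ : 0 < c₀) (hc₂' : 0 < c₂') (hη₀ : 0 < η₀)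
    (h75 : ∀ θ₁' θ₂' η r₁ r₂ : ℝ, (θ₁', θ₂') ∈ pairChartDomain →
        |r₁| ≤ (2 * K₁ + 4 * c₂) / K₂ * η * pairAngle θ₁' θ₂' → |r₂| ≤ η → η ≤ c₂' * pairAngle θ₁' θ₂' →
          η ≤ η₀ →
          fermiPoint u θ₁' + fermiPoint u θ₂' + (r₁ • unitNormal u θ₁' 0 + r₂ • unitTangent u θ₁' 0)
              ∈ pairRange u ∧
          ∃ θ₁ θ₂ : ℝ,
            fermiPoint u θ₁' + fermiPoint u θ₂' + (r₁ • unitNormal u θ₁' 0 + r₂ • unitTangent u θ₁' 0) =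
              fermiPoint u θ₁ + fermiPoint u θ₂ ∧
            |θ₁ - θ₁'| ≤ c₀ * η ∧ |θ₂ - θ₂'| ≤ c₀ * η)
    {n n' : ℕ} (hn : n ≤ n') {L : ℕ} (E : Finset (Fin L)) (hEL : E.card + 3 ≤ L) (τ : Fin L → Fin (sectorCount n'))
    {ωt : Fin L → ℕ} (hωt : ∀ i, ωt i < sectorCount n)
    (R : Fin 2 → ℝ) {Φ Ψ LΨ Bfib : ℝ} (hΨ : 0 ≤ Ψ) (hK₁c : 2 + c₂ ≤ K₁)
    (hLΨ : LΨ = L + c₂ * (E.card * Ψ) / (K₁ * Φ)) (hΦt : (2 : ℝ) ^ (-(n' : ℤ)) ≤ Φ) (hΦδ : c₃ * (2 : ℝ) ^ (-(n' : ℤ)) ≤ Φ)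
    (hΦη : K₂ * LΨ * (c₃ * (2 : ℝ) ^ (-(n' : ℤ))) ≤ c₂' * Φ)
    (hBfib : max ((2 * ((2 * c₀ * K₂ * c₃ / π + 1) * LΨ)) ^ 2) (4 * c₃ ^ 2 * K₂ ^ 2 / η₀ ^ 2 * LΨ ^ 2) ≤ Bfib)
    {i₀ j₀ : Fin L} (hi₀ : i₀ ∉ E) (hj₀ : j₀ ∉ E) :
    (Nat.card {ω : Fin L → Fin (sectorCount n') |
        (∀ e ∈ E, ω e = τ e) ∧ (∀ i' : Fin L, i' ∉ E → sSector u e₀ n' (ω i' : ℕ) ⊆ sSector u e₀ n (ωt i')) ∧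
        (∀ e ∈ E, ∀ m : Fin L, m ∉ E → pairAngle (sectorCenter n' (ω e)) (sectorCenter n' (ω m)) ≤ Ψ) ∧
        Φ < pairAngle (sectorCenter n' (ω i₀)) (sectorCenter n' (ω j₀)) ∧
        ∃ k : Fin L → (Fin 2 → ℝ), (∀ i' : Fin L, k i' ∈ sSector u e₀ n' (ω i' : ℕ)) ∧ ∑ i', k i' = R} : ℝ) ≤
      L ^ 2 * (Bfib * (3 * (2 : ℝ) ^ (n' - n)) ^ (L - E.card - 2)) := by
  classical
  -- the strings as a Finset
  set Str : Set (Fin L → Fin (sectorCount n')) := {ω : Fin L → Fin (sectorCount n') |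
        (∀ e ∈ E, ω e = τ e) ∧ (∀ i' : Fin L, i' ∉ E → sSector u e₀ n' (ω i' : ℕ) ⊆ sSector u e₀ n (ωt i')) ∧
        (∀ e ∈ E, ∀ m : Fin L, m ∉ E → pairAngle (sectorCenter n' (ω e)) (sectorCenter n' (ω m)) ≤ Ψ) ∧
        Φ < pairAngle (sectorCenter n' (ω i₀)) (sectorCenter n' (ω j₀)) ∧
        ∃ k : Fin L → (Fin 2 → ℝ), (∀ i' : Fin L, k i' ∈ sSector u e₀ n' (ω i' : ℕ)) ∧ ∑ i', k i' = R} with hStr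
  set S := Str.toFinset with hS
  have hmemS : ∀ ω, ω ∈ S ↔ ω ∈ Str := fun ω => Set.mem_toFinset
  have hcardS : Nat.card Str = S.card := by
    rw [hS, Nat.card_eq_card_toFinset]
  rw [hcardS]
  -- the classes
  obtain ⟨T, hT⟩ : ∃ T : Fin L × Fin L → Finset (Fin L → Fin (sectorCount n')),
      ∀ p ω, ω ∈ T p ↔ ω ∈ S ∧ ∀ m l : Fin L, m ∉ E → l ∉ E →
        pairAngle (sectorCenter n' (ω m)) (sectorCenter n' (ω l)) ≤
          pairAngle (sectorCenter n' (ω p.1)) (sectorCenter n' (ω p.2)) :=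
    ⟨fun p => S.filter (fun ω => ∀ m l : Fin L, m ∉ E → l ∉ E →
        pairAngle (sectorCenter n' (ω m)) (sectorCenter n' (ω l)) ≤
          pairAngle (sectorCenter n' (ω p.1)) (sectorCenter n' (ω p.2))), fun p ω => Finset.mem_filter⟩
  obtain ⟨Pairs, hPairs⟩ : ∃ Pairs : Finset (Fin L × Fin L),
      ∀ p, p ∈ Pairs ↔ p.1 ≠ p.2 ∧ p.1 ∉ E ∧ p.2 ∉ E :=
    ⟨Finset.univ.filter (fun p : Fin L × Fin L => p.1 ≠ p.2 ∧ p.1 ∉ E ∧ p.2 ∉ E), fun p => by simp⟩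
  -- (s1.22): every string has a maximal pair among the legs `∉ E`
  have hcover : S ⊆ Pairs.biUnion T := by
    intro ω hω
    have hPne : Pairs.Nonempty := by
      have hcard : 1 < (Finset.univ.filter (fun m : Fin L => m ∉ E)).card := by
        have h := Finset.card_filter_add_card_filter_not (s := (Finset.univ : Finset (Fin L))) (fun m : Fin L => m ∈ E)
        have hEeq : Finset.univ.filter (fun m : Fin L => m ∈ E) = E := by ext m; simp
        rw [hEeq, Finset.card_univ, Fintype.card_fin] at h
        omega
      obtain ⟨a, ha, b, hb, hab⟩ := Finset.one_lt_card.1 hcard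
      exact ⟨(a, b), (hPairs _).2 ⟨hab, (Finset.mem_filter.1 ha).2, (Finset.mem_filter.1 hb).2⟩⟩
    obtain ⟨p, hp, hmax⟩ := Pairs.exists_max_image
      (fun q : Fin L × Fin L => pairAngle (sectorCenter n' (ω q.1)) (sectorCenter n' (ω q.2))) hPne
    rw [Finset.mem_biUnion]
    refine ⟨p, hp, (hT p ω).2 ⟨hω, fun m l hm hl => ?_⟩⟩
    by_cases hml : m = l
    · rw [hml, pairAngle_self']; exact (pairAngle_bounds _ _).1
    · exact hmax (m, l) ((hPairs _).2 ⟨hml, hm, hl⟩)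
  -- the bound for one class
  have hclass : ∀ p ∈ Pairs, ((T p).card : ℝ) ≤ Bfib * (3 * (2 : ℝ) ^ (n' - n)) ^ (L - E.card - 2) := by
    rintro ⟨i, j⟩ hp
    obtain ⟨hij, hi, hj⟩ := (hPairs _).1 hp
    exact class_bound_target_wide_prescribed hD hlip hpi hc₂ hc₃ h73 hK₁0 hK₂ hc₀ hc₂' hη₀ h75 hn E hEL τ
      hωt hij hi hj R hΨ hK₁c hLΨ hΦt hΦδ hΦη hBfib hi₀ hj₀ (T (i, j))
      (fun ω hω => by
        obtain ⟨h1, -⟩ := (hT _ ω).1 hω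
        have h1' := (hmemS ω).1 h1
        rw [hStr] at h1'
        exact h1'.2.2.2.1)
      (fun ω hω => by
        obtain ⟨h1, h2⟩ := (hT _ ω).1 hω
        have h1' := (hmemS ω).1 h1
        rw [hStr] at h1'
        obtain ⟨hω₁eq, hsub, hW, -, hk⟩ := h1'
        exact ⟨⟨hω₁eq, hsub, hk⟩, h2, hW⟩)
  -- sum over the classes
  have hPcard : (Pairs.card : ℝ) ≤ L ^ 2 := by
    have : Pairs.card ≤ (Finset.univ : Finset (Fin L × Fin L)).card := Finset.card_le_card (Finset.subset_univ _)
    rw [Finset.card_univ, Fintype.card_prod, Fintype.card_fin] at this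
    exact_mod_cast this.trans_eq (by ring)
  have hBfib0 : 0 ≤ Bfib := le_trans (le_max_of_le_left (sq_nonneg _)) hBfib
  calc (S.card : ℝ) ≤ ((Pairs.biUnion T).card : ℝ) := by exact_mod_cast Finset.card_le_card hcover
    _ ≤ ∑ p ∈ Pairs, ((T p).card : ℝ) := by exact_mod_cast Finset.card_biUnion_le
    _ ≤ ∑ _p ∈ Pairs, Bfib * (3 * (2 : ℝ) ^ (n' - n)) ^ (L - E.card - 2) := Finset.sum_le_sum hclass
    _ = Pairs.card * (Bfib * (3 * (2 : ℝ) ^ (n' - n)) ^ (L - E.card - 2)) := by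
        rw [Finset.sum_const, nsmul_eq_mul]
    _ ≤ L ^ 2 * (Bfib * (3 * (2 : ℝ) ^ (n' - n)) ^ (L - E.card - 2)) := by gcongr

end Target

end BGM2003

end Literature.MathematicalPhysics.QuantumLattice.FermiRG
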